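import Literature.Probability.RandomPlanarGeometry.HexSAWPolygonJoinAssembly
import Literature.Probability.RandomPlanarGeometry.HexSAWPolygonJoinDecode
import Literature.Probability.RandomPlanarGeometry.SAWPolygonTraversal
import Literature.Probability.RandomPlanarGeometry.HexSAWPolygonHorizontalCutShapes
import HarnessLib

/-!
# Junction uniqueness for the capless Madras join on `ℍ`, type T5 (`JU5`): the reflected horizontal double brick is determined by the joined polygon

Topic `Literature/Probability/RandomPlanarGeometry` (lane «pcv-sawmu», a-p4 g14; stub E5a of LINE «HEX-MADRAS», the last of the five junction
types of `HexSAWPolygonJoinAssembly.JunctionUnique`; the `y ↦ −y` mirror of `HexSAWPolygonJunctionUniqueT3` (`ju3`), exactly as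
`HexSAWPolygonJunctionUniqueT4` mirrors `…T2`).

Type T5 is the horizontal double brick with the contact site's vertical bond pointing UP (`HexSAWPolygonJunctions.hdJoin'`: contact site `t` of
`P`, `b = t − (1,0)`; facing site `w′ = t + (2,−1)` of `Q`, `c = t + (3,−1)`; bits `t + (−1,−1) ∈ P`, `t + (3,0) ∈ Q`).  Its junction is the
mirror image `y ↦ −y` of the T3 junction, so a T5 decomposition `(P, Q, t)` of `J = hdJoin' t P Q` forces the MIRRORED traversal
`k ↦ (u_k⁰, −u_k¹)` of `J` to carry the cut predicates of `HexSAWPolygonHorizontalCut(Shapes)` (`IsHdCut`, `IsHdCutTF`, `IsHdCutFT`, `IsHdCutTT`,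
forward; the primed ones backward) — the mirror preserves columns, hence the left/right separation, and `2M`-periodicity and the row hypothesis.
Uniqueness (`isHdCut*_unique`, `not_isHdCut*'_of_isHdCut*`) then applies verbatim to the mirrored traversal.

## Main statements (namespace `…SAW.HexBW.Assembly`)
* `isHdCut_of_isT5` / `isHdCut'_of_isT5`, `isHdCutTF_of_isT5` / …, `isHdCutFT_of_isT5` / …, `isHdCutTT_of_isT5` / … — the bridge
  (mirrored traversal), four shapes, both orientations;
* `hdJoin'_site_unique`; `isT5_shift`, `hdJoin'_shift`; **`ju5 : JU5`**.
[cite: Hammond2015SAPJoining, Definition 4.3 p. 20 and §4.2 pp. 20–24 (arXiv v5: the junction plaquette of the Madras join is recognisable)]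
[cite: Madras1995LatticeAnimalsExponent, §2 (primary, not held)] [cite: MadrasSlade1993, Definition 3.2.1 p. 62; Theorem 3.2.3 proof pp. 64–65].
-/

noncomputable section

open SimpleGraph Finset Literature.Probability.LatticeModels Literature.Probability.Percolation
open Literature.Barriers.CriticalPhenomena.SupercriticalSAW (shiftEdges card_shiftEdges mem_shiftEdges_iff shiftEdges_injective)
open Literature.Probability.Percolation.SiteGadgetSystem (vertsOf mem_vertsOf)

namespace Literature.Probability.RandomPlanarGeometry.SAW

namespace HexBW

namespace Assembly

variable {P Q : Finset (Sym2 (Site 2))} {t : Site 2} {n : ℕ} {u : ℕ → Site 2}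

/-! ### Plumbing -/

/-- `![a, b] 0 = a` (private plumbing). [folklore] -/
@[simp] private theorem uz0 (a b : ℤ) : (![a, b] : Site 2) 0 = a := rfl
/-- `![a, b] 1 = b` (private plumbing). [folklore] -/
@[simp] private theorem uz1 (a b : ℤ) : (![a, b] : Site 2) 1 = b := rfl

/-- the next site of a traversal at a vertex with two known polygon bonds (private plumbing). [cite: MadrasSlade1993, Definition 3.2.1 p. 62 (degree two)] -/
private theorem next_eq₅ {E : Finset (Sym2 (Site 2))} {L : ℕ} (hu : IsPolyTraversal brickWallGraph E L u) (hE : IsPolygon brickWallGraph E)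
    {i : ℕ} {x y : Site 2} (hx : s(u (i + 1), x) ∈ E) (hy : s(u (i + 1), y) ∈ E) (hxy : x ≠ y) (hprev : u i = x) :
    u (i + 2) = y := by
  have hm : s(u (i + 1), u (i + 1 + 1)) ∈ E := hu.mem (i + 1)
  rcases hE.eq_or_eq_of_mem hx hy hxy hm with h | h
  · exact absurd (h.trans hprev.symm) (hu.ne_succ_succ i)
  · exact h

/-- two distinct offsets give distinct sites (private plumbing). [folklore] -/
private theorem off_ne₅ {a b c d : ℤ} (h : (a, b) ≠ (c, d)) : t + ![a, b] ≠ t + ![c, d] := by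
  intro he
  have h0 := congrArg (fun z : Site 2 => z 0) he
  have h1 := congrArg (fun z : Site 2 => z 1) he
  simp at h0 h1
  exact h (Prod.ext h0 h1)

/-- a site with prescribed offsets from `t` (private plumbing). [folklore] -/
private theorem eq_off₅ {x : Site 2} {a b : ℤ} (h0 : x 0 = t 0 + a) (h1 : x 1 = t 1 + b) : x = t + ![a, b] := by
  ext k; fin_cases k <;> simp [h0, h1]

/-- coordinates of a site given by an offset (private plumbing). [folklore] -/
private theorem coord_of_eq₅ {x p : Site 2} {a b : ℤ} (h : x = p + ![a, b]) : x 0 = p 0 + a ∧ x 1 = p 1 + b := by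
  subst h; exact ⟨by simp, by simp⟩

/-- two bonds with different offset endpoints differ (private plumbing). [folklore] -/
private theorem sne₅ {a b c d e f g k : ℤ} (h1 : (c, d) ≠ (g, k) ∨ (a, b) ≠ (e, f)) (h2 : (a, b) ≠ (g, k) ∨ (c, d) ≠ (e, f)) :
    s(t + ![a, b], t + ![c, d]) ≠ s(t + ![e, f], t + ![g, k]) := by
  intro he
  rcases Sym2.eq_iff.1 he with ⟨p1, p2⟩ | ⟨p1, p2⟩
  · rcases h1 with h | h
    · exact off_ne₅ h p2
    · exact off_ne₅ h p1
  · rcases h2 with h | h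
    · exact off_ne₅ h p1
    · exact off_ne₅ h p2

/-- Horizontal bond with prescribed offsets (private plumbing). [cite: EntingJensen2009, §7.4.2, Fig. 7.10 (brickwork form of the honeycomb lattice)] -/
private theorem adjH₅ (t : Site 2) (a b c : ℤ) (h : c = a + 1 ∨ a = c + 1) :
    brickWallGraph.Adj (t + ![a, b]) (t + ![c, b]) := by
  rw [brickWallGraph_adj_coord]; left; simp; omega

/-- Vertical bond with prescribed offsets (private plumbing). [cite: EntingJensen2009, §7.4.2, Fig. 7.10 (brickwork form of the honeycomb lattice)] -/
private theorem adjV₅ (t : Site 2) (a b d : ℤ)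
    (h : (d = b + 1 ∧ (t 0 + t 1 + a + b) % 2 = 0) ∨ (b = d + 1 ∧ (t 0 + t 1 + a + d) % 2 = 0)) :
    brickWallGraph.Adj (t + ![a, b]) (t + ![a, d]) := by
  rw [brickWallGraph_adj_coord]; right
  refine ⟨by simp, ?_⟩
  simp only [Pi.add_apply, uz0, uz1]
  rcases h with ⟨h1, h2⟩ | ⟨h1, h2⟩
  · left; constructor <;> omega
  · right; constructor <;> omega

/-- The brick-wall neighbours of `t + (a,b)` (coordinate form; private plumbing). [cite: EntingJensen2009, §7.4.2, Fig. 7.10] -/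
private theorem nbr₅ (t : Site 2) (a b : ℤ) {y : Site 2} (h : brickWallGraph.Adj (t + ![a, b]) y) :
    y = t + ![a + 1, b] ∨ y = t + ![a - 1, b] ∨
      (y = t + ![a, b + 1] ∧ (t 0 + t 1 + a + b) % 2 = 0) ∨ (y = t + ![a, b - 1] ∧ (t 0 + t 1 + a + b) % 2 = 1) := by
  rw [brickWallGraph_adj_coord] at h
  simp only [Pi.add_apply, uz0, uz1] at h
  rcases h with ⟨h0 | h0, h1⟩ | ⟨h0, ⟨h1, hp⟩ | ⟨h1, hp⟩⟩
  · left; exact eq_off₅ (by omega) (by omega)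
  · right; left; exact eq_off₅ (by omega) (by omega)
  · right; right; left; exact ⟨eq_off₅ (by omega) (by omega), by omega⟩
  · right; right; right; exact ⟨eq_off₅ (by omega) (by omega), by omega⟩

/-- a site on a bond of `E` is a vertex of `E`, left slot (private plumbing). [folklore] -/
private theorem vleft₅ {E : Finset (Sym2 (Site 2))} {v w : Site 2} (h : s(v, w) ∈ E) : v ∈ vertsOf E :=
  mem_vertsOf.2 ⟨_, h, by simp⟩

/-- a site on a bond of `E` is a vertex of `E`, right slot (private plumbing). [folklore] -/
private theorem vright₅ {E : Finset (Sym2 (Site 2))} {v w : Site 2} (h : s(v, w) ∈ E) : w ∈ vertsOf E :=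
  mem_vertsOf.2 ⟨_, h, by simp⟩

/-- **Forced bonds** (degree two): a vertex of a honeycomb polygon with one lattice neighbour off the polygon has its bonds to the other two.
[cite: MadrasSlade1993, Definition 3.2.1 p. 62 (every site of a polygon has exactly two polygon bonds)] -/
private theorem cforced₅ {E : Finset (Sym2 (Site 2))} (hE : IsPolygon brickWallGraph E) {v x y z : Site 2}
    (hv : v ∈ vertsOf E) (hnb : ∀ w, brickWallGraph.Adj v w → w = x ∨ w = y ∨ w = z) (hx : x ∉ vertsOf E) :
    s(v, y) ∈ E ∧ s(v, z) ∈ E := by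
  obtain ⟨b₁, b₂, hne, h₁, h₂, a₁, a₂⟩ := hE.exists_two_edges (mem_vertsOf.1 hv)
  have hb₁ : b₁ ≠ x := fun h => hx (h ▸ vright₅ h₁)
  have hb₂ : b₂ ≠ x := fun h => hx (h ▸ vright₅ h₂)
  rcases hnb b₁ a₁ with rfl | rfl | rfl
  · exact absurd rfl hb₁
  · rcases hnb b₂ a₂ with rfl | rfl | rfl
    · exact absurd rfl hb₂
    · exact absurd rfl hne
    · exact ⟨h₁, h₂⟩
  · rcases hnb b₂ a₂ with rfl | rfl | rfl
    · exact absurd rfl hb₂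
    · exact ⟨h₂, h₁⟩
    · exact absurd rfl hne

/-- a walk's `k`-th bond (private plumbing). [folklore] -/
private theorem getVert_edge₅ {a b : Site 2} (W : brickWallGraph.Walk a b) {k : ℕ} (hk : k < W.length) :
    s(W.getVert k, W.getVert (k + 1)) ∈ W.edges := by
  have hlen : k < W.darts.length := by rw [SimpleGraph.Walk.length_darts]; exact hk
  have hd : W.darts[k] ∈ W.darts := List.getElem_mem hlen
  rw [SimpleGraph.Walk.darts_getElem_eq_getVert k hlen] at hd
  exact List.mem_map.2 ⟨_, hd, rfl⟩

/-! ### The two-step arcs through the dropped corners `b = t − (1,0)` and `c = t + (3,−1)` -/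

/-- `t+(−1,−1) → b → t` (private plumbing). [cite: Hammond2015SAPJoining, Definition 4.3 p. 20 (arXiv v5)] -/
private def wPf₅ (t : Site 2) (h : (t 0 + t 1) % 2 = 0) : brickWallGraph.Walk (t + ![-1, -1]) (t + ![0, 0]) :=
  Walk.cons (adjV₅ t (-1) (-1) 0 (Or.inl ⟨by norm_num, by omega⟩)) (Walk.cons (adjH₅ t (-1) 0 0 (by norm_num)) Walk.nil)

/-- `t → b → t+(−1,−1)` (private plumbing). [cite: Hammond2015SAPJoining, Definition 4.3 p. 20 (arXiv v5)] -/
private def wPb₅ (t : Site 2) (h : (t 0 + t 1) % 2 = 0) : brickWallGraph.Walk (t + ![0, 0]) (t + ![-1, -1]) :=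
  Walk.cons (adjH₅ t 0 0 (-1) (by norm_num)) (Walk.cons (adjV₅ t (-1) 0 (-1) (Or.inr ⟨by norm_num, by omega⟩)) Walk.nil)

/-- `t+(3,0) → c → w′` (private plumbing). [cite: Hammond2015SAPJoining, Definition 4.3 p. 20 (arXiv v5)] -/
private def wQf₅ (t : Site 2) (h : (t 0 + t 1) % 2 = 0) : brickWallGraph.Walk (t + ![3, 0]) (t + ![2, -1]) :=
  Walk.cons (adjV₅ t 3 0 (-1) (Or.inr ⟨by norm_num, by omega⟩)) (Walk.cons (adjH₅ t 3 (-1) 2 (by norm_num)) Walk.nil)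

/-- `w′ → c → t+(3,0)` (private plumbing). [cite: Hammond2015SAPJoining, Definition 4.3 p. 20 (arXiv v5)] -/
private def wQb₅ (t : Site 2) (h : (t 0 + t 1) % 2 = 0) : brickWallGraph.Walk (t + ![2, -1]) (t + ![3, 0]) :=
  Walk.cons (adjH₅ t 2 (-1) 3 (by norm_num)) (Walk.cons (adjV₅ t 3 (-1) 0 (Or.inl ⟨by norm_num, by omega⟩)) Walk.nil)

/-! ### The T3 frame: vertices, forced bonds, membership in the join -/

section Frame

variable (hP : IsPolygon brickWallGraph P) (hQ : IsPolygon brickWallGraph Q) (hK1 : Corridor P Q) (h : IsT5 P Q t)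
include h

/-- `t ∈ P`. [cite: Hammond2015SAPJoining, Definition 4.3 p. 20 (arXiv v5)] -/
private theorem tP₅ : t + ![0, 0] ∈ vertsOf P := vleft₅ h.hl
/-- `b ∈ P`. [cite: Hammond2015SAPJoining, Definition 4.3 p. 20 (arXiv v5)] -/
private theorem bP₅ : t + ![-1, 0] ∈ vertsOf P := vright₅ h.hl
/-- `w′ ∈ Q`. [cite: Hammond2015SAPJoining, Definition 4.3 p. 20 (arXiv v5)] -/
private theorem wQ₅ : t + ![2, -1] ∈ vertsOf Q := vright₅ h.hr
/-- `c ∈ Q`. [cite: Hammond2015SAPJoining, Definition 4.3 p. 20 (arXiv v5)] -/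
private theorem cQ₅ : t + ![3, -1] ∈ vertsOf Q := vleft₅ h.hr

include hP in
/-- the vertical bond of `t` points up and lies on `P` (its right neighbour is free). [cite: MadrasSlade1993, Definition 3.2.1 p. 62 (degree two)] -/
private theorem tup₅ : s(t + ![0, 0], t + ![0, 1]) ∈ P := by
  have hpar := h.hpar
  refine (cforced₅ hP (x := t + ![1, 0]) (y := t + ![-1, 0]) (z := t + ![0, 1]) (tP₅ h) (fun w hw => ?_) h.f10.1).2
  rcases nbr₅ t 0 0 hw with e | e | ⟨e, -⟩ | ⟨e, hp⟩
  · exact Or.inl (by simpa using e)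
  · exact Or.inr (Or.inl (by simpa using e))
  · exact Or.inr (Or.inr (by simpa using e))
  · omega

include hP in
/-- long `P` case: the bond `b – t+(−1,−1)` is forced. [cite: MadrasSlade1993, Definition 3.2.1 p. 62 (degree two)] -/
private theorem forcedP₅ (hv : t + ![-1, -1] ∈ vertsOf P) : s(t + ![-1, -1], t + ![-1, 0]) ∈ P := by
  have hpar := h.hpar
  refine (cforced₅ hP (x := t + ![0, -1]) (y := t + ![-2, -1]) (z := t + ![-1, 0]) hv (fun w hw => ?_) h.f01.1).2
  rcases nbr₅ t (-1) (-1) hw with e | e | ⟨e, -⟩ | ⟨e, hp⟩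
  · exact Or.inl (by simpa using e)
  · exact Or.inr (Or.inl (by simpa using e))
  · exact Or.inr (Or.inr (by simpa using e))
  · omega

include hQ in
/-- long `Q` case: the bond `t+(3,0) – c` is forced. [cite: MadrasSlade1993, Definition 3.2.1 p. 62 (degree two)] -/
private theorem forcedQ₅ (hv : t + ![3, 0] ∈ vertsOf Q) : s(t + ![3, 0], t + ![3, -1]) ∈ Q := by
  have hpar := h.hpar
  refine (cforced₅ hQ (x := t + ![2, 0]) (y := t + ![4, 0]) (z := t + ![3, -1]) hv (fun w hw => ?_) h.f20.2).2
  rcases nbr₅ t 3 0 hw with e | e | ⟨e, hp⟩ | ⟨e, -⟩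
  · exact Or.inr (Or.inl (by simpa using e))
  · exact Or.inl (by simpa using e)
  · omega
  · exact Or.inr (Or.inr (by simpa using e))

include hK1 in
/-- a bond of `P` other than the two cluster-boundary bonds at `b` lies on the join. [cite: Hammond2015SAPJoining, Definition 4.3 p. 20 (arXiv v5: «(τ ∪ σ) Δ ∂C»)] -/
private theorem memJ_of_memP₅ {e : Sym2 (Site 2)} (he : e ∈ P) (h1 : e ≠ s(t + ![0, 0], t + ![-1, 0]))
    (h2 : t + ![-1, -1] ∈ vertsOf P → e ≠ s(t + ![-1, 0], t + ![-1, -1])) : e ∈ hdJoin' t P Q := by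
  classical
  have hdisj := disjoint_of_corridor (P := P) (Q := Q) hK1
  rw [hdJoin', Finset.mem_symmDiff]
  refine Or.inl ⟨Finset.mem_union_left _ he, fun hB => ?_⟩
  simp only [hdBoundary', Finset.mem_insert, Finset.mem_singleton] at hB
  rcases hB with rfl | rfl | rfl | rfl | rfl | rfl | rfl | rfl | rfl | rfl
  · exact h1 rfl
  · exact h2 (vright₅ he) rfl
  · exact h.f01.1 (vright₅ he)
  · exact h.f01.1 (vleft₅ he)
  · exact h.f11.1 (vleft₅ he)
  · exact hdisj _ (vright₅ he) (wQ₅ h)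
  · exact h.f30 (vleft₅ he)
  · exact h.f10.1 (vright₅ he)
  · exact h.f10.1 (vleft₅ he)
  · exact h.f20.1 (vleft₅ he)

include hK1 in
/-- a bond of `Q` other than the two cluster-boundary bonds at `c` lies on the join. [cite: Hammond2015SAPJoining, Definition 4.3 p. 20 (arXiv v5)] -/
private theorem memJ_of_memQ₅ {e : Sym2 (Site 2)} (he : e ∈ Q) (h1 : e ≠ s(t + ![3, -1], t + ![2, -1]))
    (h2 : t + ![3, 0] ∈ vertsOf Q → e ≠ s(t + ![3, 0], t + ![3, -1])) : e ∈ hdJoin' t P Q := by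
  classical
  have hdisj := disjoint_of_corridor (P := P) (Q := Q) hK1
  rw [hdJoin', Finset.mem_symmDiff]
  refine Or.inl ⟨Finset.mem_union_right _ he, fun hB => ?_⟩
  simp only [hdBoundary', Finset.mem_insert, Finset.mem_singleton] at hB
  rcases hB with rfl | rfl | rfl | rfl | rfl | rfl | rfl | rfl | rfl | rfl
  · exact hdisj _ (tP₅ h) (vleft₅ he)
  · exact h.fm1 (vright₅ he)
  · exact h.f01.2 (vright₅ he)
  · exact h.f01.2 (vleft₅ he)
  · exact h.f11.2 (vleft₅ he)
  · exact h1 rfl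
  · exact h2 (vleft₅ he) rfl
  · exact h.f10.2 (vright₅ he)
  · exact h.f10.2 (vleft₅ he)
  · exact h.f20.2 (vleft₅ he)

omit h in
/-- a cluster-boundary bond on neither polygon lies on the join (private plumbing). [cite: Hammond2015SAPJoining, Definition 4.3 p. 20 (arXiv v5)] -/
private theorem memJ_of_bdry₅ {x y : Site 2} (hB : s(x, y) ∈ hdBoundary' t) (hxP : x ∉ vertsOf P ∨ y ∉ vertsOf P)
    (hxQ : x ∉ vertsOf Q ∨ y ∉ vertsOf Q) : s(x, y) ∈ hdJoin' t P Q := by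
  classical
  rw [hdJoin', Finset.mem_symmDiff]
  refine Or.inr ⟨hB, fun hm => ?_⟩
  rcases Finset.mem_union.1 hm with hm | hm
  · rcases hxP with hx | hx
    · exact hx (vleft₅ hm)
    · exact hx (vright₅ hm)
  · rcases hxQ with hx | hx
    · exact hx (vleft₅ hm)
    · exact hx (vright₅ hm)

/-- connector `t – t+(1,0)`. [cite: Hammond2015SAPJoining, Definition 4.3 p. 20 (arXiv v5)] -/
private theorem cJ1₅ : s(t + ![0, 0], t + ![1, 0]) ∈ hdJoin' t P Q :=
  memJ_of_bdry₅ (by simp [hdBoundary']) (Or.inr h.f10.1) (Or.inr h.f10.2)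
/-- connector `t+(1,0) – t+(2,0)`. [cite: Hammond2015SAPJoining, Definition 4.3 p. 20 (arXiv v5)] -/
private theorem cJ2₅ : s(t + ![1, 0], t + ![2, 0]) ∈ hdJoin' t P Q :=
  memJ_of_bdry₅ (by simp [hdBoundary']) (Or.inl h.f10.1) (Or.inl h.f10.2)
/-- connector `t+(2,0) – t+(3,0)`. [cite: Hammond2015SAPJoining, Definition 4.3 p. 20 (arXiv v5)] -/
private theorem cJ3₅ : s(t + ![2, 0], t + ![3, 0]) ∈ hdJoin' t P Q :=
  memJ_of_bdry₅ (by simp [hdBoundary']) (Or.inl h.f20.1) (Or.inl h.f20.2)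
/-- connector `t+(−1,−1) – t+(0,-1)`. [cite: Hammond2015SAPJoining, Definition 4.3 p. 20 (arXiv v5)] -/
private theorem cJ4₅ : s(t + ![-1, -1], t + ![0, -1]) ∈ hdJoin' t P Q :=
  memJ_of_bdry₅ (by simp [hdBoundary']) (Or.inr h.f01.1) (Or.inr h.f01.2)
/-- connector `t+(0,-1) – t+(1,-1)`. [cite: Hammond2015SAPJoining, Definition 4.3 p. 20 (arXiv v5)] -/
private theorem cJ5₅ : s(t + ![0, -1], t + ![1, -1]) ∈ hdJoin' t P Q :=
  memJ_of_bdry₅ (by simp [hdBoundary']) (Or.inl h.f01.1) (Or.inl h.f01.2)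
/-- connector `t+(1,-1) – w′`. [cite: Hammond2015SAPJoining, Definition 4.3 p. 20 (arXiv v5)] -/
private theorem cJ6₅ : s(t + ![1, -1], t + ![2, -1]) ∈ hdJoin' t P Q :=
  memJ_of_bdry₅ (by simp [hdBoundary']) (Or.inl h.f11.1) (Or.inl h.f11.2)
/-- connector `b – t+(−1,−1)` (short `P` case). [cite: Hammond2015SAPJoining, Definition 4.3 p. 20 (arXiv v5)] -/
private theorem cJb₅ (hjP : t + ![-1, -1] ∉ vertsOf P) : s(t + ![-1, 0], t + ![-1, -1]) ∈ hdJoin' t P Q :=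
  memJ_of_bdry₅ (by simp [hdBoundary']) (Or.inr hjP) (Or.inr h.fm1)
/-- connector `t+(3,0) – c` (short `Q` case). [cite: Hammond2015SAPJoining, Definition 4.3 p. 20 (arXiv v5)] -/
private theorem cJc₅ (hjQ : t + ![3, 0] ∉ vertsOf Q) : s(t + ![3, 0], t + ![3, -1]) ∈ hdJoin' t P Q :=
  memJ_of_bdry₅ (by simp [hdBoundary']) (Or.inl h.f30) (Or.inl hjQ)

include hP hK1 in
/-- the up bond of `t` lies on the join. [cite: Hammond2015SAPJoining, Definition 4.3 p. 20 (arXiv v5)] -/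
private theorem tupJ₅ : s(t + ![0, 0], t + ![0, 1]) ∈ hdJoin' t P Q :=
  memJ_of_memP₅ hK1 h (tup₅ hP h) (sne₅ (Or.inl (by decide)) (Or.inl (by decide))) (fun _ => sne₅ (Or.inl (by decide)) (Or.inl (by decide)))

end Frame

/-! ### The bridge: a T5 decomposition imposes the horizontal cut on the mirror of every traversal -/

/-- `IsHdCut` of the MIRRORED sequence from the junction values of a T5 reading (private plumbing). [cite: Hammond2015SAPJoining, Definition 4.3 p. 20 (arXiv v5)] -/
private theorem isHdCut_of_eqs_mirror {M j : ℕ} {v : ℕ → Site 2} (p : Site 2)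
    (h0 : v j = p + ![-1, 0]) (h1 : v (j + M - 4) = p + ![0, 0]) (h2 : v (j + M - 3) = p + ![1, 0]) (h3 : v (j + M - 2) = p + ![2, 0])
    (h4 : v (j + M - 1) = p + ![3, 0]) (h5 : v (j + M) = p + ![3, -1]) (h6 : v (j + 2 * M - 4) = p + ![2, -1])
    (h7 : v (j + 2 * M - 3) = p + ![1, -1]) (h8 : v (j + 2 * M - 2) = p + ![0, -1]) (h9 : v (j + 2 * M - 1) = p + ![-1, -1])
    (sep : ∀ a b : ℕ, j ≤ a → a < j + M → j + M ≤ b → b < j + 2 * M → v a 1 = v b 1 → v a 0 < v b 0) :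
    IsHdCut M (fun k => ![v k 0, -(v k 1)]) j := by
  obtain ⟨e0, e1⟩ := coord_of_eq₅ h0
  obtain ⟨f10, f11⟩ := coord_of_eq₅ h1
  obtain ⟨f20, f21⟩ := coord_of_eq₅ h2
  obtain ⟨f30, f31⟩ := coord_of_eq₅ h3
  obtain ⟨f40, f41⟩ := coord_of_eq₅ h4
  obtain ⟨f50, f51⟩ := coord_of_eq₅ h5
  obtain ⟨f60, f61⟩ := coord_of_eq₅ h6
  obtain ⟨f70, f71⟩ := coord_of_eq₅ h7
  obtain ⟨f80, f81⟩ := coord_of_eq₅ h8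
  obtain ⟨f90, f91⟩ := coord_of_eq₅ h9
  refine ⟨⟨?_, ?_⟩, ⟨?_, ?_⟩, ⟨?_, ?_⟩, ⟨?_, ?_⟩, ⟨?_, ?_⟩, ⟨?_, ?_⟩, ⟨?_, ?_⟩, ⟨?_, ?_⟩, ⟨?_, ?_⟩, ?_⟩
  · simp only [uz0]; omega
  · simp only [uz1]; omega
  · simp only [uz0]; omega
  · simp only [uz1]; omega
  · simp only [uz0]; omega
  · simp only [uz1]; omega
  · simp only [uz0]; omega
  · simp only [uz1]; omega
  · simp only [uz0]; omega
  · simp only [uz1]; omega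
  · simp only [uz0]; omega
  · simp only [uz1]; omega
  · simp only [uz0]; omega
  · simp only [uz1]; omega
  · simp only [uz0]; omega
  · simp only [uz1]; omega
  · simp only [uz0]; omega
  · simp only [uz1]; omega
  · intro a b ha1 ha2 hb1 hb2 hr
    simp only [uz0, uz1, neg_inj] at hr ⊢
    exact sep a b ha1 ha2 hb1 hb2 hr

/-- `IsHdCut'` of the MIRRORED sequence from the junction values of a T5 reading (private plumbing). [cite: Hammond2015SAPJoining, Definition 4.3 p. 20 (arXiv v5)] -/
private theorem isHdCut'_of_eqs_mirror {M j : ℕ} {v : ℕ → Site 2} (p : Site 2)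
    (h0 : v j = p + ![-1, -1]) (h1 : v (j + 1) = p + ![0, -1]) (h2 : v (j + 2) = p + ![1, -1]) (h3 : v (j + 3) = p + ![2, -1])
    (h4 : v (j + M - 1) = p + ![3, -1]) (h5 : v (j + M) = p + ![3, 0]) (h6 : v (j + M + 1) = p + ![2, 0]) (h7 : v (j + M + 2) = p + ![1, 0])
    (h8 : v (j + M + 3) = p + ![0, 0]) (h9 : v (j + 2 * M - 1) = p + ![-1, 0])
    (sep : ∀ a b : ℕ, j ≤ a → a < j + M → j + M ≤ b → b < j + 2 * M → v a 1 = v b 1 → v b 0 < v a 0) :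
    IsHdCut' M (fun k => ![v k 0, -(v k 1)]) j := by
  obtain ⟨e0, e1⟩ := coord_of_eq₅ h0
  obtain ⟨f10, f11⟩ := coord_of_eq₅ h1
  obtain ⟨f20, f21⟩ := coord_of_eq₅ h2
  obtain ⟨f30, f31⟩ := coord_of_eq₅ h3
  obtain ⟨f40, f41⟩ := coord_of_eq₅ h4
  obtain ⟨f50, f51⟩ := coord_of_eq₅ h5
  obtain ⟨f60, f61⟩ := coord_of_eq₅ h6
  obtain ⟨f70, f71⟩ := coord_of_eq₅ h7
  obtain ⟨f80, f81⟩ := coord_of_eq₅ h8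
  obtain ⟨f90, f91⟩ := coord_of_eq₅ h9
  refine ⟨⟨?_, ?_⟩, ⟨?_, ?_⟩, ⟨?_, ?_⟩, ⟨?_, ?_⟩, ⟨?_, ?_⟩, ⟨?_, ?_⟩, ⟨?_, ?_⟩, ⟨?_, ?_⟩, ⟨?_, ?_⟩, ?_⟩
  · simp only [uz0]; omega
  · simp only [uz1]; omega
  · simp only [uz0]; omega
  · simp only [uz1]; omega
  · simp only [uz0]; omega
  · simp only [uz1]; omega
  · simp only [uz0]; omega
  · simp only [uz1]; omega
  · simp only [uz0]; omega
  · simp only [uz1]; omega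
  · simp only [uz0]; omega
  · simp only [uz1]; omega
  · simp only [uz0]; omega
  · simp only [uz1]; omega
  · simp only [uz0]; omega
  · simp only [uz1]; omega
  · simp only [uz0]; omega
  · simp only [uz1]; omega
  · intro a b ha1 ha2 hb1 hb2 hr
    simp only [uz0, uz1, neg_inj] at hr ⊢
    exact sep a b ha1 ha2 hb1 hb2 hr

/-- `IsHdCutTF` of the MIRRORED sequence from the junction values of a T5 reading (private plumbing). [cite: Hammond2015SAPJoining, Definition 4.3 p. 20 (arXiv v5)] -/
private theorem isHdCutTF_of_eqs_mirror {M j : ℕ} {v : ℕ → Site 2} (p : Site 2)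
    (h0 : v j = p + ![-1, -1]) (h1 : v (j + M - 4) = p + ![0, 0]) (h2 : v (j + M - 3) = p + ![1, 0]) (h3 : v (j + M - 2) = p + ![2, 0])
    (h4 : v (j + M - 1) = p + ![3, 0]) (h5 : v (j + M) = p + ![3, -1]) (h6 : v (j + 2 * M - 3) = p + ![2, -1])
    (h7 : v (j + 2 * M - 2) = p + ![1, -1]) (h8 : v (j + 2 * M - 1) = p + ![0, -1])
    (sep : ∀ a b : ℕ, j ≤ a → a < j + M → j + M ≤ b → b < j + 2 * M → v a 1 = v b 1 → v a 0 < v b 0) :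
    IsHdCutTF M (fun k => ![v k 0, -(v k 1)]) j := by
  obtain ⟨e0, e1⟩ := coord_of_eq₅ h0
  obtain ⟨f10, f11⟩ := coord_of_eq₅ h1
  obtain ⟨f20, f21⟩ := coord_of_eq₅ h2
  obtain ⟨f30, f31⟩ := coord_of_eq₅ h3
  obtain ⟨f40, f41⟩ := coord_of_eq₅ h4
  obtain ⟨f50, f51⟩ := coord_of_eq₅ h5
  obtain ⟨f60, f61⟩ := coord_of_eq₅ h6
  obtain ⟨f70, f71⟩ := coord_of_eq₅ h7
  obtain ⟨f80, f81⟩ := coord_of_eq₅ h8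
  refine ⟨⟨?_, ?_⟩, ⟨?_, ?_⟩, ⟨?_, ?_⟩, ⟨?_, ?_⟩, ⟨?_, ?_⟩, ⟨?_, ?_⟩, ⟨?_, ?_⟩, ⟨?_, ?_⟩, ?_⟩
  · simp only [uz0]; omega
  · simp only [uz1]; omega
  · simp only [uz0]; omega
  · simp only [uz1]; omega
  · simp only [uz0]; omega
  · simp only [uz1]; omega
  · simp only [uz0]; omega
  · simp only [uz1]; omega
  · simp only [uz0]; omega
  · simp only [uz1]; omega
  · simp only [uz0]; omega
  · simp only [uz1]; omega
  · simp only [uz0]; omega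
  · simp only [uz1]; omega
  · simp only [uz0]; omega
  · simp only [uz1]; omega
  · intro a b ha1 ha2 hb1 hb2 hr
    simp only [uz0, uz1, neg_inj] at hr ⊢
    exact sep a b ha1 ha2 hb1 hb2 hr

/-- `IsHdCutTF'` of the MIRRORED sequence from the junction values of a T5 reading (private plumbing). [cite: Hammond2015SAPJoining, Definition 4.3 p. 20 (arXiv v5)] -/
private theorem isHdCutTF'_of_eqs_mirror {M j : ℕ} {v : ℕ → Site 2} (p : Site 2)
    (h0 : v j = p + ![0, -1]) (h1 : v (j + 1) = p + ![1, -1]) (h2 : v (j + 2) = p + ![2, -1]) (h3 : v (j + M - 1) = p + ![3, -1])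
    (h4 : v (j + M) = p + ![3, 0]) (h5 : v (j + M + 1) = p + ![2, 0]) (h6 : v (j + M + 2) = p + ![1, 0]) (h7 : v (j + M + 3) = p + ![0, 0])
    (h8 : v (j + 2 * M - 1) = p + ![-1, -1])
    (sep : ∀ a b : ℕ, j ≤ a → a < j + M → j + M ≤ b → b < j + 2 * M → v a 1 = v b 1 → v b 0 < v a 0) :
    IsHdCutTF' M (fun k => ![v k 0, -(v k 1)]) j := by
  obtain ⟨e0, e1⟩ := coord_of_eq₅ h0
  obtain ⟨f10, f11⟩ := coord_of_eq₅ h1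
  obtain ⟨f20, f21⟩ := coord_of_eq₅ h2
  obtain ⟨f30, f31⟩ := coord_of_eq₅ h3
  obtain ⟨f40, f41⟩ := coord_of_eq₅ h4
  obtain ⟨f50, f51⟩ := coord_of_eq₅ h5
  obtain ⟨f60, f61⟩ := coord_of_eq₅ h6
  obtain ⟨f70, f71⟩ := coord_of_eq₅ h7
  obtain ⟨f80, f81⟩ := coord_of_eq₅ h8
  refine ⟨⟨?_, ?_⟩, ⟨?_, ?_⟩, ⟨?_, ?_⟩, ⟨?_, ?_⟩, ⟨?_, ?_⟩, ⟨?_, ?_⟩, ⟨?_, ?_⟩, ⟨?_, ?_⟩, ?_⟩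
  · simp only [uz0]; omega
  · simp only [uz1]; omega
  · simp only [uz0]; omega
  · simp only [uz1]; omega
  · simp only [uz0]; omega
  · simp only [uz1]; omega
  · simp only [uz0]; omega
  · simp only [uz1]; omega
  · simp only [uz0]; omega
  · simp only [uz1]; omega
  · simp only [uz0]; omega
  · simp only [uz1]; omega
  · simp only [uz0]; omega
  · simp only [uz1]; omega
  · simp only [uz0]; omega
  · simp only [uz1]; omega
  · intro a b ha1 ha2 hb1 hb2 hr
    simp only [uz0, uz1, neg_inj] at hr ⊢
    exact sep a b ha1 ha2 hb1 hb2 hr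

/-- `IsHdCutFT` of the MIRRORED sequence from the junction values of a T5 reading (private plumbing). [cite: Hammond2015SAPJoining, Definition 4.3 p. 20 (arXiv v5)] -/
private theorem isHdCutFT_of_eqs_mirror {M j : ℕ} {v : ℕ → Site 2} (p : Site 2)
    (h0 : v j = p + ![-1, 0]) (h1 : v (j + M - 3) = p + ![0, 0]) (h2 : v (j + M - 2) = p + ![1, 0]) (h3 : v (j + M - 1) = p + ![2, 0])
    (h4 : v (j + M) = p + ![3, 0]) (h5 : v (j + 2 * M - 4) = p + ![2, -1]) (h6 : v (j + 2 * M - 3) = p + ![1, -1])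
    (h7 : v (j + 2 * M - 2) = p + ![0, -1]) (h8 : v (j + 2 * M - 1) = p + ![-1, -1])
    (sep : ∀ a b : ℕ, j ≤ a → a < j + M → j + M ≤ b → b < j + 2 * M → v a 1 = v b 1 → v a 0 < v b 0) :
    IsHdCutFT M (fun k => ![v k 0, -(v k 1)]) j := by
  obtain ⟨e0, e1⟩ := coord_of_eq₅ h0
  obtain ⟨f10, f11⟩ := coord_of_eq₅ h1
  obtain ⟨f20, f21⟩ := coord_of_eq₅ h2
  obtain ⟨f30, f31⟩ := coord_of_eq₅ h3
  obtain ⟨f40, f41⟩ := coord_of_eq₅ h4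
  obtain ⟨f50, f51⟩ := coord_of_eq₅ h5
  obtain ⟨f60, f61⟩ := coord_of_eq₅ h6
  obtain ⟨f70, f71⟩ := coord_of_eq₅ h7
  obtain ⟨f80, f81⟩ := coord_of_eq₅ h8
  refine ⟨⟨?_, ?_⟩, ⟨?_, ?_⟩, ⟨?_, ?_⟩, ⟨?_, ?_⟩, ⟨?_, ?_⟩, ⟨?_, ?_⟩, ⟨?_, ?_⟩, ⟨?_, ?_⟩, ?_⟩
  · simp only [uz0]; omega
  · simp only [uz1]; omega
  · simp only [uz0]; omega
  · simp only [uz1]; omega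
  · simp only [uz0]; omega
  · simp only [uz1]; omega
  · simp only [uz0]; omega
  · simp only [uz1]; omega
  · simp only [uz0]; omega
  · simp only [uz1]; omega
  · simp only [uz0]; omega
  · simp only [uz1]; omega
  · simp only [uz0]; omega
  · simp only [uz1]; omega
  · simp only [uz0]; omega
  · simp only [uz1]; omega
  · intro a b ha1 ha2 hb1 hb2 hr
    simp only [uz0, uz1, neg_inj] at hr ⊢
    exact sep a b ha1 ha2 hb1 hb2 hr

/-- `IsHdCutFT'` of the MIRRORED sequence from the junction values of a T5 reading (private plumbing). [cite: Hammond2015SAPJoining, Definition 4.3 p. 20 (arXiv v5)] -/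
private theorem isHdCutFT'_of_eqs_mirror {M j : ℕ} {v : ℕ → Site 2} (p : Site 2)
    (h0 : v j = p + ![-1, -1]) (h1 : v (j + 1) = p + ![0, -1]) (h2 : v (j + 2) = p + ![1, -1]) (h3 : v (j + 3) = p + ![2, -1])
    (h4 : v (j + M - 1) = p + ![3, 0]) (h5 : v (j + M) = p + ![2, 0]) (h6 : v (j + M + 1) = p + ![1, 0]) (h7 : v (j + M + 2) = p + ![0, 0])
    (h8 : v (j + 2 * M - 1) = p + ![-1, 0])
    (sep : ∀ a b : ℕ, j ≤ a → a < j + M → j + M ≤ b → b < j + 2 * M → v a 1 = v b 1 → v b 0 < v a 0) :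
    IsHdCutFT' M (fun k => ![v k 0, -(v k 1)]) j := by
  obtain ⟨e0, e1⟩ := coord_of_eq₅ h0
  obtain ⟨f10, f11⟩ := coord_of_eq₅ h1
  obtain ⟨f20, f21⟩ := coord_of_eq₅ h2
  obtain ⟨f30, f31⟩ := coord_of_eq₅ h3
  obtain ⟨f40, f41⟩ := coord_of_eq₅ h4
  obtain ⟨f50, f51⟩ := coord_of_eq₅ h5
  obtain ⟨f60, f61⟩ := coord_of_eq₅ h6
  obtain ⟨f70, f71⟩ := coord_of_eq₅ h7
  obtain ⟨f80, f81⟩ := coord_of_eq₅ h8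
  refine ⟨⟨?_, ?_⟩, ⟨?_, ?_⟩, ⟨?_, ?_⟩, ⟨?_, ?_⟩, ⟨?_, ?_⟩, ⟨?_, ?_⟩, ⟨?_, ?_⟩, ⟨?_, ?_⟩, ?_⟩
  · simp only [uz0]; omega
  · simp only [uz1]; omega
  · simp only [uz0]; omega
  · simp only [uz1]; omega
  · simp only [uz0]; omega
  · simp only [uz1]; omega
  · simp only [uz0]; omega
  · simp only [uz1]; omega
  · simp only [uz0]; omega
  · simp only [uz1]; omega
  · simp only [uz0]; omega
  · simp only [uz1]; omega
  · simp only [uz0]; omega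
  · simp only [uz1]; omega
  · simp only [uz0]; omega
  · simp only [uz1]; omega
  · intro a b ha1 ha2 hb1 hb2 hr
    simp only [uz0, uz1, neg_inj] at hr ⊢
    exact sep a b ha1 ha2 hb1 hb2 hr

/-- `IsHdCutTT` of the MIRRORED sequence from the junction values of a T5 reading (private plumbing). [cite: Hammond2015SAPJoining, Definition 4.3 p. 20 (arXiv v5)] -/
private theorem isHdCutTT_of_eqs_mirror {M j : ℕ} {v : ℕ → Site 2} (p : Site 2)
    (h0 : v j = p + ![-1, -1]) (h1 : v (j + M - 3) = p + ![0, 0]) (h2 : v (j + M - 2) = p + ![1, 0]) (h3 : v (j + M - 1) = p + ![2, 0])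
    (h4 : v (j + M) = p + ![3, 0]) (h5 : v (j + 2 * M - 3) = p + ![2, -1]) (h6 : v (j + 2 * M - 2) = p + ![1, -1])
    (h7 : v (j + 2 * M - 1) = p + ![0, -1])
    (sep : ∀ a b : ℕ, j ≤ a → a < j + M → j + M ≤ b → b < j + 2 * M → v a 1 = v b 1 → v a 0 < v b 0) :
    IsHdCutTT M (fun k => ![v k 0, -(v k 1)]) j := by
  obtain ⟨e0, e1⟩ := coord_of_eq₅ h0
  obtain ⟨f10, f11⟩ := coord_of_eq₅ h1
  obtain ⟨f20, f21⟩ := coord_of_eq₅ h2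
  obtain ⟨f30, f31⟩ := coord_of_eq₅ h3
  obtain ⟨f40, f41⟩ := coord_of_eq₅ h4
  obtain ⟨f50, f51⟩ := coord_of_eq₅ h5
  obtain ⟨f60, f61⟩ := coord_of_eq₅ h6
  obtain ⟨f70, f71⟩ := coord_of_eq₅ h7
  refine ⟨⟨?_, ?_⟩, ⟨?_, ?_⟩, ⟨?_, ?_⟩, ⟨?_, ?_⟩, ⟨?_, ?_⟩, ⟨?_, ?_⟩, ⟨?_, ?_⟩, ?_⟩
  · simp only [uz0]; omega
  · simp only [uz1]; omega
  · simp only [uz0]; omega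
  · simp only [uz1]; omega
  · simp only [uz0]; omega
  · simp only [uz1]; omega
  · simp only [uz0]; omega
  · simp only [uz1]; omega
  · simp only [uz0]; omega
  · simp only [uz1]; omega
  · simp only [uz0]; omega
  · simp only [uz1]; omega
  · simp only [uz0]; omega
  · simp only [uz1]; omega
  · intro a b ha1 ha2 hb1 hb2 hr
    simp only [uz0, uz1, neg_inj] at hr ⊢
    exact sep a b ha1 ha2 hb1 hb2 hr

/-- `IsHdCutTT'` of the MIRRORED sequence from the junction values of a T5 reading (private plumbing). [cite: Hammond2015SAPJoining, Definition 4.3 p. 20 (arXiv v5)] -/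
private theorem isHdCutTT'_of_eqs_mirror {M j : ℕ} {v : ℕ → Site 2} (p : Site 2)
    (h0 : v j = p + ![0, -1]) (h1 : v (j + 1) = p + ![1, -1]) (h2 : v (j + 2) = p + ![2, -1]) (h3 : v (j + M - 1) = p + ![3, 0])
    (h4 : v (j + M) = p + ![2, 0]) (h5 : v (j + M + 1) = p + ![1, 0]) (h6 : v (j + M + 2) = p + ![0, 0]) (h7 : v (j + 2 * M - 1) = p + ![-1, -1])
    (sep : ∀ a b : ℕ, j ≤ a → a < j + M → j + M ≤ b → b < j + 2 * M → v a 1 = v b 1 → v b 0 < v a 0) :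
    IsHdCutTT' M (fun k => ![v k 0, -(v k 1)]) j := by
  obtain ⟨e0, e1⟩ := coord_of_eq₅ h0
  obtain ⟨f10, f11⟩ := coord_of_eq₅ h1
  obtain ⟨f20, f21⟩ := coord_of_eq₅ h2
  obtain ⟨f30, f31⟩ := coord_of_eq₅ h3
  obtain ⟨f40, f41⟩ := coord_of_eq₅ h4
  obtain ⟨f50, f51⟩ := coord_of_eq₅ h5
  obtain ⟨f60, f61⟩ := coord_of_eq₅ h6
  obtain ⟨f70, f71⟩ := coord_of_eq₅ h7
  refine ⟨⟨?_, ?_⟩, ⟨?_, ?_⟩, ⟨?_, ?_⟩, ⟨?_, ?_⟩, ⟨?_, ?_⟩, ⟨?_, ?_⟩, ⟨?_, ?_⟩, ?_⟩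
  · simp only [uz0]; omega
  · simp only [uz1]; omega
  · simp only [uz0]; omega
  · simp only [uz1]; omega
  · simp only [uz0]; omega
  · simp only [uz1]; omega
  · simp only [uz0]; omega
  · simp only [uz1]; omega
  · simp only [uz0]; omega
  · simp only [uz1]; omega
  · simp only [uz0]; omega
  · simp only [uz1]; omega
  · simp only [uz0]; omega
  · simp only [uz1]; omega
  · intro a b ha1 ha2 hb1 hb2 hr
    simp only [uz0, uz1, neg_inj] at hr ⊢
    exact sep a b ha1 ha2 hb1 hb2 hr

section Bridge

variable (hP : IsPolygon brickWallGraph P) (hQ : IsPolygon brickWallGraph Q) (hPn : #P = n) (hQn : #Q = n) (hn : 3 ≤ n)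
  (hK1 : Corridor P Q) (h : IsT5 P Q t)
include hP hQ hPn hQn hn hK1 h

/-- **A T3 decomposition, shape FF (`t+(−1,−1) ∉ P`, `t+(3,0) ∉ Q`), imposes, on the MIRROR `y ↦ −y` of the traversal, the forward horizontal cut `IsHdCut (n + 3) u (i+1)` for every traversal of the
joined polygon with `u i = t + (-1,-1)`, `u (i+1) = t + (-1,0)`.** [cite: Hammond2015SAPJoining, §4.2 pp. 20–24 (arXiv v5: recognising the junction plaquette); Madras1995LatticeAnimalsExponent, §2] -/
theorem isHdCut_of_isT5 (hjP : t + ![-1, -1] ∉ vertsOf P) (hjQ : t + ![3, 0] ∉ vertsOf Q) (hu : IsPolyTraversal brickWallGraph (hdJoin' t P Q) (2 * n + 6) u) {i : ℕ}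
    (h0 : u i = t + ![-1, -1]) (h1 : u (i + 1) = t + ![-1, 0]) : IsHdCut (n + 3) (fun k => ![u k 0, -(u k 1)]) (i + 1) := by
  classical
  have hdisj := disjoint_of_corridor (P := P) (Q := Q) hK1
  obtain ⟨hJ, -⟩ := h.isPolygon_join hP hQ hdisj
  set J := hdJoin' t P Q with hJdef
  have hpar := h.hpar
  have tP : t + ![0, 0] ∈ vertsOf P := tP₅ h
  have wQ : t + ![2, -1] ∈ vertsOf Q := wQ₅ h
  have cJ1 : s(t + ![0, 0], t + ![1, 0]) ∈ J := cJ1₅ h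
  have cJ2 : s(t + ![1, 0], t + ![2, 0]) ∈ J := cJ2₅ h
  have cJ3 : s(t + ![2, 0], t + ![3, 0]) ∈ J := cJ3₅ h
  have cJ4 : s(t + ![-1, -1], t + ![0, -1]) ∈ J := cJ4₅ h
  have cJ5 : s(t + ![0, -1], t + ![1, -1]) ∈ J := cJ5₅ h
  have cJ6 : s(t + ![1, -1], t + ![2, -1]) ∈ J := cJ6₅ h
  have cJb : s(t + ![-1, 0], t + ![-1, -1]) ∈ J := cJb₅ h hjP
  have cJc : s(t + ![3, 0], t + ![3, -1]) ∈ J := cJc₅ h hjQ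
  -- open `P` at `b – t`: the `P`-arc `W : b ⇝ t`
  have hbt : s(t + ![-1, 0], t + ![0, 0]) ∈ P := by rw [Sym2.eq_swap]; exact h.hl
  obtain ⟨W, hW, hWe, -, hWl, hWs⟩ := hP.exists_isPath_erase hbt
  have hWJ : ∀ e ∈ W.edges, e ∈ J := fun e he => by
    have hm : e ∈ P.erase s(t + ![-1, 0], t + ![0, 0]) := by rw [← hWe]; exact List.mem_toFinset.2 he
    exact memJ_of_memP₅ hK1 h (Finset.mem_erase.1 hm).2 (by rw [Sym2.eq_swap]; exact (Finset.mem_erase.1 hm).1)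
      (fun hv => absurd hv hjP)
  have hWlen : W.length = n - 1 := by omega
  have hWv : ∀ k, W.getVert k ∈ vertsOf P := fun k => mem_vertsOf.2 ((hWs _).1 (W.getVert_mem_support k))
  -- open `Q` at `c – w′`: the `Q`-arc `W' : c ⇝ w′`
  obtain ⟨W', hW', hW'e, -, hW'l, hW's⟩ := hQ.exists_isPath_erase h.hr
  have hW'J : ∀ e ∈ W'.edges, e ∈ J := fun e he => by
    have hm : e ∈ Q.erase s(t + ![3, -1], t + ![2, -1]) := by rw [← hW'e]; exact List.mem_toFinset.2 he
    exact memJ_of_memQ₅ hK1 h (Finset.mem_erase.1 hm).2 (Finset.mem_erase.1 hm).1 (fun hv => absurd hv hjQ)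
  have hW'len : W'.length = n - 1 := by omega
  have hW'v : ∀ k, W'.getVert k ∈ vertsOf Q := fun k => mem_vertsOf.2 ((hW's _).1 (W'.getVert_mem_support k))
  have hWedge : ∀ k, k < W.length → s(W.getVert k, W.getVert (k + 1)) ∈ J := fun k hk => hWJ _ (getVert_edge₅ W hk)
  have hW'edge : ∀ k, k < W'.length → s(W'.getVert k, W'.getVert (k + 1)) ∈ J := fun k hk => hW'J _ (getVert_edge₅ W' hk)
  -- STEP 1: the `P`-arc, `u (i+1+k) = W_k`
  have hu2 : u (i + 2) = W.getVert 1 := by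
    have := next_eq₅ (i := i) hu hJ (x := t + ![-1, -1]) (y := W.getVert 1) (by rw [h1]; exact cJb) ?_ ?_ h0
    · exact this
    · rw [h1]; have := hWedge 0 (by omega); rwa [Walk.getVert_zero] at this
    · exact (fun he => hjP (he ▸ hWv 1))
  have hP_arc : ∀ k, k ≤ n - 1 → u (i + 1 + k) = W.getVert k := fun k hk =>
    hu.follows_path hJ W hW hWJ (i := i + 1) h1 (fun _ => by rw [show i + 1 + 1 = i + 2 by omega]; exact hu2) k (by omega)
  have hut : u (i + n) = t + ![0, 0] := by
    have := hP_arc (n - 1) le_rfl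
    rw [show i + 1 + (n - 1) = i + n by omega, ← hWlen, Walk.getVert_length] at this; exact this
  have hut1 : u (i + n - 1) = W.getVert (n - 2) := by
    have := hP_arc (n - 2) (by omega); rwa [show i + 1 + (n - 2) = i + n - 1 by omega] at this
  have hWlast : s(t + ![0, 0], W.getVert (n - 2)) ∈ J := by
    have := hWedge (n - 2) (by omega)
    rw [show n - 2 + 1 = n - 1 by omega, ← hWlen, Walk.getVert_length, Sym2.eq_swap] at this
    exact this
  -- STEP 2: the lower connector
  have hR1 : u (i + n + 1) = t + ![1, 0] := by
    have := next_eq₅ (i := i + n - 1) hu hJ (x := W.getVert (n - 2)) (y := t + ![1, 0]) (by rw [show i + n - 1 + 1 = i + n by omega, hut]; exact hWlast)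
      (by rw [show i + n - 1 + 1 = i + n by omega, hut]; exact cJ1) (fun he => h.f10.1 (he ▸ hWv (n - 2))) hut1
    rwa [show i + n - 1 + 2 = i + n + 1 by omega] at this
  have hR2 : u (i + n + 2) = t + ![2, 0] := by
    have := next_eq₅ (i := i + n) hu hJ (x := t + ![0, 0]) (y := t + ![2, 0]) (by rw [hR1, Sym2.eq_swap]; exact cJ1)
      (by rw [hR1]; exact cJ2) (off_ne₅ (by decide)) hut
    exact this
  have hR3 : u (i + n + 3) = t + ![3, 0] := by
    have := next_eq₅ (i := i + n + 1) hu hJ (x := t + ![1, 0]) (y := t + ![3, 0]) (by rw [show i + n + 1 + 1 = i + n + 2 by omega, hR2, Sym2.eq_swap]; exact cJ2)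
      (by rw [show i + n + 1 + 1 = i + n + 2 by omega, hR2]; exact cJ3) (off_ne₅ (by decide)) hR1
    rwa [show i + n + 1 + 2 = i + n + 3 by omega] at this
  have hR4 : u (i + n + 4) = t + ![3, -1] := by
    have := next_eq₅ (i := i + n + 2) hu hJ (x := t + ![2, 0]) (y := t + ![3, -1]) (by rw [show i + n + 2 + 1 = i + n + 3 by omega, hR3, Sym2.eq_swap]; exact cJ3)
      (by rw [show i + n + 2 + 1 = i + n + 3 by omega, hR3]; exact cJc) (off_ne₅ (by decide)) hR2
    rwa [show i + n + 2 + 2 = i + n + 4 by omega] at this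
  -- STEP 3: the `Q`-arc
  have hQ1 : u (i + n + 4 + 1) = W'.getVert 1 := by
    have := next_eq₅ (i := i + n + 3) hu hJ (x := t + ![3, 0]) (y := W'.getVert 1) (by rw [show i + n + 3 + 1 = i + n + 4 by omega, hR4, Sym2.eq_swap]; exact cJc) ?_ ?_ hR3
    · rwa [show i + n + 3 + 2 = i + n + 4 + 1 by omega] at this
    · rw [show i + n + 3 + 1 = i + n + 4 by omega, hR4]; have := hW'edge 0 (by omega); rwa [Walk.getVert_zero] at this
    · exact (fun he => hjQ (he ▸ hW'v 1))
  have hQ_arc : ∀ k, k ≤ n - 1 → u (i + n + 4 + k) = W'.getVert k := fun k hk =>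
    hu.follows_path hJ W' hW' hW'J (i := i + n + 4) hR4 (fun _ => hQ1) k (by omega)
  have huw : u (i + 2 * n + 3) = t + ![2, -1] := by
    have := hQ_arc (n - 1) le_rfl
    rw [show i + n + 4 + (n - 1) = i + 2 * n + 3 by omega, ← hW'len, Walk.getVert_length] at this; exact this
  have huw1 : u (i + 2 * n + 2) = W'.getVert (n - 2) := by
    have := hQ_arc (n - 2) (by omega); rwa [show i + n + 4 + (n - 2) = i + 2 * n + 2 by omega] at this
  have hW'last : s(t + ![2, -1], W'.getVert (n - 2)) ∈ J := by
    have := hW'edge (n - 2) (by omega)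
    rw [show n - 2 + 1 = n - 1 by omega, ← hW'len, Walk.getVert_length, Sym2.eq_swap] at this
    exact this
  -- STEP 4: the upper connector
  have hL1 : u (i + 2 * n + 4) = t + ![1, -1] := by
    have := next_eq₅ (i := i + 2 * n + 2) hu hJ (x := W'.getVert (n - 2)) (y := t + ![1, -1]) (by rw [show i + 2 * n + 2 + 1 = i + 2 * n + 3 by omega, huw]; exact hW'last)
      (by rw [show i + 2 * n + 2 + 1 = i + 2 * n + 3 by omega, huw, Sym2.eq_swap]; exact cJ6) (fun he => h.f11.2 (he ▸ hW'v (n - 2))) huw1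
    rwa [show i + 2 * n + 2 + 2 = i + 2 * n + 4 by omega] at this
  have hL2 : u (i + 2 * n + 5) = t + ![0, -1] := by
    have := next_eq₅ (i := i + 2 * n + 3) hu hJ (x := t + ![2, -1]) (y := t + ![0, -1]) (by rw [show i + 2 * n + 3 + 1 = i + 2 * n + 4 by omega, hL1]; exact cJ6)
      (by rw [show i + 2 * n + 3 + 1 = i + 2 * n + 4 by omega, hL1, Sym2.eq_swap]; exact cJ5) (off_ne₅ (by decide)) huw
    rwa [show i + 2 * n + 3 + 2 = i + 2 * n + 5 by omega] at this
  have hL3 : u (i + 2 * n + 6) = t + ![-1, -1] := by rw [show i + 2 * n + 6 = i + (2 * n + 6) by omega, hu.periodic, h0]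
  -- the cut
  refine isHdCut_of_eqs_mirror t h1
    (by rw [show i + 1 + (n + 3) - 4 = i + n by omega, hut])
    (by rw [show i + 1 + (n + 3) - 3 = i + n + 1 by omega, hR1])
    (by rw [show i + 1 + (n + 3) - 2 = i + n + 2 by omega, hR2])
    (by rw [show i + 1 + (n + 3) - 1 = i + n + 3 by omega, hR3])
    (by rw [show i + 1 + (n + 3) = i + n + 4 by omega, hR4])
    (by rw [show i + 1 + 2 * (n + 3) - 4 = i + 2 * n + 3 by omega, huw])
    (by rw [show i + 1 + 2 * (n + 3) - 3 = i + 2 * n + 4 by omega, hL1])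
    (by rw [show i + 1 + 2 * (n + 3) - 2 = i + 2 * n + 5 by omega, hL2])
    (by rw [show i + 1 + 2 * (n + 3) - 1 = i + 2 * n + 6 by omega, hL3])
    ?_
  -- row separation: the left block (`P`-arc and lower connector) lies left of the right block (`Q`-arc and upper connector)
  intro a b ha1 ha2 hb1 hb2 hrow
  have haL : u a ∈ vertsOf P ∨ (u a = t + ![1, 0] ∨ u a = t + ![2, 0] ∨ u a = t + ![3, 0]) := by
    rcases Nat.lt_or_ge a (i + n + 1) with hlt | hge
    · left
      have := hP_arc (a - (i + 1)) (by omega)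
      rw [show i + 1 + (a - (i + 1)) = a by omega] at this
      rw [this]; exact hWv _
    · right
      rcases Nat.lt_or_ge a (i + n + 2) with h1' | h1'
      · left; rw [show a = i + n + 1 by omega]; exact hR1
      rcases Nat.lt_or_ge a (i + n + 3) with h2' | h2'
      · right; left; rw [show a = i + n + 2 by omega]; exact hR2
      · right; right; rw [show a = i + n + 3 by omega]; exact hR3
  have hbR : u b ∈ vertsOf Q ∨ (u b = t + ![1, -1] ∨ u b = t + ![0, -1] ∨ u b = t + ![-1, -1]) := by
    rcases Nat.lt_or_ge b (i + 2 * n + 3 + 1) with hlt | hge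
    · left
      have := hQ_arc (b - (i + n + 4)) (by omega)
      rw [show i + n + 4 + (b - (i + n + 4)) = b by omega] at this
      rw [this]; exact hW'v _
    · right
      rcases Nat.lt_or_ge b (i + 2 * n + 3 + 2) with h1' | h1'
      · left; rw [show b = i + 2 * n + 4 by omega]; exact hL1
      rcases Nat.lt_or_ge b (i + 2 * n + 3 + 3) with h2' | h2'
      · right; left; rw [show b = i + 2 * n + 5 by omega]; exact hL2
      · right; right; rw [show b = i + 2 * n + 6 by omega]; exact hL3
  rcases haL with haP | hj <;> rcases hbR with hbQ | hj'
  · exact lt_of_lt_of_le (by omega) (hK1 _ haP _ hbQ (Or.inl hrow))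
  · -- a `P`-site against an upper-connector site (row `t₁ + 1`): corridor against `w′ ∈ Q`; `t+(0,-1)`, `t+(−1,−1)` are off `P`
    rcases hj' with hbE | hbE | hbE <;> rw [hbE] at hrow ⊢
    · have := hK1 _ haP _ wQ (by simp at hrow ⊢; omega); simp at this ⊢; omega
    · have := hK1 _ haP _ wQ (by simp at hrow ⊢; omega)
      simp at this hrow ⊢
      rcases lt_or_eq_of_le (show u a 0 ≤ t 0 by omega) with hlt | heq
      · omega
      · exact absurd haP (by rw [eq_off₅ (t := t) (x := u a) (a := 0) (b := -1) (by omega) (by omega)]; exact h.f01.1)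
    · have := hK1 _ haP _ wQ (by simp at hrow ⊢; omega)
      simp at this hrow ⊢
      rcases lt_or_eq_of_le (show u a 0 ≤ t 0 by omega) with hlt | heq
      · rcases lt_or_eq_of_le (show u a 0 ≤ t 0 - 1 by omega) with hlt' | heq'
        · omega
        · exact absurd haP (by rw [eq_off₅ (t := t) (x := u a) (a := -1) (b := -1) (by omega) (by omega)]; exact hjP)
      · exact absurd haP (by rw [eq_off₅ (t := t) (x := u a) (a := 0) (b := -1) (by omega) (by omega)]; exact h.f01.1)
  · -- a lower-connector site against a `Q`-site (row `t₁`): corridor against `t ∈ P`; `t+(2,0)`, `t+(3,0)` are off `Q`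
    rcases hj with haE | haE | haE <;> rw [haE] at hrow ⊢
    · have := hK1 _ tP _ hbQ (by simp at hrow ⊢; omega); simp at this ⊢; omega
    · have := hK1 _ tP _ hbQ (by simp at hrow ⊢; omega)
      simp at this hrow ⊢
      rcases lt_or_eq_of_le (show t 0 + 2 ≤ u b 0 by omega) with hlt | heq
      · omega
      · exact absurd hbQ (by rw [eq_off₅ (t := t) (x := u b) (a := 2) (b := 0) (by omega) (by omega)]; exact h.f20.2)
    · have := hK1 _ tP _ hbQ (by simp at hrow ⊢; omega)
      simp at this hrow ⊢
      rcases lt_or_eq_of_le (show t 0 + 2 ≤ u b 0 by omega) with hlt | heq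
      · rcases lt_or_eq_of_le (show t 0 + 3 ≤ u b 0 by omega) with hlt' | heq'
        · omega
        · exact absurd hbQ (by rw [eq_off₅ (t := t) (x := u b) (a := 3) (b := 0) (by omega) (by omega)]; exact hjQ)
      · exact absurd hbQ (by rw [eq_off₅ (t := t) (x := u b) (a := 2) (b := 0) (by omega) (by omega)]; exact h.f20.2)
  · rcases hj with haE | haE | haE <;> rcases hj' with hbE | hbE | hbE <;> rw [haE, hbE] at hrow ⊢ <;>
      (simp only [Pi.add_apply, uz0, uz1] at hrow ⊢; omega)

/-- **A T3 decomposition, shape FF (`t+(−1,−1) ∉ P`, `t+(3,0) ∉ Q`), imposes, on the MIRROR `y ↦ −y` of the traversal, the BACKWARD horizontal cut `IsHdCut' (n + 3) u (i+1)` for every traversal of the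
joined polygon with `u i = t + (-1,0)`, `u (i+1) = t + (-1,-1)`.** [cite: Hammond2015SAPJoining, §4.2 pp. 20–24 (arXiv v5: recognising the junction plaquette); Madras1995LatticeAnimalsExponent, §2] -/
theorem isHdCut'_of_isT5 (hjP : t + ![-1, -1] ∉ vertsOf P) (hjQ : t + ![3, 0] ∉ vertsOf Q) (hu : IsPolyTraversal brickWallGraph (hdJoin' t P Q) (2 * n + 6) u) {i : ℕ}
    (h0 : u i = t + ![-1, 0]) (h1 : u (i + 1) = t + ![-1, -1]) : IsHdCut' (n + 3) (fun k => ![u k 0, -(u k 1)]) (i + 1) := by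
  classical
  have hdisj := disjoint_of_corridor (P := P) (Q := Q) hK1
  obtain ⟨hJ, -⟩ := h.isPolygon_join hP hQ hdisj
  set J := hdJoin' t P Q with hJdef
  have hpar := h.hpar
  have tP : t + ![0, 0] ∈ vertsOf P := tP₅ h
  have wQ : t + ![2, -1] ∈ vertsOf Q := wQ₅ h
  have cJ1 : s(t + ![0, 0], t + ![1, 0]) ∈ J := cJ1₅ h
  have cJ2 : s(t + ![1, 0], t + ![2, 0]) ∈ J := cJ2₅ h
  have cJ3 : s(t + ![2, 0], t + ![3, 0]) ∈ J := cJ3₅ h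
  have cJ4 : s(t + ![-1, -1], t + ![0, -1]) ∈ J := cJ4₅ h
  have cJ5 : s(t + ![0, -1], t + ![1, -1]) ∈ J := cJ5₅ h
  have cJ6 : s(t + ![1, -1], t + ![2, -1]) ∈ J := cJ6₅ h
  have cJb : s(t + ![-1, 0], t + ![-1, -1]) ∈ J := cJb₅ h hjP
  have cJc : s(t + ![3, 0], t + ![3, -1]) ∈ J := cJc₅ h hjQ
  -- open `P` at `t – b`: the `P`-arc `W : t ⇝ b`
  obtain ⟨W, hW, hWe, -, hWl, hWs⟩ := hP.exists_isPath_erase h.hl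
  have hWJ : ∀ e ∈ W.edges, e ∈ J := fun e he => by
    have hm : e ∈ P.erase s(t + ![0, 0], t + ![-1, 0]) := by rw [← hWe]; exact List.mem_toFinset.2 he
    exact memJ_of_memP₅ hK1 h (Finset.mem_erase.1 hm).2 (Finset.mem_erase.1 hm).1 (fun hv => absurd hv hjP)
  have hWlen : W.length = n - 1 := by omega
  have hWv : ∀ k, W.getVert k ∈ vertsOf P := fun k => mem_vertsOf.2 ((hWs _).1 (W.getVert_mem_support k))
  -- open `Q` at `w′ – c`: the `Q`-arc `W' : w′ ⇝ c`
  have hwc : s(t + ![2, -1], t + ![3, -1]) ∈ Q := by rw [Sym2.eq_swap]; exact h.hr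
  obtain ⟨W', hW', hW'e, -, hW'l, hW's⟩ := hQ.exists_isPath_erase hwc
  have hW'J : ∀ e ∈ W'.edges, e ∈ J := fun e he => by
    have hm : e ∈ Q.erase s(t + ![2, -1], t + ![3, -1]) := by rw [← hW'e]; exact List.mem_toFinset.2 he
    exact memJ_of_memQ₅ hK1 h (Finset.mem_erase.1 hm).2 (by rw [Sym2.eq_swap]; exact (Finset.mem_erase.1 hm).1)
      (fun hv => absurd hv hjQ)
  have hW'len : W'.length = n - 1 := by omega
  have hW'v : ∀ k, W'.getVert k ∈ vertsOf Q := fun k => mem_vertsOf.2 ((hW's _).1 (W'.getVert_mem_support k))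
  have hWedge : ∀ k, k < W.length → s(W.getVert k, W.getVert (k + 1)) ∈ J := fun k hk => hWJ _ (getVert_edge₅ W hk)
  have hW'edge : ∀ k, k < W'.length → s(W'.getVert k, W'.getVert (k + 1)) ∈ J := fun k hk => hW'J _ (getVert_edge₅ W' hk)
  -- STEP 1: the upper connector `t+(−1,−1) → t+(0,-1) → t+(1,-1) → w′`
  have hL1 : u (i + 2) = t + ![0, -1] := by
    have := next_eq₅ (i := i) hu hJ (x := t + ![-1, 0]) (y := t + ![0, -1]) (by rw [h1, Sym2.eq_swap]; exact cJb)
      (by rw [h1]; exact cJ4) (off_ne₅ (by decide)) h0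
    exact this
  have hL2 : u (i + 3) = t + ![1, -1] := by
    have := next_eq₅ (i := i + 1) hu hJ (x := t + ![-1, -1]) (y := t + ![1, -1]) (by rw [show i + 1 + 1 = i + 2 by omega, hL1, Sym2.eq_swap]; exact cJ4)
      (by rw [show i + 1 + 1 = i + 2 by omega, hL1]; exact cJ5) (off_ne₅ (by decide)) h1
    rwa [show i + 1 + 2 = i + 3 by omega] at this
  have hL3 : u (i + 4) = t + ![2, -1] := by
    have := next_eq₅ (i := i + 2) hu hJ (x := t + ![0, -1]) (y := t + ![2, -1]) (by rw [show i + 2 + 1 = i + 3 by omega, hL2, Sym2.eq_swap]; exact cJ5)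
      (by rw [show i + 2 + 1 = i + 3 by omega, hL2]; exact cJ6) (off_ne₅ (by decide)) hL1
    rwa [show i + 2 + 2 = i + 4 by omega] at this
  -- STEP 2: the `Q`-arc backwards, `u (i+4+k) = W'_k`
  have hQ1 : u (i + 5) = W'.getVert 1 := by
    have := next_eq₅ (i := i + 3) hu hJ (x := t + ![1, -1]) (y := W'.getVert 1) (by rw [show i + 3 + 1 = i + 4 by omega, hL3, Sym2.eq_swap]; exact cJ6) ?_ ?_ hL2
    · rwa [show i + 3 + 2 = i + 5 by omega] at this
    · rw [show i + 3 + 1 = i + 4 by omega, hL3]; have := hW'edge 0 (by omega); rwa [Walk.getVert_zero] at this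
    · exact (fun he => h.f11.2 (he ▸ hW'v 1))
  have hQ_arc : ∀ k, k ≤ n - 1 → u (i + 4 + k) = W'.getVert k := fun k hk =>
    hu.follows_path hJ W' hW' hW'J (i := i + 4) hL3 (fun _ => by rw [show i + 4 + 1 = i + 5 by omega]; exact hQ1) k (by omega)
  have huR0 : u (i + n + 3) = t + ![3, -1] := by
    have := hQ_arc (n - 1) le_rfl
    rw [show i + 4 + (n - 1) = i + n + 3 by omega, ← hW'len, Walk.getVert_length] at this; exact this
  have huR01 : u (i + n + 2) = W'.getVert (n - 2) := by
    have := hQ_arc (n - 2) (by omega); rwa [show i + 4 + (n - 2) = i + n + 2 by omega] at this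
  have hW'last : s(t + ![3, -1], W'.getVert (n - 2)) ∈ J := by
    have := hW'edge (n - 2) (by omega)
    rw [show n - 2 + 1 = n - 1 by omega, ← hW'len, Walk.getVert_length, Sym2.eq_swap] at this
    exact this
  -- STEP 3: the lower connector backwards
  have hR1 : u (i + n + 4) = t + ![3, 0] := by
    have := next_eq₅ (i := i + n + 2) hu hJ (x := W'.getVert (n - 2)) (y := t + ![3, 0]) (by rw [show i + n + 2 + 1 = i + n + 3 by omega, huR0]; exact hW'last)
      (by rw [show i + n + 2 + 1 = i + n + 3 by omega, huR0, Sym2.eq_swap]; exact cJc) (fun he => hjQ (he ▸ hW'v (n - 2))) huR01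
    rwa [show i + n + 2 + 2 = i + n + 4 by omega] at this
  have hR2 : u (i + n + 5) = t + ![2, 0] := by
    have := next_eq₅ (i := i + n + 3) hu hJ (x := t + ![3, -1]) (y := t + ![2, 0]) (by rw [show i + n + 3 + 1 = i + n + 4 by omega, hR1]; exact cJc)
      (by rw [show i + n + 3 + 1 = i + n + 4 by omega, hR1, Sym2.eq_swap]; exact cJ3) (off_ne₅ (by decide)) huR0
    rwa [show i + n + 3 + 2 = i + n + 5 by omega] at this
  have hR3 : u (i + n + 6) = t + ![1, 0] := by
    have := next_eq₅ (i := i + n + 4) hu hJ (x := t + ![3, 0]) (y := t + ![1, 0]) (by rw [show i + n + 4 + 1 = i + n + 5 by omega, hR2]; exact cJ3)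
      (by rw [show i + n + 4 + 1 = i + n + 5 by omega, hR2, Sym2.eq_swap]; exact cJ2) (off_ne₅ (by decide)) hR1
    rwa [show i + n + 4 + 2 = i + n + 6 by omega] at this
  have hR4 : u (i + n + 7) = t + ![0, 0] := by
    have := next_eq₅ (i := i + n + 5) hu hJ (x := t + ![2, 0]) (y := t + ![0, 0]) (by rw [show i + n + 5 + 1 = i + n + 6 by omega, hR3]; exact cJ2)
      (by rw [show i + n + 5 + 1 = i + n + 6 by omega, hR3, Sym2.eq_swap]; exact cJ1) (off_ne₅ (by decide)) hR2
    rwa [show i + n + 5 + 2 = i + n + 7 by omega] at this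
  -- STEP 4: the `P`-arc backwards
  have hP1 : u (i + n + 7 + 1) = W.getVert 1 := by
    have := next_eq₅ (i := i + n + 6) hu hJ (x := t + ![1, 0]) (y := W.getVert 1) (by rw [show i + n + 6 + 1 = i + n + 7 by omega, hR4]; exact cJ1) ?_ ?_ hR3
    · rwa [show i + n + 6 + 2 = i + n + 7 + 1 by omega] at this
    · rw [show i + n + 6 + 1 = i + n + 7 by omega, hR4]; have := hWedge 0 (by omega); rwa [Walk.getVert_zero] at this
    · exact (fun he => h.f10.1 (he ▸ hWv 1))
  have hP_arc : ∀ k, k ≤ n - 1 → u (i + n + 7 + k) = W.getVert k := fun k hk =>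
    hu.follows_path hJ W hW hWJ (i := i + n + 7) hR4 (fun _ => hP1) k (by omega)
  have huend : u (i + (2 * n + 6)) = t + ![-1, 0] := by
    have := hP_arc (n - 1) le_rfl
    rw [show i + n + 7 + (n - 1) = i + (2 * n + 6) by omega, ← hWlen, Walk.getVert_length] at this; exact this
  -- the backward cut
  refine isHdCut'_of_eqs_mirror t h1
    (by rw [show i + 1 + 1 = i + 2 by omega, hL1])
    (by rw [show i + 1 + 2 = i + 3 by omega, hL2])
    (by rw [show i + 1 + 3 = i + 4 by omega, hL3])
    (by rw [show i + 1 + (n + 3) - 1 = i + n + 3 by omega, huR0])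
    (by rw [show i + 1 + (n + 3) = i + n + 4 by omega, hR1])
    (by rw [show i + 1 + (n + 3) + 1 = i + n + 5 by omega, hR2])
    (by rw [show i + 1 + (n + 3) + 2 = i + n + 6 by omega, hR3])
    (by rw [show i + 1 + (n + 3) + 3 = i + n + 7 by omega, hR4])
    (by rw [show i + 1 + 2 * (n + 3) - 1 = i + (2 * n + 6) by omega, huend])
    ?_
  -- row separation: the first block (upper connector, `Q`-arc) lies right of the second (lower connector, `P`-arc)
  intro a b ha1 ha2 hb1 hb2 hrow
  have haR : u a ∈ vertsOf Q ∨ (u a = t + ![-1, -1] ∨ u a = t + ![0, -1] ∨ u a = t + ![1, -1]) := by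
    rcases Nat.lt_or_ge a (i + 4) with hlt | hge
    · right
      rcases Nat.lt_or_ge a (i + 2) with h1' | h1'
      · left; rw [show a = i + 1 by omega]; exact h1
      rcases Nat.lt_or_ge a (i + 3) with h2' | h2'
      · right; left; rw [show a = i + 2 by omega]; exact hL1
      · right; right; rw [show a = i + 3 by omega]; exact hL2
    · left
      have := hQ_arc (a - (i + 4)) (by omega)
      rw [show i + 4 + (a - (i + 4)) = a by omega] at this
      rw [this]; exact hW'v _
  have hbL : u b ∈ vertsOf P ∨ (u b = t + ![3, 0] ∨ u b = t + ![2, 0] ∨ u b = t + ![1, 0]) := by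
    rcases Nat.lt_or_ge b (i + n + 7) with hlt | hge
    · right
      rcases Nat.lt_or_ge b (i + n + 5) with h1' | h1'
      · left; rw [show b = i + n + 4 by omega]; exact hR1
      rcases Nat.lt_or_ge b (i + n + 6) with h2' | h2'
      · right; left; rw [show b = i + n + 5 by omega]; exact hR2
      · right; right; rw [show b = i + n + 6 by omega]; exact hR3
    · left
      have := hP_arc (b - (i + n + 7)) (by omega)
      rw [show i + n + 7 + (b - (i + n + 7)) = b by omega] at this
      rw [this]; exact hWv _
  rcases haR with haQ | hj <;> rcases hbL with hbP | hj'
  · exact lt_of_lt_of_le (by omega) (hK1 _ hbP _ haQ (Or.inl hrow.symm))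
  · -- a `Q`-site against a lower-connector site (row `t₁`): corridor against `t ∈ P`
    rcases hj' with hbE | hbE | hbE <;> rw [hbE] at hrow ⊢
    · have := hK1 _ tP _ haQ (by simp at hrow ⊢; omega)
      simp at this hrow ⊢
      rcases lt_or_eq_of_le (show t 0 + 2 ≤ u a 0 by omega) with hlt | heq
      · rcases lt_or_eq_of_le (show t 0 + 3 ≤ u a 0 by omega) with hlt' | heq'
        · omega
        · exact absurd haQ (by rw [eq_off₅ (t := t) (x := u a) (a := 3) (b := 0) (by omega) (by omega)]; exact hjQ)
      · exact absurd haQ (by rw [eq_off₅ (t := t) (x := u a) (a := 2) (b := 0) (by omega) (by omega)]; exact h.f20.2)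
    · have := hK1 _ tP _ haQ (by simp at hrow ⊢; omega)
      simp at this hrow ⊢
      rcases lt_or_eq_of_le (show t 0 + 2 ≤ u a 0 by omega) with hlt | heq
      · omega
      · exact absurd haQ (by rw [eq_off₅ (t := t) (x := u a) (a := 2) (b := 0) (by omega) (by omega)]; exact h.f20.2)
    · have := hK1 _ tP _ haQ (by simp at hrow ⊢; omega); simp at this ⊢; omega
  · -- an upper-connector site against a `P`-site (row `t₁ + 1`): corridor against `w′ ∈ Q`
    rcases hj with haE | haE | haE <;> rw [haE] at hrow ⊢
    · have := hK1 _ hbP _ wQ (by simp at hrow ⊢; omega)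
      simp at this hrow ⊢
      rcases lt_or_eq_of_le (show u b 0 ≤ t 0 by omega) with hlt | heq
      · rcases lt_or_eq_of_le (show u b 0 ≤ t 0 - 1 by omega) with hlt' | heq'
        · omega
        · exact absurd hbP (by rw [eq_off₅ (t := t) (x := u b) (a := -1) (b := -1) (by omega) (by omega)]; exact hjP)
      · exact absurd hbP (by rw [eq_off₅ (t := t) (x := u b) (a := 0) (b := -1) (by omega) (by omega)]; exact h.f01.1)
    · have := hK1 _ hbP _ wQ (by simp at hrow ⊢; omega)
      simp at this hrow ⊢
      rcases lt_or_eq_of_le (show u b 0 ≤ t 0 by omega) with hlt | heq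
      · omega
      · exact absurd hbP (by rw [eq_off₅ (t := t) (x := u b) (a := 0) (b := -1) (by omega) (by omega)]; exact h.f01.1)
    · have := hK1 _ hbP _ wQ (by simp at hrow ⊢; omega); simp at this ⊢; omega
  · rcases hj with haE | haE | haE <;> rcases hj' with hbE | hbE | hbE <;> rw [haE, hbE] at hrow ⊢ <;>
      (simp only [Pi.add_apply, uz0, uz1] at hrow ⊢; omega)

/-- **A T3 decomposition, shape TF (`t+(−1,−1) ∈ P`, `t+(3,0) ∉ Q`), imposes, on the MIRROR `y ↦ −y` of the traversal, the forward horizontal cut `IsHdCutTF (n + 2) u (i+1)` for every traversal of the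
joined polygon with `u i = t + (0,-1)`, `u (i+1) = t + (-1,-1)`.** [cite: Hammond2015SAPJoining, §4.2 pp. 20–24 (arXiv v5: recognising the junction plaquette); Madras1995LatticeAnimalsExponent, §2] -/
theorem isHdCutTF_of_isT5 (hjP : t + ![-1, -1] ∈ vertsOf P) (hjQ : t + ![3, 0] ∉ vertsOf Q) (hu : IsPolyTraversal brickWallGraph (hdJoin' t P Q) (2 * n + 4) u) {i : ℕ}
    (h0 : u i = t + ![0, -1]) (h1 : u (i + 1) = t + ![-1, -1]) : IsHdCutTF (n + 2) (fun k => ![u k 0, -(u k 1)]) (i + 1) := by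
  classical
  have hdisj := disjoint_of_corridor (P := P) (Q := Q) hK1
  obtain ⟨hJ, -⟩ := h.isPolygon_join hP hQ hdisj
  set J := hdJoin' t P Q with hJdef
  have hpar := h.hpar
  have tP : t + ![0, 0] ∈ vertsOf P := tP₅ h
  have wQ : t + ![2, -1] ∈ vertsOf Q := wQ₅ h
  have cJ1 : s(t + ![0, 0], t + ![1, 0]) ∈ J := cJ1₅ h
  have cJ2 : s(t + ![1, 0], t + ![2, 0]) ∈ J := cJ2₅ h
  have cJ3 : s(t + ![2, 0], t + ![3, 0]) ∈ J := cJ3₅ h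
  have cJ4 : s(t + ![-1, -1], t + ![0, -1]) ∈ J := cJ4₅ h
  have cJ5 : s(t + ![0, -1], t + ![1, -1]) ∈ J := cJ5₅ h
  have cJ6 : s(t + ![1, -1], t + ![2, -1]) ∈ J := cJ6₅ h
  have cJc : s(t + ![3, 0], t + ![3, -1]) ∈ J := cJc₅ h hjQ
  -- open `P` along `t+(−1,−1) – b – t`: the `P`-arc `W`
  have hpE : ∀ e ∈ (wPf₅ t hpar).edges, e ∈ P := fun e he => by
    simp only [wPf₅, Walk.edges_cons, Walk.edges_nil, List.mem_cons, List.not_mem_nil, or_false] at he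
    rcases he with rfl | rfl
    · exact forcedP₅ hP h hjP
    · rw [Sym2.eq_swap]; exact h.hl
  obtain ⟨W, hW, hWe, hWl, hWs⟩ := hP.exists_isPath_sdiff (wPf₅ t hpar) (by rw [Walk.isPath_def]; simp [wPf₅]) hpE
    (by simp [wPf₅]) (by simp [wPf₅]; omega)
  have hpl : (wPf₅ t hpar).length = 2 := by simp [wPf₅]
  have hWJ : ∀ e ∈ W.edges, e ∈ J := fun e he => by
    have hm : e ∈ P \ (wPf₅ t hpar).edges.toFinset := by rw [← hWe]; exact List.mem_toFinset.2 he
    rw [Finset.mem_sdiff] at hm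
    have hne : ¬ (e = s(t + ![-1, -1], t + ![-1, 0]) ∨ e = s(t + ![-1, 0], t + ![0, 0])) := by
      intro hh; apply hm.2
      simp only [wPf₅, Walk.edges_cons, Walk.edges_nil, List.toFinset_cons, List.toFinset_nil, Finset.mem_insert,
        Finset.notMem_empty, or_false]
      exact hh
    exact memJ_of_memP₅ hK1 h hm.1 (fun he' => hne (Or.inr (by rw [Sym2.eq_swap]; exact he')))
      (fun _ he' => hne (Or.inl (by rw [Sym2.eq_swap]; exact he')))
  have hWlen : W.length = n - 2 := by rw [hpl] at hWl; omega
  have hWv : ∀ k, W.getVert k ∈ vertsOf P := fun k => mem_vertsOf.2 ((hWs _).1 (W.getVert_mem_support k)).1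
  -- open `Q` at `c – w′`: the `Q`-arc `W' : c ⇝ w′`
  obtain ⟨W', hW', hW'e, -, hW'l, hW's⟩ := hQ.exists_isPath_erase h.hr
  have hW'J : ∀ e ∈ W'.edges, e ∈ J := fun e he => by
    have hm : e ∈ Q.erase s(t + ![3, -1], t + ![2, -1]) := by rw [← hW'e]; exact List.mem_toFinset.2 he
    exact memJ_of_memQ₅ hK1 h (Finset.mem_erase.1 hm).2 (Finset.mem_erase.1 hm).1 (fun hv => absurd hv hjQ)
  have hW'len : W'.length = n - 1 := by omega
  have hW'v : ∀ k, W'.getVert k ∈ vertsOf Q := fun k => mem_vertsOf.2 ((hW's _).1 (W'.getVert_mem_support k))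
  have hWedge : ∀ k, k < W.length → s(W.getVert k, W.getVert (k + 1)) ∈ J := fun k hk => hWJ _ (getVert_edge₅ W hk)
  have hW'edge : ∀ k, k < W'.length → s(W'.getVert k, W'.getVert (k + 1)) ∈ J := fun k hk => hW'J _ (getVert_edge₅ W' hk)
  -- STEP 1: the `P`-arc, `u (i+1+k) = W_k`
  have hu2 : u (i + 2) = W.getVert 1 := by
    have := next_eq₅ (i := i) hu hJ (x := t + ![0, -1]) (y := W.getVert 1) (by rw [h1]; exact cJ4) ?_ ?_ h0
    · exact this
    · rw [h1]; have := hWedge 0 (by omega); rwa [Walk.getVert_zero] at this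
    · exact (fun he => h.f01.1 (he ▸ hWv 1))
  have hP_arc : ∀ k, k ≤ n - 2 → u (i + 1 + k) = W.getVert k := fun k hk =>
    hu.follows_path hJ W hW hWJ (i := i + 1) h1 (fun _ => by rw [show i + 1 + 1 = i + 2 by omega]; exact hu2) k (by omega)
  have hut : u (i + n - 1) = t + ![0, 0] := by
    have := hP_arc (n - 2) le_rfl
    rw [show i + 1 + (n - 2) = i + n - 1 by omega, ← hWlen, Walk.getVert_length] at this; exact this
  have hut1 : u (i + n - 2) = W.getVert (n - 3) := by
    have := hP_arc (n - 3) (by omega); rwa [show i + 1 + (n - 3) = i + n - 2 by omega] at this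
  have hWlast : s(t + ![0, 0], W.getVert (n - 3)) ∈ J := by
    have := hWedge (n - 3) (by omega)
    rw [show n - 3 + 1 = n - 2 by omega, ← hWlen, Walk.getVert_length, Sym2.eq_swap] at this
    exact this
  -- STEP 2: the lower connector
  have hR1 : u (i + n) = t + ![1, 0] := by
    have := next_eq₅ (i := i + n - 2) hu hJ (x := W.getVert (n - 3)) (y := t + ![1, 0]) (by rw [show i + n - 2 + 1 = i + n - 1 by omega, hut]; exact hWlast)
      (by rw [show i + n - 2 + 1 = i + n - 1 by omega, hut]; exact cJ1) (fun he => h.f10.1 (he ▸ hWv (n - 3))) hut1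
    rwa [show i + n - 2 + 2 = i + n by omega] at this
  have hR2 : u (i + n + 1) = t + ![2, 0] := by
    have := next_eq₅ (i := i + n - 1) hu hJ (x := t + ![0, 0]) (y := t + ![2, 0]) (by rw [show i + n - 1 + 1 = i + n by omega, hR1, Sym2.eq_swap]; exact cJ1)
      (by rw [show i + n - 1 + 1 = i + n by omega, hR1]; exact cJ2) (off_ne₅ (by decide)) hut
    rwa [show i + n - 1 + 2 = i + n + 1 by omega] at this
  have hR3 : u (i + n + 2) = t + ![3, 0] := by
    have := next_eq₅ (i := i + n) hu hJ (x := t + ![1, 0]) (y := t + ![3, 0]) (by rw [hR2, Sym2.eq_swap]; exact cJ2)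
      (by rw [hR2]; exact cJ3) (off_ne₅ (by decide)) hR1
    exact this
  have hR4 : u (i + n + 3) = t + ![3, -1] := by
    have := next_eq₅ (i := i + n + 1) hu hJ (x := t + ![2, 0]) (y := t + ![3, -1]) (by rw [show i + n + 1 + 1 = i + n + 2 by omega, hR3, Sym2.eq_swap]; exact cJ3)
      (by rw [show i + n + 1 + 1 = i + n + 2 by omega, hR3]; exact cJc) (off_ne₅ (by decide)) hR2
    rwa [show i + n + 1 + 2 = i + n + 3 by omega] at this
  -- STEP 3: the `Q`-arc
  have hQ1 : u (i + n + 3 + 1) = W'.getVert 1 := by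
    have := next_eq₅ (i := i + n + 2) hu hJ (x := t + ![3, 0]) (y := W'.getVert 1) (by rw [show i + n + 2 + 1 = i + n + 3 by omega, hR4, Sym2.eq_swap]; exact cJc) ?_ ?_ hR3
    · rwa [show i + n + 2 + 2 = i + n + 3 + 1 by omega] at this
    · rw [show i + n + 2 + 1 = i + n + 3 by omega, hR4]; have := hW'edge 0 (by omega); rwa [Walk.getVert_zero] at this
    · exact (fun he => hjQ (he ▸ hW'v 1))
  have hQ_arc : ∀ k, k ≤ n - 1 → u (i + n + 3 + k) = W'.getVert k := fun k hk =>
    hu.follows_path hJ W' hW' hW'J (i := i + n + 3) hR4 (fun _ => hQ1) k (by omega)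
  have huw : u (i + 2 * n + 2) = t + ![2, -1] := by
    have := hQ_arc (n - 1) le_rfl
    rw [show i + n + 3 + (n - 1) = i + 2 * n + 2 by omega, ← hW'len, Walk.getVert_length] at this; exact this
  have huw1 : u (i + 2 * n + 1) = W'.getVert (n - 2) := by
    have := hQ_arc (n - 2) (by omega); rwa [show i + n + 3 + (n - 2) = i + 2 * n + 1 by omega] at this
  have hW'last : s(t + ![2, -1], W'.getVert (n - 2)) ∈ J := by
    have := hW'edge (n - 2) (by omega)
    rw [show n - 2 + 1 = n - 1 by omega, ← hW'len, Walk.getVert_length, Sym2.eq_swap] at this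
    exact this
  -- STEP 4: the upper connector
  have hL1 : u (i + 2 * n + 3) = t + ![1, -1] := by
    have := next_eq₅ (i := i + 2 * n + 1) hu hJ (x := W'.getVert (n - 2)) (y := t + ![1, -1]) (by rw [show i + 2 * n + 1 + 1 = i + 2 * n + 2 by omega, huw]; exact hW'last)
      (by rw [show i + 2 * n + 1 + 1 = i + 2 * n + 2 by omega, huw, Sym2.eq_swap]; exact cJ6) (fun he => h.f11.2 (he ▸ hW'v (n - 2))) huw1
    rwa [show i + 2 * n + 1 + 2 = i + 2 * n + 3 by omega] at this
  have hL2 : u (i + 2 * n + 4) = t + ![0, -1] := by rw [show i + 2 * n + 4 = i + (2 * n + 4) by omega, hu.periodic, h0]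
  -- the cut
  refine isHdCutTF_of_eqs_mirror t h1
    (by rw [show i + 1 + (n + 2) - 4 = i + n - 1 by omega, hut])
    (by rw [show i + 1 + (n + 2) - 3 = i + n by omega, hR1])
    (by rw [show i + 1 + (n + 2) - 2 = i + n + 1 by omega, hR2])
    (by rw [show i + 1 + (n + 2) - 1 = i + n + 2 by omega, hR3])
    (by rw [show i + 1 + (n + 2) = i + n + 3 by omega, hR4])
    (by rw [show i + 1 + 2 * (n + 2) - 3 = i + 2 * n + 2 by omega, huw])
    (by rw [show i + 1 + 2 * (n + 2) - 2 = i + 2 * n + 3 by omega, hL1])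
    (by rw [show i + 1 + 2 * (n + 2) - 1 = i + 2 * n + 4 by omega, hL2])
    ?_
  -- row separation: the left block (`P`-arc and lower connector) lies left of the right block (`Q`-arc and upper connector)
  intro a b ha1 ha2 hb1 hb2 hrow
  have haL : u a ∈ vertsOf P ∨ (u a = t + ![1, 0] ∨ u a = t + ![2, 0] ∨ u a = t + ![3, 0]) := by
    rcases Nat.lt_or_ge a (i + n - 1 + 1) with hlt | hge
    · left
      have := hP_arc (a - (i + 1)) (by omega)
      rw [show i + 1 + (a - (i + 1)) = a by omega] at this
      rw [this]; exact hWv _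
    · right
      rcases Nat.lt_or_ge a (i + n - 1 + 2) with h1' | h1'
      · left; rw [show a = i + n by omega]; exact hR1
      rcases Nat.lt_or_ge a (i + n - 1 + 3) with h2' | h2'
      · right; left; rw [show a = i + n + 1 by omega]; exact hR2
      · right; right; rw [show a = i + n + 2 by omega]; exact hR3
  have hbR : u b ∈ vertsOf Q ∨ (u b = t + ![1, -1] ∨ u b = t + ![0, -1]) := by
    rcases Nat.lt_or_ge b (i + 2 * n + 2 + 1) with hlt | hge
    · left
      have := hQ_arc (b - (i + n + 3)) (by omega)
      rw [show i + n + 3 + (b - (i + n + 3)) = b by omega] at this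
      rw [this]; exact hW'v _
    · right
      rcases Nat.lt_or_ge b (i + 2 * n + 2 + 2) with h1' | h1'
      · left; rw [show b = i + 2 * n + 3 by omega]; exact hL1
      · right; rw [show b = i + 2 * n + 4 by omega]; exact hL2
  rcases haL with haP | hj <;> rcases hbR with hbQ | hj'
  · exact lt_of_lt_of_le (by omega) (hK1 _ haP _ hbQ (Or.inl hrow))
  · -- a `P`-site against an upper-connector site (row `t₁ + 1`): corridor against `w′ ∈ Q`; `t+(0,-1)`, `t+(−1,−1)` are off `P`
    rcases hj' with hbE | hbE <;> rw [hbE] at hrow ⊢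
    · have := hK1 _ haP _ wQ (by simp at hrow ⊢; omega); simp at this ⊢; omega
    · have := hK1 _ haP _ wQ (by simp at hrow ⊢; omega)
      simp at this hrow ⊢
      rcases lt_or_eq_of_le (show u a 0 ≤ t 0 by omega) with hlt | heq
      · omega
      · exact absurd haP (by rw [eq_off₅ (t := t) (x := u a) (a := 0) (b := -1) (by omega) (by omega)]; exact h.f01.1)
  · -- a lower-connector site against a `Q`-site (row `t₁`): corridor against `t ∈ P`; `t+(2,0)`, `t+(3,0)` are off `Q`
    rcases hj with haE | haE | haE <;> rw [haE] at hrow ⊢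
    · have := hK1 _ tP _ hbQ (by simp at hrow ⊢; omega); simp at this ⊢; omega
    · have := hK1 _ tP _ hbQ (by simp at hrow ⊢; omega)
      simp at this hrow ⊢
      rcases lt_or_eq_of_le (show t 0 + 2 ≤ u b 0 by omega) with hlt | heq
      · omega
      · exact absurd hbQ (by rw [eq_off₅ (t := t) (x := u b) (a := 2) (b := 0) (by omega) (by omega)]; exact h.f20.2)
    · have := hK1 _ tP _ hbQ (by simp at hrow ⊢; omega)
      simp at this hrow ⊢
      rcases lt_or_eq_of_le (show t 0 + 2 ≤ u b 0 by omega) with hlt | heq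
      · rcases lt_or_eq_of_le (show t 0 + 3 ≤ u b 0 by omega) with hlt' | heq'
        · omega
        · exact absurd hbQ (by rw [eq_off₅ (t := t) (x := u b) (a := 3) (b := 0) (by omega) (by omega)]; exact hjQ)
      · exact absurd hbQ (by rw [eq_off₅ (t := t) (x := u b) (a := 2) (b := 0) (by omega) (by omega)]; exact h.f20.2)
  · rcases hj with haE | haE | haE <;> rcases hj' with hbE | hbE <;> rw [haE, hbE] at hrow ⊢ <;>
      (simp only [Pi.add_apply, uz0, uz1] at hrow ⊢; omega)

/-- **A T3 decomposition, shape TF (`t+(−1,−1) ∈ P`, `t+(3,0) ∉ Q`), imposes, on the MIRROR `y ↦ −y` of the traversal, the BACKWARD horizontal cut `IsHdCutTF' (n + 2) u (i+1)` for every traversal of the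
joined polygon with `u i = t + (-1,-1)`, `u (i+1) = t + (0,-1)`.** [cite: Hammond2015SAPJoining, §4.2 pp. 20–24 (arXiv v5: recognising the junction plaquette); Madras1995LatticeAnimalsExponent, §2] -/
theorem isHdCutTF'_of_isT5 (hjP : t + ![-1, -1] ∈ vertsOf P) (hjQ : t + ![3, 0] ∉ vertsOf Q) (hu : IsPolyTraversal brickWallGraph (hdJoin' t P Q) (2 * n + 4) u) {i : ℕ}
    (h0 : u i = t + ![-1, -1]) (h1 : u (i + 1) = t + ![0, -1]) : IsHdCutTF' (n + 2) (fun k => ![u k 0, -(u k 1)]) (i + 1) := by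
  classical
  have hdisj := disjoint_of_corridor (P := P) (Q := Q) hK1
  obtain ⟨hJ, -⟩ := h.isPolygon_join hP hQ hdisj
  set J := hdJoin' t P Q with hJdef
  have hpar := h.hpar
  have tP : t + ![0, 0] ∈ vertsOf P := tP₅ h
  have wQ : t + ![2, -1] ∈ vertsOf Q := wQ₅ h
  have cJ1 : s(t + ![0, 0], t + ![1, 0]) ∈ J := cJ1₅ h
  have cJ2 : s(t + ![1, 0], t + ![2, 0]) ∈ J := cJ2₅ h
  have cJ3 : s(t + ![2, 0], t + ![3, 0]) ∈ J := cJ3₅ h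
  have cJ4 : s(t + ![-1, -1], t + ![0, -1]) ∈ J := cJ4₅ h
  have cJ5 : s(t + ![0, -1], t + ![1, -1]) ∈ J := cJ5₅ h
  have cJ6 : s(t + ![1, -1], t + ![2, -1]) ∈ J := cJ6₅ h
  have cJc : s(t + ![3, 0], t + ![3, -1]) ∈ J := cJc₅ h hjQ
  -- open `P` along `t+(−1,−1) – b – t`: the `P`-arc `W`
  have hpE : ∀ e ∈ (wPb₅ t hpar).edges, e ∈ P := fun e he => by
    simp only [wPb₅, Walk.edges_cons, Walk.edges_nil, List.mem_cons, List.not_mem_nil, or_false] at he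
    rcases he with rfl | rfl
    · exact h.hl
    · rw [Sym2.eq_swap]; exact forcedP₅ hP h hjP
  obtain ⟨W, hW, hWe, hWl, hWs⟩ := hP.exists_isPath_sdiff (wPb₅ t hpar) (by rw [Walk.isPath_def]; simp [wPb₅]) hpE
    (by simp [wPb₅]) (by simp [wPb₅]; omega)
  have hpl : (wPb₅ t hpar).length = 2 := by simp [wPb₅]
  have hWJ : ∀ e ∈ W.edges, e ∈ J := fun e he => by
    have hm : e ∈ P \ (wPb₅ t hpar).edges.toFinset := by rw [← hWe]; exact List.mem_toFinset.2 he
    rw [Finset.mem_sdiff] at hm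
    have hne : ¬ (e = s(t + ![0, 0], t + ![-1, 0]) ∨ e = s(t + ![-1, 0], t + ![-1, -1])) := by
      intro hh; apply hm.2
      simp only [wPb₅, Walk.edges_cons, Walk.edges_nil, List.toFinset_cons, List.toFinset_nil, Finset.mem_insert,
        Finset.notMem_empty, or_false]
      exact hh
    exact memJ_of_memP₅ hK1 h hm.1 (fun he' => hne (Or.inl he')) (fun _ he' => hne (Or.inr he'))
  have hWlen : W.length = n - 2 := by rw [hpl] at hWl; omega
  have hWv : ∀ k, W.getVert k ∈ vertsOf P := fun k => mem_vertsOf.2 ((hWs _).1 (W.getVert_mem_support k)).1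
  -- open `Q` at `w′ – c`: the `Q`-arc `W' : w′ ⇝ c`
  have hwc : s(t + ![2, -1], t + ![3, -1]) ∈ Q := by rw [Sym2.eq_swap]; exact h.hr
  obtain ⟨W', hW', hW'e, -, hW'l, hW's⟩ := hQ.exists_isPath_erase hwc
  have hW'J : ∀ e ∈ W'.edges, e ∈ J := fun e he => by
    have hm : e ∈ Q.erase s(t + ![2, -1], t + ![3, -1]) := by rw [← hW'e]; exact List.mem_toFinset.2 he
    exact memJ_of_memQ₅ hK1 h (Finset.mem_erase.1 hm).2 (by rw [Sym2.eq_swap]; exact (Finset.mem_erase.1 hm).1)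
      (fun hv => absurd hv hjQ)
  have hW'len : W'.length = n - 1 := by omega
  have hW'v : ∀ k, W'.getVert k ∈ vertsOf Q := fun k => mem_vertsOf.2 ((hW's _).1 (W'.getVert_mem_support k))
  have hWedge : ∀ k, k < W.length → s(W.getVert k, W.getVert (k + 1)) ∈ J := fun k hk => hWJ _ (getVert_edge₅ W hk)
  have hW'edge : ∀ k, k < W'.length → s(W'.getVert k, W'.getVert (k + 1)) ∈ J := fun k hk => hW'J _ (getVert_edge₅ W' hk)
  -- STEP 1: the upper connector `t+(0,-1) → t+(1,-1) → w′`
  have hL1 : u (i + 2) = t + ![1, -1] := by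
    have := next_eq₅ (i := i) hu hJ (x := t + ![-1, -1]) (y := t + ![1, -1]) (by rw [h1, Sym2.eq_swap]; exact cJ4)
      (by rw [h1]; exact cJ5) (off_ne₅ (by decide)) h0
    exact this
  have hL2 : u (i + 3) = t + ![2, -1] := by
    have := next_eq₅ (i := i + 1) hu hJ (x := t + ![0, -1]) (y := t + ![2, -1]) (by rw [show i + 1 + 1 = i + 2 by omega, hL1, Sym2.eq_swap]; exact cJ5)
      (by rw [show i + 1 + 1 = i + 2 by omega, hL1]; exact cJ6) (off_ne₅ (by decide)) h1
    rwa [show i + 1 + 2 = i + 3 by omega] at this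
  -- STEP 2: the `Q`-arc backwards, `u (i+3+k) = W'_k`
  have hQ1 : u (i + 4) = W'.getVert 1 := by
    have := next_eq₅ (i := i + 2) hu hJ (x := t + ![1, -1]) (y := W'.getVert 1) (by rw [show i + 2 + 1 = i + 3 by omega, hL2, Sym2.eq_swap]; exact cJ6) ?_ ?_ hL1
    · rwa [show i + 2 + 2 = i + 4 by omega] at this
    · rw [show i + 2 + 1 = i + 3 by omega, hL2]; have := hW'edge 0 (by omega); rwa [Walk.getVert_zero] at this
    · exact (fun he => h.f11.2 (he ▸ hW'v 1))
  have hQ_arc : ∀ k, k ≤ n - 1 → u (i + 3 + k) = W'.getVert k := fun k hk =>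
    hu.follows_path hJ W' hW' hW'J (i := i + 3) hL2 (fun _ => by rw [show i + 3 + 1 = i + 4 by omega]; exact hQ1) k (by omega)
  have huR0 : u (i + n + 2) = t + ![3, -1] := by
    have := hQ_arc (n - 1) le_rfl
    rw [show i + 3 + (n - 1) = i + n + 2 by omega, ← hW'len, Walk.getVert_length] at this; exact this
  have huR01 : u (i + n + 1) = W'.getVert (n - 2) := by
    have := hQ_arc (n - 2) (by omega); rwa [show i + 3 + (n - 2) = i + n + 1 by omega] at this
  have hW'last : s(t + ![3, -1], W'.getVert (n - 2)) ∈ J := by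
    have := hW'edge (n - 2) (by omega)
    rw [show n - 2 + 1 = n - 1 by omega, ← hW'len, Walk.getVert_length, Sym2.eq_swap] at this
    exact this
  -- STEP 3: the lower connector backwards
  have hR1 : u (i + n + 3) = t + ![3, 0] := by
    have := next_eq₅ (i := i + n + 1) hu hJ (x := W'.getVert (n - 2)) (y := t + ![3, 0]) (by rw [show i + n + 1 + 1 = i + n + 2 by omega, huR0]; exact hW'last)
      (by rw [show i + n + 1 + 1 = i + n + 2 by omega, huR0, Sym2.eq_swap]; exact cJc) (fun he => hjQ (he ▸ hW'v (n - 2))) huR01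
    rwa [show i + n + 1 + 2 = i + n + 3 by omega] at this
  have hR2 : u (i + n + 4) = t + ![2, 0] := by
    have := next_eq₅ (i := i + n + 2) hu hJ (x := t + ![3, -1]) (y := t + ![2, 0]) (by rw [show i + n + 2 + 1 = i + n + 3 by omega, hR1]; exact cJc)
      (by rw [show i + n + 2 + 1 = i + n + 3 by omega, hR1, Sym2.eq_swap]; exact cJ3) (off_ne₅ (by decide)) huR0
    rwa [show i + n + 2 + 2 = i + n + 4 by omega] at this
  have hR3 : u (i + n + 5) = t + ![1, 0] := by
    have := next_eq₅ (i := i + n + 3) hu hJ (x := t + ![3, 0]) (y := t + ![1, 0]) (by rw [show i + n + 3 + 1 = i + n + 4 by omega, hR2]; exact cJ3)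
      (by rw [show i + n + 3 + 1 = i + n + 4 by omega, hR2, Sym2.eq_swap]; exact cJ2) (off_ne₅ (by decide)) hR1
    rwa [show i + n + 3 + 2 = i + n + 5 by omega] at this
  have hR4 : u (i + n + 6) = t + ![0, 0] := by
    have := next_eq₅ (i := i + n + 4) hu hJ (x := t + ![2, 0]) (y := t + ![0, 0]) (by rw [show i + n + 4 + 1 = i + n + 5 by omega, hR3]; exact cJ2)
      (by rw [show i + n + 4 + 1 = i + n + 5 by omega, hR3, Sym2.eq_swap]; exact cJ1) (off_ne₅ (by decide)) hR2
    rwa [show i + n + 4 + 2 = i + n + 6 by omega] at this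
  -- STEP 4: the `P`-arc backwards
  have hP1 : u (i + n + 6 + 1) = W.getVert 1 := by
    have := next_eq₅ (i := i + n + 5) hu hJ (x := t + ![1, 0]) (y := W.getVert 1) (by rw [show i + n + 5 + 1 = i + n + 6 by omega, hR4]; exact cJ1) ?_ ?_ hR3
    · rwa [show i + n + 5 + 2 = i + n + 6 + 1 by omega] at this
    · rw [show i + n + 5 + 1 = i + n + 6 by omega, hR4]; have := hWedge 0 (by omega); rwa [Walk.getVert_zero] at this
    · exact (fun he => h.f10.1 (he ▸ hWv 1))
  have hP_arc : ∀ k, k ≤ n - 2 → u (i + n + 6 + k) = W.getVert k := fun k hk =>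
    hu.follows_path hJ W hW hWJ (i := i + n + 6) hR4 (fun _ => hP1) k (by omega)
  have huend : u (i + (2 * n + 4)) = t + ![-1, -1] := by
    have := hP_arc (n - 2) le_rfl
    rw [show i + n + 6 + (n - 2) = i + (2 * n + 4) by omega, ← hWlen, Walk.getVert_length] at this; exact this
  -- the backward cut
  refine isHdCutTF'_of_eqs_mirror t h1
    (by rw [show i + 1 + 1 = i + 2 by omega, hL1])
    (by rw [show i + 1 + 2 = i + 3 by omega, hL2])
    (by rw [show i + 1 + (n + 2) - 1 = i + n + 2 by omega, huR0])
    (by rw [show i + 1 + (n + 2) = i + n + 3 by omega, hR1])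
    (by rw [show i + 1 + (n + 2) + 1 = i + n + 4 by omega, hR2])
    (by rw [show i + 1 + (n + 2) + 2 = i + n + 5 by omega, hR3])
    (by rw [show i + 1 + (n + 2) + 3 = i + n + 6 by omega, hR4])
    (by rw [show i + 1 + 2 * (n + 2) - 1 = i + (2 * n + 4) by omega, huend])
    ?_
  -- row separation: the first block (upper connector, `Q`-arc) lies right of the second (lower connector, `P`-arc)
  intro a b ha1 ha2 hb1 hb2 hrow
  have haR : u a ∈ vertsOf Q ∨ (u a = t + ![0, -1] ∨ u a = t + ![1, -1]) := by
    rcases Nat.lt_or_ge a (i + 3) with hlt | hge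
    · right
      rcases Nat.lt_or_ge a (i + 2) with h1' | h1'
      · left; rw [show a = i + 1 by omega]; exact h1
      · right; rw [show a = i + 2 by omega]; exact hL1
    · left
      have := hQ_arc (a - (i + 3)) (by omega)
      rw [show i + 3 + (a - (i + 3)) = a by omega] at this
      rw [this]; exact hW'v _
  have hbL : u b ∈ vertsOf P ∨ (u b = t + ![3, 0] ∨ u b = t + ![2, 0] ∨ u b = t + ![1, 0]) := by
    rcases Nat.lt_or_ge b (i + n + 6) with hlt | hge
    · right
      rcases Nat.lt_or_ge b (i + n + 4) with h1' | h1'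
      · left; rw [show b = i + n + 3 by omega]; exact hR1
      rcases Nat.lt_or_ge b (i + n + 5) with h2' | h2'
      · right; left; rw [show b = i + n + 4 by omega]; exact hR2
      · right; right; rw [show b = i + n + 5 by omega]; exact hR3
    · left
      have := hP_arc (b - (i + n + 6)) (by omega)
      rw [show i + n + 6 + (b - (i + n + 6)) = b by omega] at this
      rw [this]; exact hWv _
  rcases haR with haQ | hj <;> rcases hbL with hbP | hj'
  · exact lt_of_lt_of_le (by omega) (hK1 _ hbP _ haQ (Or.inl hrow.symm))
  · -- a `Q`-site against a lower-connector site (row `t₁`): corridor against `t ∈ P`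
    rcases hj' with hbE | hbE | hbE <;> rw [hbE] at hrow ⊢
    · have := hK1 _ tP _ haQ (by simp at hrow ⊢; omega)
      simp at this hrow ⊢
      rcases lt_or_eq_of_le (show t 0 + 2 ≤ u a 0 by omega) with hlt | heq
      · rcases lt_or_eq_of_le (show t 0 + 3 ≤ u a 0 by omega) with hlt' | heq'
        · omega
        · exact absurd haQ (by rw [eq_off₅ (t := t) (x := u a) (a := 3) (b := 0) (by omega) (by omega)]; exact hjQ)
      · exact absurd haQ (by rw [eq_off₅ (t := t) (x := u a) (a := 2) (b := 0) (by omega) (by omega)]; exact h.f20.2)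
    · have := hK1 _ tP _ haQ (by simp at hrow ⊢; omega)
      simp at this hrow ⊢
      rcases lt_or_eq_of_le (show t 0 + 2 ≤ u a 0 by omega) with hlt | heq
      · omega
      · exact absurd haQ (by rw [eq_off₅ (t := t) (x := u a) (a := 2) (b := 0) (by omega) (by omega)]; exact h.f20.2)
    · have := hK1 _ tP _ haQ (by simp at hrow ⊢; omega); simp at this ⊢; omega
  · -- an upper-connector site against a `P`-site (row `t₁ + 1`): corridor against `w′ ∈ Q`
    rcases hj with haE | haE <;> rw [haE] at hrow ⊢
    · have := hK1 _ hbP _ wQ (by simp at hrow ⊢; omega)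
      simp at this hrow ⊢
      rcases lt_or_eq_of_le (show u b 0 ≤ t 0 by omega) with hlt | heq
      · omega
      · exact absurd hbP (by rw [eq_off₅ (t := t) (x := u b) (a := 0) (b := -1) (by omega) (by omega)]; exact h.f01.1)
    · have := hK1 _ hbP _ wQ (by simp at hrow ⊢; omega); simp at this ⊢; omega
  · rcases hj with haE | haE <;> rcases hj' with hbE | hbE | hbE <;> rw [haE, hbE] at hrow ⊢ <;>
      (simp only [Pi.add_apply, uz0, uz1] at hrow ⊢; omega)

/-- **A T3 decomposition, shape FT (`t+(−1,−1) ∉ P`, `t+(3,0) ∈ Q`), imposes, on the MIRROR `y ↦ −y` of the traversal, the forward horizontal cut `IsHdCutFT (n + 2) u (i+1)` for every traversal of the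
joined polygon with `u i = t + (-1,-1)`, `u (i+1) = t + (-1,0)`.** [cite: Hammond2015SAPJoining, §4.2 pp. 20–24 (arXiv v5: recognising the junction plaquette); Madras1995LatticeAnimalsExponent, §2] -/
theorem isHdCutFT_of_isT5 (hjP : t + ![-1, -1] ∉ vertsOf P) (hjQ : t + ![3, 0] ∈ vertsOf Q) (hu : IsPolyTraversal brickWallGraph (hdJoin' t P Q) (2 * n + 4) u) {i : ℕ}
    (h0 : u i = t + ![-1, -1]) (h1 : u (i + 1) = t + ![-1, 0]) : IsHdCutFT (n + 2) (fun k => ![u k 0, -(u k 1)]) (i + 1) := by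
  classical
  have hdisj := disjoint_of_corridor (P := P) (Q := Q) hK1
  obtain ⟨hJ, -⟩ := h.isPolygon_join hP hQ hdisj
  set J := hdJoin' t P Q with hJdef
  have hpar := h.hpar
  have tP : t + ![0, 0] ∈ vertsOf P := tP₅ h
  have wQ : t + ![2, -1] ∈ vertsOf Q := wQ₅ h
  have cJ1 : s(t + ![0, 0], t + ![1, 0]) ∈ J := cJ1₅ h
  have cJ2 : s(t + ![1, 0], t + ![2, 0]) ∈ J := cJ2₅ h
  have cJ3 : s(t + ![2, 0], t + ![3, 0]) ∈ J := cJ3₅ h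
  have cJ4 : s(t + ![-1, -1], t + ![0, -1]) ∈ J := cJ4₅ h
  have cJ5 : s(t + ![0, -1], t + ![1, -1]) ∈ J := cJ5₅ h
  have cJ6 : s(t + ![1, -1], t + ![2, -1]) ∈ J := cJ6₅ h
  have cJb : s(t + ![-1, 0], t + ![-1, -1]) ∈ J := cJb₅ h hjP
  -- open `P` at `b – t`: the `P`-arc `W : b ⇝ t`
  have hbt : s(t + ![-1, 0], t + ![0, 0]) ∈ P := by rw [Sym2.eq_swap]; exact h.hl
  obtain ⟨W, hW, hWe, -, hWl, hWs⟩ := hP.exists_isPath_erase hbt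
  have hWJ : ∀ e ∈ W.edges, e ∈ J := fun e he => by
    have hm : e ∈ P.erase s(t + ![-1, 0], t + ![0, 0]) := by rw [← hWe]; exact List.mem_toFinset.2 he
    exact memJ_of_memP₅ hK1 h (Finset.mem_erase.1 hm).2 (by rw [Sym2.eq_swap]; exact (Finset.mem_erase.1 hm).1)
      (fun hv => absurd hv hjP)
  have hWlen : W.length = n - 1 := by omega
  have hWv : ∀ k, W.getVert k ∈ vertsOf P := fun k => mem_vertsOf.2 ((hWs _).1 (W.getVert_mem_support k))
  -- open `Q` along `t+(3,0) – c – w′`: the `Q`-arc `W'`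
  have hqE : ∀ e ∈ (wQf₅ t hpar).edges, e ∈ Q := fun e he => by
    simp only [wQf₅, Walk.edges_cons, Walk.edges_nil, List.mem_cons, List.not_mem_nil, or_false] at he
    rcases he with rfl | rfl
    · exact forcedQ₅ hQ h hjQ
    · exact h.hr
  obtain ⟨W', hW', hW'e, hW'l, hW's⟩ := hQ.exists_isPath_sdiff (wQf₅ t hpar) (by rw [Walk.isPath_def]; simp [wQf₅]) hqE
    (by simp [wQf₅]) (by simp [wQf₅]; omega)
  have hql : (wQf₅ t hpar).length = 2 := by simp [wQf₅]
  have hW'J : ∀ e ∈ W'.edges, e ∈ J := fun e he => by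
    have hm : e ∈ Q \ (wQf₅ t hpar).edges.toFinset := by rw [← hW'e]; exact List.mem_toFinset.2 he
    rw [Finset.mem_sdiff] at hm
    have hne : ¬ (e = s(t + ![3, 0], t + ![3, -1]) ∨ e = s(t + ![3, -1], t + ![2, -1])) := by
      intro hh; apply hm.2
      simp only [wQf₅, Walk.edges_cons, Walk.edges_nil, List.toFinset_cons, List.toFinset_nil, Finset.mem_insert,
        Finset.notMem_empty, or_false]
      exact hh
    exact memJ_of_memQ₅ hK1 h hm.1 (fun he' => hne (Or.inr he')) (fun _ he' => hne (Or.inl he'))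
  have hW'len : W'.length = n - 2 := by rw [hql] at hW'l; omega
  have hW'v : ∀ k, W'.getVert k ∈ vertsOf Q := fun k => mem_vertsOf.2 ((hW's _).1 (W'.getVert_mem_support k)).1
  have hWedge : ∀ k, k < W.length → s(W.getVert k, W.getVert (k + 1)) ∈ J := fun k hk => hWJ _ (getVert_edge₅ W hk)
  have hW'edge : ∀ k, k < W'.length → s(W'.getVert k, W'.getVert (k + 1)) ∈ J := fun k hk => hW'J _ (getVert_edge₅ W' hk)
  -- STEP 1: the `P`-arc, `u (i+1+k) = W_k`
  have hu2 : u (i + 2) = W.getVert 1 := by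
    have := next_eq₅ (i := i) hu hJ (x := t + ![-1, -1]) (y := W.getVert 1) (by rw [h1]; exact cJb) ?_ ?_ h0
    · exact this
    · rw [h1]; have := hWedge 0 (by omega); rwa [Walk.getVert_zero] at this
    · exact (fun he => hjP (he ▸ hWv 1))
  have hP_arc : ∀ k, k ≤ n - 1 → u (i + 1 + k) = W.getVert k := fun k hk =>
    hu.follows_path hJ W hW hWJ (i := i + 1) h1 (fun _ => by rw [show i + 1 + 1 = i + 2 by omega]; exact hu2) k (by omega)
  have hut : u (i + n) = t + ![0, 0] := by
    have := hP_arc (n - 1) le_rfl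
    rw [show i + 1 + (n - 1) = i + n by omega, ← hWlen, Walk.getVert_length] at this; exact this
  have hut1 : u (i + n - 1) = W.getVert (n - 2) := by
    have := hP_arc (n - 2) (by omega); rwa [show i + 1 + (n - 2) = i + n - 1 by omega] at this
  have hWlast : s(t + ![0, 0], W.getVert (n - 2)) ∈ J := by
    have := hWedge (n - 2) (by omega)
    rw [show n - 2 + 1 = n - 1 by omega, ← hWlen, Walk.getVert_length, Sym2.eq_swap] at this
    exact this
  -- STEP 2: the lower connector
  have hR1 : u (i + n + 1) = t + ![1, 0] := by
    have := next_eq₅ (i := i + n - 1) hu hJ (x := W.getVert (n - 2)) (y := t + ![1, 0]) (by rw [show i + n - 1 + 1 = i + n by omega, hut]; exact hWlast)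
      (by rw [show i + n - 1 + 1 = i + n by omega, hut]; exact cJ1) (fun he => h.f10.1 (he ▸ hWv (n - 2))) hut1
    rwa [show i + n - 1 + 2 = i + n + 1 by omega] at this
  have hR2 : u (i + n + 2) = t + ![2, 0] := by
    have := next_eq₅ (i := i + n) hu hJ (x := t + ![0, 0]) (y := t + ![2, 0]) (by rw [hR1, Sym2.eq_swap]; exact cJ1)
      (by rw [hR1]; exact cJ2) (off_ne₅ (by decide)) hut
    exact this
  have hR3 : u (i + n + 3) = t + ![3, 0] := by
    have := next_eq₅ (i := i + n + 1) hu hJ (x := t + ![1, 0]) (y := t + ![3, 0]) (by rw [show i + n + 1 + 1 = i + n + 2 by omega, hR2, Sym2.eq_swap]; exact cJ2)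
      (by rw [show i + n + 1 + 1 = i + n + 2 by omega, hR2]; exact cJ3) (off_ne₅ (by decide)) hR1
    rwa [show i + n + 1 + 2 = i + n + 3 by omega] at this
  -- STEP 3: the `Q`-arc
  have hQ1 : u (i + n + 3 + 1) = W'.getVert 1 := by
    have := next_eq₅ (i := i + n + 2) hu hJ (x := t + ![2, 0]) (y := W'.getVert 1) (by rw [show i + n + 2 + 1 = i + n + 3 by omega, hR3, Sym2.eq_swap]; exact cJ3) ?_ ?_ hR2
    · rwa [show i + n + 2 + 2 = i + n + 3 + 1 by omega] at this
    · rw [show i + n + 2 + 1 = i + n + 3 by omega, hR3]; have := hW'edge 0 (by omega); rwa [Walk.getVert_zero] at this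
    · exact (fun he => h.f20.2 (he ▸ hW'v 1))
  have hQ_arc : ∀ k, k ≤ n - 2 → u (i + n + 3 + k) = W'.getVert k := fun k hk =>
    hu.follows_path hJ W' hW' hW'J (i := i + n + 3) hR3 (fun _ => hQ1) k (by omega)
  have huw : u (i + 2 * n + 1) = t + ![2, -1] := by
    have := hQ_arc (n - 2) le_rfl
    rw [show i + n + 3 + (n - 2) = i + 2 * n + 1 by omega, ← hW'len, Walk.getVert_length] at this; exact this
  have huw1 : u (i + 2 * n) = W'.getVert (n - 3) := by
    have := hQ_arc (n - 3) (by omega); rwa [show i + n + 3 + (n - 3) = i + 2 * n by omega] at this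
  have hW'last : s(t + ![2, -1], W'.getVert (n - 3)) ∈ J := by
    have := hW'edge (n - 3) (by omega)
    rw [show n - 3 + 1 = n - 2 by omega, ← hW'len, Walk.getVert_length, Sym2.eq_swap] at this
    exact this
  -- STEP 4: the upper connector
  have hL1 : u (i + 2 * n + 2) = t + ![1, -1] := by
    have := next_eq₅ (i := i + 2 * n) hu hJ (x := W'.getVert (n - 3)) (y := t + ![1, -1]) (by rw [huw]; exact hW'last)
      (by rw [huw, Sym2.eq_swap]; exact cJ6) (fun he => h.f11.2 (he ▸ hW'v (n - 3))) huw1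
    exact this
  have hL2 : u (i + 2 * n + 3) = t + ![0, -1] := by
    have := next_eq₅ (i := i + 2 * n + 1) hu hJ (x := t + ![2, -1]) (y := t + ![0, -1]) (by rw [show i + 2 * n + 1 + 1 = i + 2 * n + 2 by omega, hL1]; exact cJ6)
      (by rw [show i + 2 * n + 1 + 1 = i + 2 * n + 2 by omega, hL1, Sym2.eq_swap]; exact cJ5) (off_ne₅ (by decide)) huw
    rwa [show i + 2 * n + 1 + 2 = i + 2 * n + 3 by omega] at this
  have hL3 : u (i + 2 * n + 4) = t + ![-1, -1] := by rw [show i + 2 * n + 4 = i + (2 * n + 4) by omega, hu.periodic, h0]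
  -- the cut
  refine isHdCutFT_of_eqs_mirror t h1
    (by rw [show i + 1 + (n + 2) - 3 = i + n by omega, hut])
    (by rw [show i + 1 + (n + 2) - 2 = i + n + 1 by omega, hR1])
    (by rw [show i + 1 + (n + 2) - 1 = i + n + 2 by omega, hR2])
    (by rw [show i + 1 + (n + 2) = i + n + 3 by omega, hR3])
    (by rw [show i + 1 + 2 * (n + 2) - 4 = i + 2 * n + 1 by omega, huw])
    (by rw [show i + 1 + 2 * (n + 2) - 3 = i + 2 * n + 2 by omega, hL1])
    (by rw [show i + 1 + 2 * (n + 2) - 2 = i + 2 * n + 3 by omega, hL2])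
    (by rw [show i + 1 + 2 * (n + 2) - 1 = i + 2 * n + 4 by omega, hL3])
    ?_
  -- row separation: the left block (`P`-arc and lower connector) lies left of the right block (`Q`-arc and upper connector)
  intro a b ha1 ha2 hb1 hb2 hrow
  have haL : u a ∈ vertsOf P ∨ (u a = t + ![1, 0] ∨ u a = t + ![2, 0]) := by
    rcases Nat.lt_or_ge a (i + n + 1) with hlt | hge
    · left
      have := hP_arc (a - (i + 1)) (by omega)
      rw [show i + 1 + (a - (i + 1)) = a by omega] at this
      rw [this]; exact hWv _
    · right
      rcases Nat.lt_or_ge a (i + n + 2) with h1' | h1'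
      · left; rw [show a = i + n + 1 by omega]; exact hR1
      · right; rw [show a = i + n + 2 by omega]; exact hR2
  have hbR : u b ∈ vertsOf Q ∨ (u b = t + ![1, -1] ∨ u b = t + ![0, -1] ∨ u b = t + ![-1, -1]) := by
    rcases Nat.lt_or_ge b (i + 2 * n + 1 + 1) with hlt | hge
    · left
      have := hQ_arc (b - (i + n + 3)) (by omega)
      rw [show i + n + 3 + (b - (i + n + 3)) = b by omega] at this
      rw [this]; exact hW'v _
    · right
      rcases Nat.lt_or_ge b (i + 2 * n + 1 + 2) with h1' | h1'
      · left; rw [show b = i + 2 * n + 2 by omega]; exact hL1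
      rcases Nat.lt_or_ge b (i + 2 * n + 1 + 3) with h2' | h2'
      · right; left; rw [show b = i + 2 * n + 3 by omega]; exact hL2
      · right; right; rw [show b = i + 2 * n + 4 by omega]; exact hL3
  rcases haL with haP | hj <;> rcases hbR with hbQ | hj'
  · exact lt_of_lt_of_le (by omega) (hK1 _ haP _ hbQ (Or.inl hrow))
  · -- a `P`-site against an upper-connector site (row `t₁ + 1`): corridor against `w′ ∈ Q`; `t+(0,-1)`, `t+(−1,−1)` are off `P`
    rcases hj' with hbE | hbE | hbE <;> rw [hbE] at hrow ⊢
    · have := hK1 _ haP _ wQ (by simp at hrow ⊢; omega); simp at this ⊢; omega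
    · have := hK1 _ haP _ wQ (by simp at hrow ⊢; omega)
      simp at this hrow ⊢
      rcases lt_or_eq_of_le (show u a 0 ≤ t 0 by omega) with hlt | heq
      · omega
      · exact absurd haP (by rw [eq_off₅ (t := t) (x := u a) (a := 0) (b := -1) (by omega) (by omega)]; exact h.f01.1)
    · have := hK1 _ haP _ wQ (by simp at hrow ⊢; omega)
      simp at this hrow ⊢
      rcases lt_or_eq_of_le (show u a 0 ≤ t 0 by omega) with hlt | heq
      · rcases lt_or_eq_of_le (show u a 0 ≤ t 0 - 1 by omega) with hlt' | heq'
        · omega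
        · exact absurd haP (by rw [eq_off₅ (t := t) (x := u a) (a := -1) (b := -1) (by omega) (by omega)]; exact hjP)
      · exact absurd haP (by rw [eq_off₅ (t := t) (x := u a) (a := 0) (b := -1) (by omega) (by omega)]; exact h.f01.1)
  · -- a lower-connector site against a `Q`-site (row `t₁`): corridor against `t ∈ P`; `t+(2,0)`, `t+(3,0)` are off `Q`
    rcases hj with haE | haE <;> rw [haE] at hrow ⊢
    · have := hK1 _ tP _ hbQ (by simp at hrow ⊢; omega); simp at this ⊢; omega
    · have := hK1 _ tP _ hbQ (by simp at hrow ⊢; omega)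
      simp at this hrow ⊢
      rcases lt_or_eq_of_le (show t 0 + 2 ≤ u b 0 by omega) with hlt | heq
      · omega
      · exact absurd hbQ (by rw [eq_off₅ (t := t) (x := u b) (a := 2) (b := 0) (by omega) (by omega)]; exact h.f20.2)
  · rcases hj with haE | haE <;> rcases hj' with hbE | hbE | hbE <;> rw [haE, hbE] at hrow ⊢ <;>
      (simp only [Pi.add_apply, uz0, uz1] at hrow ⊢; omega)

/-- **A T3 decomposition, shape FT (`t+(−1,−1) ∉ P`, `t+(3,0) ∈ Q`), imposes, on the MIRROR `y ↦ −y` of the traversal, the BACKWARD horizontal cut `IsHdCutFT' (n + 2) u (i+1)` for every traversal of the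
joined polygon with `u i = t + (-1,0)`, `u (i+1) = t + (-1,-1)`.** [cite: Hammond2015SAPJoining, §4.2 pp. 20–24 (arXiv v5: recognising the junction plaquette); Madras1995LatticeAnimalsExponent, §2] -/
theorem isHdCutFT'_of_isT5 (hjP : t + ![-1, -1] ∉ vertsOf P) (hjQ : t + ![3, 0] ∈ vertsOf Q) (hu : IsPolyTraversal brickWallGraph (hdJoin' t P Q) (2 * n + 4) u) {i : ℕ}
    (h0 : u i = t + ![-1, 0]) (h1 : u (i + 1) = t + ![-1, -1]) : IsHdCutFT' (n + 2) (fun k => ![u k 0, -(u k 1)]) (i + 1) := by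
  classical
  have hdisj := disjoint_of_corridor (P := P) (Q := Q) hK1
  obtain ⟨hJ, -⟩ := h.isPolygon_join hP hQ hdisj
  set J := hdJoin' t P Q with hJdef
  have hpar := h.hpar
  have tP : t + ![0, 0] ∈ vertsOf P := tP₅ h
  have wQ : t + ![2, -1] ∈ vertsOf Q := wQ₅ h
  have cJ1 : s(t + ![0, 0], t + ![1, 0]) ∈ J := cJ1₅ h
  have cJ2 : s(t + ![1, 0], t + ![2, 0]) ∈ J := cJ2₅ h
  have cJ3 : s(t + ![2, 0], t + ![3, 0]) ∈ J := cJ3₅ h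
  have cJ4 : s(t + ![-1, -1], t + ![0, -1]) ∈ J := cJ4₅ h
  have cJ5 : s(t + ![0, -1], t + ![1, -1]) ∈ J := cJ5₅ h
  have cJ6 : s(t + ![1, -1], t + ![2, -1]) ∈ J := cJ6₅ h
  have cJb : s(t + ![-1, 0], t + ![-1, -1]) ∈ J := cJb₅ h hjP
  -- open `P` at `t – b`: the `P`-arc `W : t ⇝ b`
  obtain ⟨W, hW, hWe, -, hWl, hWs⟩ := hP.exists_isPath_erase h.hl
  have hWJ : ∀ e ∈ W.edges, e ∈ J := fun e he => by
    have hm : e ∈ P.erase s(t + ![0, 0], t + ![-1, 0]) := by rw [← hWe]; exact List.mem_toFinset.2 he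
    exact memJ_of_memP₅ hK1 h (Finset.mem_erase.1 hm).2 (Finset.mem_erase.1 hm).1 (fun hv => absurd hv hjP)
  have hWlen : W.length = n - 1 := by omega
  have hWv : ∀ k, W.getVert k ∈ vertsOf P := fun k => mem_vertsOf.2 ((hWs _).1 (W.getVert_mem_support k))
  -- open `Q` along `t+(3,0) – c – w′`: the `Q`-arc `W'`
  have hqE : ∀ e ∈ (wQb₅ t hpar).edges, e ∈ Q := fun e he => by
    simp only [wQb₅, Walk.edges_cons, Walk.edges_nil, List.mem_cons, List.not_mem_nil, or_false] at he
    rcases he with rfl | rfl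
    · rw [Sym2.eq_swap]; exact h.hr
    · rw [Sym2.eq_swap]; exact forcedQ₅ hQ h hjQ
  obtain ⟨W', hW', hW'e, hW'l, hW's⟩ := hQ.exists_isPath_sdiff (wQb₅ t hpar) (by rw [Walk.isPath_def]; simp [wQb₅]) hqE
    (by simp [wQb₅]) (by simp [wQb₅]; omega)
  have hql : (wQb₅ t hpar).length = 2 := by simp [wQb₅]
  have hW'J : ∀ e ∈ W'.edges, e ∈ J := fun e he => by
    have hm : e ∈ Q \ (wQb₅ t hpar).edges.toFinset := by rw [← hW'e]; exact List.mem_toFinset.2 he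
    rw [Finset.mem_sdiff] at hm
    have hne : ¬ (e = s(t + ![2, -1], t + ![3, -1]) ∨ e = s(t + ![3, -1], t + ![3, 0])) := by
      intro hh; apply hm.2
      simp only [wQb₅, Walk.edges_cons, Walk.edges_nil, List.toFinset_cons, List.toFinset_nil, Finset.mem_insert,
        Finset.notMem_empty, or_false]
      exact hh
    exact memJ_of_memQ₅ hK1 h hm.1 (fun he' => hne (Or.inl (by rw [Sym2.eq_swap]; exact he')))
      (fun _ he' => hne (Or.inr (by rw [Sym2.eq_swap]; exact he')))
  have hW'len : W'.length = n - 2 := by rw [hql] at hW'l; omega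
  have hW'v : ∀ k, W'.getVert k ∈ vertsOf Q := fun k => mem_vertsOf.2 ((hW's _).1 (W'.getVert_mem_support k)).1
  have hWedge : ∀ k, k < W.length → s(W.getVert k, W.getVert (k + 1)) ∈ J := fun k hk => hWJ _ (getVert_edge₅ W hk)
  have hW'edge : ∀ k, k < W'.length → s(W'.getVert k, W'.getVert (k + 1)) ∈ J := fun k hk => hW'J _ (getVert_edge₅ W' hk)
  -- STEP 1: the upper connector `t+(−1,−1) → t+(0,-1) → t+(1,-1) → w′`
  have hL1 : u (i + 2) = t + ![0, -1] := by
    have := next_eq₅ (i := i) hu hJ (x := t + ![-1, 0]) (y := t + ![0, -1]) (by rw [h1, Sym2.eq_swap]; exact cJb)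
      (by rw [h1]; exact cJ4) (off_ne₅ (by decide)) h0
    exact this
  have hL2 : u (i + 3) = t + ![1, -1] := by
    have := next_eq₅ (i := i + 1) hu hJ (x := t + ![-1, -1]) (y := t + ![1, -1]) (by rw [show i + 1 + 1 = i + 2 by omega, hL1, Sym2.eq_swap]; exact cJ4)
      (by rw [show i + 1 + 1 = i + 2 by omega, hL1]; exact cJ5) (off_ne₅ (by decide)) h1
    rwa [show i + 1 + 2 = i + 3 by omega] at this
  have hL3 : u (i + 4) = t + ![2, -1] := by
    have := next_eq₅ (i := i + 2) hu hJ (x := t + ![0, -1]) (y := t + ![2, -1]) (by rw [show i + 2 + 1 = i + 3 by omega, hL2, Sym2.eq_swap]; exact cJ5)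
      (by rw [show i + 2 + 1 = i + 3 by omega, hL2]; exact cJ6) (off_ne₅ (by decide)) hL1
    rwa [show i + 2 + 2 = i + 4 by omega] at this
  -- STEP 2: the `Q`-arc backwards, `u (i+4+k) = W'_k`
  have hQ1 : u (i + 5) = W'.getVert 1 := by
    have := next_eq₅ (i := i + 3) hu hJ (x := t + ![1, -1]) (y := W'.getVert 1) (by rw [show i + 3 + 1 = i + 4 by omega, hL3, Sym2.eq_swap]; exact cJ6) ?_ ?_ hL2
    · rwa [show i + 3 + 2 = i + 5 by omega] at this
    · rw [show i + 3 + 1 = i + 4 by omega, hL3]; have := hW'edge 0 (by omega); rwa [Walk.getVert_zero] at this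
    · exact (fun he => h.f11.2 (he ▸ hW'v 1))
  have hQ_arc : ∀ k, k ≤ n - 2 → u (i + 4 + k) = W'.getVert k := fun k hk =>
    hu.follows_path hJ W' hW' hW'J (i := i + 4) hL3 (fun _ => by rw [show i + 4 + 1 = i + 5 by omega]; exact hQ1) k (by omega)
  have huR0 : u (i + n + 2) = t + ![3, 0] := by
    have := hQ_arc (n - 2) le_rfl
    rw [show i + 4 + (n - 2) = i + n + 2 by omega, ← hW'len, Walk.getVert_length] at this; exact this
  have huR01 : u (i + n + 1) = W'.getVert (n - 3) := by
    have := hQ_arc (n - 3) (by omega); rwa [show i + 4 + (n - 3) = i + n + 1 by omega] at this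
  have hW'last : s(t + ![3, 0], W'.getVert (n - 3)) ∈ J := by
    have := hW'edge (n - 3) (by omega)
    rw [show n - 3 + 1 = n - 2 by omega, ← hW'len, Walk.getVert_length, Sym2.eq_swap] at this
    exact this
  -- STEP 3: the lower connector backwards
  have hR1 : u (i + n + 3) = t + ![2, 0] := by
    have := next_eq₅ (i := i + n + 1) hu hJ (x := W'.getVert (n - 3)) (y := t + ![2, 0]) (by rw [show i + n + 1 + 1 = i + n + 2 by omega, huR0]; exact hW'last)
      (by rw [show i + n + 1 + 1 = i + n + 2 by omega, huR0, Sym2.eq_swap]; exact cJ3) (fun he => h.f20.2 (he ▸ hW'v (n - 3))) huR01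
    rwa [show i + n + 1 + 2 = i + n + 3 by omega] at this
  have hR2 : u (i + n + 4) = t + ![1, 0] := by
    have := next_eq₅ (i := i + n + 2) hu hJ (x := t + ![3, 0]) (y := t + ![1, 0]) (by rw [show i + n + 2 + 1 = i + n + 3 by omega, hR1]; exact cJ3)
      (by rw [show i + n + 2 + 1 = i + n + 3 by omega, hR1, Sym2.eq_swap]; exact cJ2) (off_ne₅ (by decide)) huR0
    rwa [show i + n + 2 + 2 = i + n + 4 by omega] at this
  have hR3 : u (i + n + 5) = t + ![0, 0] := by
    have := next_eq₅ (i := i + n + 3) hu hJ (x := t + ![2, 0]) (y := t + ![0, 0]) (by rw [show i + n + 3 + 1 = i + n + 4 by omega, hR2]; exact cJ2)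
      (by rw [show i + n + 3 + 1 = i + n + 4 by omega, hR2, Sym2.eq_swap]; exact cJ1) (off_ne₅ (by decide)) hR1
    rwa [show i + n + 3 + 2 = i + n + 5 by omega] at this
  -- STEP 4: the `P`-arc backwards
  have hP1 : u (i + n + 5 + 1) = W.getVert 1 := by
    have := next_eq₅ (i := i + n + 4) hu hJ (x := t + ![1, 0]) (y := W.getVert 1) (by rw [show i + n + 4 + 1 = i + n + 5 by omega, hR3]; exact cJ1) ?_ ?_ hR2
    · rwa [show i + n + 4 + 2 = i + n + 5 + 1 by omega] at this
    · rw [show i + n + 4 + 1 = i + n + 5 by omega, hR3]; have := hWedge 0 (by omega); rwa [Walk.getVert_zero] at this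
    · exact (fun he => h.f10.1 (he ▸ hWv 1))
  have hP_arc : ∀ k, k ≤ n - 1 → u (i + n + 5 + k) = W.getVert k := fun k hk =>
    hu.follows_path hJ W hW hWJ (i := i + n + 5) hR3 (fun _ => hP1) k (by omega)
  have huend : u (i + (2 * n + 4)) = t + ![-1, 0] := by
    have := hP_arc (n - 1) le_rfl
    rw [show i + n + 5 + (n - 1) = i + (2 * n + 4) by omega, ← hWlen, Walk.getVert_length] at this; exact this
  -- the backward cut
  refine isHdCutFT'_of_eqs_mirror t h1
    (by rw [show i + 1 + 1 = i + 2 by omega, hL1])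
    (by rw [show i + 1 + 2 = i + 3 by omega, hL2])
    (by rw [show i + 1 + 3 = i + 4 by omega, hL3])
    (by rw [show i + 1 + (n + 2) - 1 = i + n + 2 by omega, huR0])
    (by rw [show i + 1 + (n + 2) = i + n + 3 by omega, hR1])
    (by rw [show i + 1 + (n + 2) + 1 = i + n + 4 by omega, hR2])
    (by rw [show i + 1 + (n + 2) + 2 = i + n + 5 by omega, hR3])
    (by rw [show i + 1 + 2 * (n + 2) - 1 = i + (2 * n + 4) by omega, huend])
    ?_
  -- row separation: the first block (upper connector, `Q`-arc) lies right of the second (lower connector, `P`-arc)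
  intro a b ha1 ha2 hb1 hb2 hrow
  have haR : u a ∈ vertsOf Q ∨ (u a = t + ![-1, -1] ∨ u a = t + ![0, -1] ∨ u a = t + ![1, -1]) := by
    rcases Nat.lt_or_ge a (i + 4) with hlt | hge
    · right
      rcases Nat.lt_or_ge a (i + 2) with h1' | h1'
      · left; rw [show a = i + 1 by omega]; exact h1
      rcases Nat.lt_or_ge a (i + 3) with h2' | h2'
      · right; left; rw [show a = i + 2 by omega]; exact hL1
      · right; right; rw [show a = i + 3 by omega]; exact hL2
    · left
      have := hQ_arc (a - (i + 4)) (by omega)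
      rw [show i + 4 + (a - (i + 4)) = a by omega] at this
      rw [this]; exact hW'v _
  have hbL : u b ∈ vertsOf P ∨ (u b = t + ![2, 0] ∨ u b = t + ![1, 0]) := by
    rcases Nat.lt_or_ge b (i + n + 5) with hlt | hge
    · right
      rcases Nat.lt_or_ge b (i + n + 4) with h1' | h1'
      · left; rw [show b = i + n + 3 by omega]; exact hR1
      · right; rw [show b = i + n + 4 by omega]; exact hR2
    · left
      have := hP_arc (b - (i + n + 5)) (by omega)
      rw [show i + n + 5 + (b - (i + n + 5)) = b by omega] at this
      rw [this]; exact hWv _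
  rcases haR with haQ | hj <;> rcases hbL with hbP | hj'
  · exact lt_of_lt_of_le (by omega) (hK1 _ hbP _ haQ (Or.inl hrow.symm))
  · -- a `Q`-site against a lower-connector site (row `t₁`): corridor against `t ∈ P`
    rcases hj' with hbE | hbE <;> rw [hbE] at hrow ⊢
    · have := hK1 _ tP _ haQ (by simp at hrow ⊢; omega)
      simp at this hrow ⊢
      rcases lt_or_eq_of_le (show t 0 + 2 ≤ u a 0 by omega) with hlt | heq
      · omega
      · exact absurd haQ (by rw [eq_off₅ (t := t) (x := u a) (a := 2) (b := 0) (by omega) (by omega)]; exact h.f20.2)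
    · have := hK1 _ tP _ haQ (by simp at hrow ⊢; omega); simp at this ⊢; omega
  · -- an upper-connector site against a `P`-site (row `t₁ + 1`): corridor against `w′ ∈ Q`
    rcases hj with haE | haE | haE <;> rw [haE] at hrow ⊢
    · have := hK1 _ hbP _ wQ (by simp at hrow ⊢; omega)
      simp at this hrow ⊢
      rcases lt_or_eq_of_le (show u b 0 ≤ t 0 by omega) with hlt | heq
      · rcases lt_or_eq_of_le (show u b 0 ≤ t 0 - 1 by omega) with hlt' | heq'
        · omega
        · exact absurd hbP (by rw [eq_off₅ (t := t) (x := u b) (a := -1) (b := -1) (by omega) (by omega)]; exact hjP)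
      · exact absurd hbP (by rw [eq_off₅ (t := t) (x := u b) (a := 0) (b := -1) (by omega) (by omega)]; exact h.f01.1)
    · have := hK1 _ hbP _ wQ (by simp at hrow ⊢; omega)
      simp at this hrow ⊢
      rcases lt_or_eq_of_le (show u b 0 ≤ t 0 by omega) with hlt | heq
      · omega
      · exact absurd hbP (by rw [eq_off₅ (t := t) (x := u b) (a := 0) (b := -1) (by omega) (by omega)]; exact h.f01.1)
    · have := hK1 _ hbP _ wQ (by simp at hrow ⊢; omega); simp at this ⊢; omega
  · rcases hj with haE | haE | haE <;> rcases hj' with hbE | hbE <;> rw [haE, hbE] at hrow ⊢ <;>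
      (simp only [Pi.add_apply, uz0, uz1] at hrow ⊢; omega)

/-- **A T3 decomposition, shape TT (`t+(−1,−1) ∈ P`, `t+(3,0) ∈ Q`), imposes, on the MIRROR `y ↦ −y` of the traversal, the forward horizontal cut `IsHdCutTT (n + 1) u (i+1)` for every traversal of the
joined polygon with `u i = t + (0,-1)`, `u (i+1) = t + (-1,-1)`.** [cite: Hammond2015SAPJoining, §4.2 pp. 20–24 (arXiv v5: recognising the junction plaquette); Madras1995LatticeAnimalsExponent, §2] -/
theorem isHdCutTT_of_isT5 (hjP : t + ![-1, -1] ∈ vertsOf P) (hjQ : t + ![3, 0] ∈ vertsOf Q) (hu : IsPolyTraversal brickWallGraph (hdJoin' t P Q) (2 * n + 2) u) {i : ℕ}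
    (h0 : u i = t + ![0, -1]) (h1 : u (i + 1) = t + ![-1, -1]) : IsHdCutTT (n + 1) (fun k => ![u k 0, -(u k 1)]) (i + 1) := by
  classical
  have hdisj := disjoint_of_corridor (P := P) (Q := Q) hK1
  obtain ⟨hJ, -⟩ := h.isPolygon_join hP hQ hdisj
  set J := hdJoin' t P Q with hJdef
  have hpar := h.hpar
  have tP : t + ![0, 0] ∈ vertsOf P := tP₅ h
  have wQ : t + ![2, -1] ∈ vertsOf Q := wQ₅ h
  have cJ1 : s(t + ![0, 0], t + ![1, 0]) ∈ J := cJ1₅ h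
  have cJ2 : s(t + ![1, 0], t + ![2, 0]) ∈ J := cJ2₅ h
  have cJ3 : s(t + ![2, 0], t + ![3, 0]) ∈ J := cJ3₅ h
  have cJ4 : s(t + ![-1, -1], t + ![0, -1]) ∈ J := cJ4₅ h
  have cJ5 : s(t + ![0, -1], t + ![1, -1]) ∈ J := cJ5₅ h
  have cJ6 : s(t + ![1, -1], t + ![2, -1]) ∈ J := cJ6₅ h
  -- open `P` along `t+(−1,−1) – b – t`: the `P`-arc `W`
  have hpE : ∀ e ∈ (wPf₅ t hpar).edges, e ∈ P := fun e he => by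
    simp only [wPf₅, Walk.edges_cons, Walk.edges_nil, List.mem_cons, List.not_mem_nil, or_false] at he
    rcases he with rfl | rfl
    · exact forcedP₅ hP h hjP
    · rw [Sym2.eq_swap]; exact h.hl
  obtain ⟨W, hW, hWe, hWl, hWs⟩ := hP.exists_isPath_sdiff (wPf₅ t hpar) (by rw [Walk.isPath_def]; simp [wPf₅]) hpE
    (by simp [wPf₅]) (by simp [wPf₅]; omega)
  have hpl : (wPf₅ t hpar).length = 2 := by simp [wPf₅]
  have hWJ : ∀ e ∈ W.edges, e ∈ J := fun e he => by
    have hm : e ∈ P \ (wPf₅ t hpar).edges.toFinset := by rw [← hWe]; exact List.mem_toFinset.2 he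
    rw [Finset.mem_sdiff] at hm
    have hne : ¬ (e = s(t + ![-1, -1], t + ![-1, 0]) ∨ e = s(t + ![-1, 0], t + ![0, 0])) := by
      intro hh; apply hm.2
      simp only [wPf₅, Walk.edges_cons, Walk.edges_nil, List.toFinset_cons, List.toFinset_nil, Finset.mem_insert,
        Finset.notMem_empty, or_false]
      exact hh
    exact memJ_of_memP₅ hK1 h hm.1 (fun he' => hne (Or.inr (by rw [Sym2.eq_swap]; exact he')))
      (fun _ he' => hne (Or.inl (by rw [Sym2.eq_swap]; exact he')))
  have hWlen : W.length = n - 2 := by rw [hpl] at hWl; omega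
  have hWv : ∀ k, W.getVert k ∈ vertsOf P := fun k => mem_vertsOf.2 ((hWs _).1 (W.getVert_mem_support k)).1
  -- open `Q` along `t+(3,0) – c – w′`: the `Q`-arc `W'`
  have hqE : ∀ e ∈ (wQf₅ t hpar).edges, e ∈ Q := fun e he => by
    simp only [wQf₅, Walk.edges_cons, Walk.edges_nil, List.mem_cons, List.not_mem_nil, or_false] at he
    rcases he with rfl | rfl
    · exact forcedQ₅ hQ h hjQ
    · exact h.hr
  obtain ⟨W', hW', hW'e, hW'l, hW's⟩ := hQ.exists_isPath_sdiff (wQf₅ t hpar) (by rw [Walk.isPath_def]; simp [wQf₅]) hqE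
    (by simp [wQf₅]) (by simp [wQf₅]; omega)
  have hql : (wQf₅ t hpar).length = 2 := by simp [wQf₅]
  have hW'J : ∀ e ∈ W'.edges, e ∈ J := fun e he => by
    have hm : e ∈ Q \ (wQf₅ t hpar).edges.toFinset := by rw [← hW'e]; exact List.mem_toFinset.2 he
    rw [Finset.mem_sdiff] at hm
    have hne : ¬ (e = s(t + ![3, 0], t + ![3, -1]) ∨ e = s(t + ![3, -1], t + ![2, -1])) := by
      intro hh; apply hm.2
      simp only [wQf₅, Walk.edges_cons, Walk.edges_nil, List.toFinset_cons, List.toFinset_nil, Finset.mem_insert,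
        Finset.notMem_empty, or_false]
      exact hh
    exact memJ_of_memQ₅ hK1 h hm.1 (fun he' => hne (Or.inr he')) (fun _ he' => hne (Or.inl he'))
  have hW'len : W'.length = n - 2 := by rw [hql] at hW'l; omega
  have hW'v : ∀ k, W'.getVert k ∈ vertsOf Q := fun k => mem_vertsOf.2 ((hW's _).1 (W'.getVert_mem_support k)).1
  have hWedge : ∀ k, k < W.length → s(W.getVert k, W.getVert (k + 1)) ∈ J := fun k hk => hWJ _ (getVert_edge₅ W hk)
  have hW'edge : ∀ k, k < W'.length → s(W'.getVert k, W'.getVert (k + 1)) ∈ J := fun k hk => hW'J _ (getVert_edge₅ W' hk)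
  -- STEP 1: the `P`-arc, `u (i+1+k) = W_k`
  have hu2 : u (i + 2) = W.getVert 1 := by
    have := next_eq₅ (i := i) hu hJ (x := t + ![0, -1]) (y := W.getVert 1) (by rw [h1]; exact cJ4) ?_ ?_ h0
    · exact this
    · rw [h1]; have := hWedge 0 (by omega); rwa [Walk.getVert_zero] at this
    · exact (fun he => h.f01.1 (he ▸ hWv 1))
  have hP_arc : ∀ k, k ≤ n - 2 → u (i + 1 + k) = W.getVert k := fun k hk =>
    hu.follows_path hJ W hW hWJ (i := i + 1) h1 (fun _ => by rw [show i + 1 + 1 = i + 2 by omega]; exact hu2) k (by omega)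
  have hut : u (i + n - 1) = t + ![0, 0] := by
    have := hP_arc (n - 2) le_rfl
    rw [show i + 1 + (n - 2) = i + n - 1 by omega, ← hWlen, Walk.getVert_length] at this; exact this
  have hut1 : u (i + n - 2) = W.getVert (n - 3) := by
    have := hP_arc (n - 3) (by omega); rwa [show i + 1 + (n - 3) = i + n - 2 by omega] at this
  have hWlast : s(t + ![0, 0], W.getVert (n - 3)) ∈ J := by
    have := hWedge (n - 3) (by omega)
    rw [show n - 3 + 1 = n - 2 by omega, ← hWlen, Walk.getVert_length, Sym2.eq_swap] at this
    exact this
  -- STEP 2: the lower connector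
  have hR1 : u (i + n) = t + ![1, 0] := by
    have := next_eq₅ (i := i + n - 2) hu hJ (x := W.getVert (n - 3)) (y := t + ![1, 0]) (by rw [show i + n - 2 + 1 = i + n - 1 by omega, hut]; exact hWlast)
      (by rw [show i + n - 2 + 1 = i + n - 1 by omega, hut]; exact cJ1) (fun he => h.f10.1 (he ▸ hWv (n - 3))) hut1
    rwa [show i + n - 2 + 2 = i + n by omega] at this
  have hR2 : u (i + n + 1) = t + ![2, 0] := by
    have := next_eq₅ (i := i + n - 1) hu hJ (x := t + ![0, 0]) (y := t + ![2, 0]) (by rw [show i + n - 1 + 1 = i + n by omega, hR1, Sym2.eq_swap]; exact cJ1)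
      (by rw [show i + n - 1 + 1 = i + n by omega, hR1]; exact cJ2) (off_ne₅ (by decide)) hut
    rwa [show i + n - 1 + 2 = i + n + 1 by omega] at this
  have hR3 : u (i + n + 2) = t + ![3, 0] := by
    have := next_eq₅ (i := i + n) hu hJ (x := t + ![1, 0]) (y := t + ![3, 0]) (by rw [hR2, Sym2.eq_swap]; exact cJ2)
      (by rw [hR2]; exact cJ3) (off_ne₅ (by decide)) hR1
    exact this
  -- STEP 3: the `Q`-arc
  have hQ1 : u (i + n + 2 + 1) = W'.getVert 1 := by
    have := next_eq₅ (i := i + n + 1) hu hJ (x := t + ![2, 0]) (y := W'.getVert 1) (by rw [show i + n + 1 + 1 = i + n + 2 by omega, hR3, Sym2.eq_swap]; exact cJ3) ?_ ?_ hR2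
    · rwa [show i + n + 1 + 2 = i + n + 2 + 1 by omega] at this
    · rw [show i + n + 1 + 1 = i + n + 2 by omega, hR3]; have := hW'edge 0 (by omega); rwa [Walk.getVert_zero] at this
    · exact (fun he => h.f20.2 (he ▸ hW'v 1))
  have hQ_arc : ∀ k, k ≤ n - 2 → u (i + n + 2 + k) = W'.getVert k := fun k hk =>
    hu.follows_path hJ W' hW' hW'J (i := i + n + 2) hR3 (fun _ => hQ1) k (by omega)
  have huw : u (i + 2 * n) = t + ![2, -1] := by
    have := hQ_arc (n - 2) le_rfl
    rw [show i + n + 2 + (n - 2) = i + 2 * n by omega, ← hW'len, Walk.getVert_length] at this; exact this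
  have huw1 : u (i + 2 * n - 1) = W'.getVert (n - 3) := by
    have := hQ_arc (n - 3) (by omega); rwa [show i + n + 2 + (n - 3) = i + 2 * n - 1 by omega] at this
  have hW'last : s(t + ![2, -1], W'.getVert (n - 3)) ∈ J := by
    have := hW'edge (n - 3) (by omega)
    rw [show n - 3 + 1 = n - 2 by omega, ← hW'len, Walk.getVert_length, Sym2.eq_swap] at this
    exact this
  -- STEP 4: the upper connector
  have hL1 : u (i + 2 * n + 1) = t + ![1, -1] := by
    have := next_eq₅ (i := i + 2 * n - 1) hu hJ (x := W'.getVert (n - 3)) (y := t + ![1, -1]) (by rw [show i + 2 * n - 1 + 1 = i + 2 * n by omega, huw]; exact hW'last)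
      (by rw [show i + 2 * n - 1 + 1 = i + 2 * n by omega, huw, Sym2.eq_swap]; exact cJ6) (fun he => h.f11.2 (he ▸ hW'v (n - 3))) huw1
    rwa [show i + 2 * n - 1 + 2 = i + 2 * n + 1 by omega] at this
  have hL2 : u (i + 2 * n + 2) = t + ![0, -1] := by rw [show i + 2 * n + 2 = i + (2 * n + 2) by omega, hu.periodic, h0]
  -- the cut
  refine isHdCutTT_of_eqs_mirror t h1
    (by rw [show i + 1 + (n + 1) - 3 = i + n - 1 by omega, hut])
    (by rw [show i + 1 + (n + 1) - 2 = i + n by omega, hR1])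
    (by rw [show i + 1 + (n + 1) - 1 = i + n + 1 by omega, hR2])
    (by rw [show i + 1 + (n + 1) = i + n + 2 by omega, hR3])
    (by rw [show i + 1 + 2 * (n + 1) - 3 = i + 2 * n by omega, huw])
    (by rw [show i + 1 + 2 * (n + 1) - 2 = i + 2 * n + 1 by omega, hL1])
    (by rw [show i + 1 + 2 * (n + 1) - 1 = i + 2 * n + 2 by omega, hL2])
    ?_
  -- row separation: the left block (`P`-arc and lower connector) lies left of the right block (`Q`-arc and upper connector)
  intro a b ha1 ha2 hb1 hb2 hrow
  have haL : u a ∈ vertsOf P ∨ (u a = t + ![1, 0] ∨ u a = t + ![2, 0]) := by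
    rcases Nat.lt_or_ge a (i + n - 1 + 1) with hlt | hge
    · left
      have := hP_arc (a - (i + 1)) (by omega)
      rw [show i + 1 + (a - (i + 1)) = a by omega] at this
      rw [this]; exact hWv _
    · right
      rcases Nat.lt_or_ge a (i + n - 1 + 2) with h1' | h1'
      · left; rw [show a = i + n by omega]; exact hR1
      · right; rw [show a = i + n + 1 by omega]; exact hR2
  have hbR : u b ∈ vertsOf Q ∨ (u b = t + ![1, -1] ∨ u b = t + ![0, -1]) := by
    rcases Nat.lt_or_ge b (i + 2 * n + 1) with hlt | hge
    · left
      have := hQ_arc (b - (i + n + 2)) (by omega)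
      rw [show i + n + 2 + (b - (i + n + 2)) = b by omega] at this
      rw [this]; exact hW'v _
    · right
      rcases Nat.lt_or_ge b (i + 2 * n + 2) with h1' | h1'
      · left; rw [show b = i + 2 * n + 1 by omega]; exact hL1
      · right; rw [show b = i + 2 * n + 2 by omega]; exact hL2
  rcases haL with haP | hj <;> rcases hbR with hbQ | hj'
  · exact lt_of_lt_of_le (by omega) (hK1 _ haP _ hbQ (Or.inl hrow))
  · -- a `P`-site against an upper-connector site (row `t₁ + 1`): corridor against `w′ ∈ Q`; `t+(0,-1)`, `t+(−1,−1)` are off `P`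
    rcases hj' with hbE | hbE <;> rw [hbE] at hrow ⊢
    · have := hK1 _ haP _ wQ (by simp at hrow ⊢; omega); simp at this ⊢; omega
    · have := hK1 _ haP _ wQ (by simp at hrow ⊢; omega)
      simp at this hrow ⊢
      rcases lt_or_eq_of_le (show u a 0 ≤ t 0 by omega) with hlt | heq
      · omega
      · exact absurd haP (by rw [eq_off₅ (t := t) (x := u a) (a := 0) (b := -1) (by omega) (by omega)]; exact h.f01.1)
  · -- a lower-connector site against a `Q`-site (row `t₁`): corridor against `t ∈ P`; `t+(2,0)`, `t+(3,0)` are off `Q`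
    rcases hj with haE | haE <;> rw [haE] at hrow ⊢
    · have := hK1 _ tP _ hbQ (by simp at hrow ⊢; omega); simp at this ⊢; omega
    · have := hK1 _ tP _ hbQ (by simp at hrow ⊢; omega)
      simp at this hrow ⊢
      rcases lt_or_eq_of_le (show t 0 + 2 ≤ u b 0 by omega) with hlt | heq
      · omega
      · exact absurd hbQ (by rw [eq_off₅ (t := t) (x := u b) (a := 2) (b := 0) (by omega) (by omega)]; exact h.f20.2)
  · rcases hj with haE | haE <;> rcases hj' with hbE | hbE <;> rw [haE, hbE] at hrow ⊢ <;>
      (simp only [Pi.add_apply, uz0, uz1] at hrow ⊢; omega)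

/-- **A T3 decomposition, shape TT (`t+(−1,−1) ∈ P`, `t+(3,0) ∈ Q`), imposes, on the MIRROR `y ↦ −y` of the traversal, the BACKWARD horizontal cut `IsHdCutTT' (n + 1) u (i+1)` for every traversal of the
joined polygon with `u i = t + (-1,-1)`, `u (i+1) = t + (0,-1)`.** [cite: Hammond2015SAPJoining, §4.2 pp. 20–24 (arXiv v5: recognising the junction plaquette); Madras1995LatticeAnimalsExponent, §2] -/
theorem isHdCutTT'_of_isT5 (hjP : t + ![-1, -1] ∈ vertsOf P) (hjQ : t + ![3, 0] ∈ vertsOf Q) (hu : IsPolyTraversal brickWallGraph (hdJoin' t P Q) (2 * n + 2) u) {i : ℕ}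
    (h0 : u i = t + ![-1, -1]) (h1 : u (i + 1) = t + ![0, -1]) : IsHdCutTT' (n + 1) (fun k => ![u k 0, -(u k 1)]) (i + 1) := by
  classical
  have hdisj := disjoint_of_corridor (P := P) (Q := Q) hK1
  obtain ⟨hJ, -⟩ := h.isPolygon_join hP hQ hdisj
  set J := hdJoin' t P Q with hJdef
  have hpar := h.hpar
  have tP : t + ![0, 0] ∈ vertsOf P := tP₅ h
  have wQ : t + ![2, -1] ∈ vertsOf Q := wQ₅ h
  have cJ1 : s(t + ![0, 0], t + ![1, 0]) ∈ J := cJ1₅ h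
  have cJ2 : s(t + ![1, 0], t + ![2, 0]) ∈ J := cJ2₅ h
  have cJ3 : s(t + ![2, 0], t + ![3, 0]) ∈ J := cJ3₅ h
  have cJ4 : s(t + ![-1, -1], t + ![0, -1]) ∈ J := cJ4₅ h
  have cJ5 : s(t + ![0, -1], t + ![1, -1]) ∈ J := cJ5₅ h
  have cJ6 : s(t + ![1, -1], t + ![2, -1]) ∈ J := cJ6₅ h
  -- open `P` along `t+(−1,−1) – b – t`: the `P`-arc `W`
  have hpE : ∀ e ∈ (wPb₅ t hpar).edges, e ∈ P := fun e he => by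
    simp only [wPb₅, Walk.edges_cons, Walk.edges_nil, List.mem_cons, List.not_mem_nil, or_false] at he
    rcases he with rfl | rfl
    · exact h.hl
    · rw [Sym2.eq_swap]; exact forcedP₅ hP h hjP
  obtain ⟨W, hW, hWe, hWl, hWs⟩ := hP.exists_isPath_sdiff (wPb₅ t hpar) (by rw [Walk.isPath_def]; simp [wPb₅]) hpE
    (by simp [wPb₅]) (by simp [wPb₅]; omega)
  have hpl : (wPb₅ t hpar).length = 2 := by simp [wPb₅]
  have hWJ : ∀ e ∈ W.edges, e ∈ J := fun e he => by
    have hm : e ∈ P \ (wPb₅ t hpar).edges.toFinset := by rw [← hWe]; exact List.mem_toFinset.2 he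
    rw [Finset.mem_sdiff] at hm
    have hne : ¬ (e = s(t + ![0, 0], t + ![-1, 0]) ∨ e = s(t + ![-1, 0], t + ![-1, -1])) := by
      intro hh; apply hm.2
      simp only [wPb₅, Walk.edges_cons, Walk.edges_nil, List.toFinset_cons, List.toFinset_nil, Finset.mem_insert,
        Finset.notMem_empty, or_false]
      exact hh
    exact memJ_of_memP₅ hK1 h hm.1 (fun he' => hne (Or.inl he')) (fun _ he' => hne (Or.inr he'))
  have hWlen : W.length = n - 2 := by rw [hpl] at hWl; omega
  have hWv : ∀ k, W.getVert k ∈ vertsOf P := fun k => mem_vertsOf.2 ((hWs _).1 (W.getVert_mem_support k)).1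
  -- open `Q` along `t+(3,0) – c – w′`: the `Q`-arc `W'`
  have hqE : ∀ e ∈ (wQb₅ t hpar).edges, e ∈ Q := fun e he => by
    simp only [wQb₅, Walk.edges_cons, Walk.edges_nil, List.mem_cons, List.not_mem_nil, or_false] at he
    rcases he with rfl | rfl
    · rw [Sym2.eq_swap]; exact h.hr
    · rw [Sym2.eq_swap]; exact forcedQ₅ hQ h hjQ
  obtain ⟨W', hW', hW'e, hW'l, hW's⟩ := hQ.exists_isPath_sdiff (wQb₅ t hpar) (by rw [Walk.isPath_def]; simp [wQb₅]) hqE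
    (by simp [wQb₅]) (by simp [wQb₅]; omega)
  have hql : (wQb₅ t hpar).length = 2 := by simp [wQb₅]
  have hW'J : ∀ e ∈ W'.edges, e ∈ J := fun e he => by
    have hm : e ∈ Q \ (wQb₅ t hpar).edges.toFinset := by rw [← hW'e]; exact List.mem_toFinset.2 he
    rw [Finset.mem_sdiff] at hm
    have hne : ¬ (e = s(t + ![2, -1], t + ![3, -1]) ∨ e = s(t + ![3, -1], t + ![3, 0])) := by
      intro hh; apply hm.2
      simp only [wQb₅, Walk.edges_cons, Walk.edges_nil, List.toFinset_cons, List.toFinset_nil, Finset.mem_insert,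
        Finset.notMem_empty, or_false]
      exact hh
    exact memJ_of_memQ₅ hK1 h hm.1 (fun he' => hne (Or.inl (by rw [Sym2.eq_swap]; exact he')))
      (fun _ he' => hne (Or.inr (by rw [Sym2.eq_swap]; exact he')))
  have hW'len : W'.length = n - 2 := by rw [hql] at hW'l; omega
  have hW'v : ∀ k, W'.getVert k ∈ vertsOf Q := fun k => mem_vertsOf.2 ((hW's _).1 (W'.getVert_mem_support k)).1
  have hWedge : ∀ k, k < W.length → s(W.getVert k, W.getVert (k + 1)) ∈ J := fun k hk => hWJ _ (getVert_edge₅ W hk)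
  have hW'edge : ∀ k, k < W'.length → s(W'.getVert k, W'.getVert (k + 1)) ∈ J := fun k hk => hW'J _ (getVert_edge₅ W' hk)
  -- STEP 1: the upper connector `t+(0,-1) → t+(1,-1) → w′`
  have hL1 : u (i + 2) = t + ![1, -1] := by
    have := next_eq₅ (i := i) hu hJ (x := t + ![-1, -1]) (y := t + ![1, -1]) (by rw [h1, Sym2.eq_swap]; exact cJ4)
      (by rw [h1]; exact cJ5) (off_ne₅ (by decide)) h0
    exact this
  have hL2 : u (i + 3) = t + ![2, -1] := by
    have := next_eq₅ (i := i + 1) hu hJ (x := t + ![0, -1]) (y := t + ![2, -1]) (by rw [show i + 1 + 1 = i + 2 by omega, hL1, Sym2.eq_swap]; exact cJ5)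
      (by rw [show i + 1 + 1 = i + 2 by omega, hL1]; exact cJ6) (off_ne₅ (by decide)) h1
    rwa [show i + 1 + 2 = i + 3 by omega] at this
  -- STEP 2: the `Q`-arc backwards, `u (i+3+k) = W'_k`
  have hQ1 : u (i + 4) = W'.getVert 1 := by
    have := next_eq₅ (i := i + 2) hu hJ (x := t + ![1, -1]) (y := W'.getVert 1) (by rw [show i + 2 + 1 = i + 3 by omega, hL2, Sym2.eq_swap]; exact cJ6) ?_ ?_ hL1
    · rwa [show i + 2 + 2 = i + 4 by omega] at this
    · rw [show i + 2 + 1 = i + 3 by omega, hL2]; have := hW'edge 0 (by omega); rwa [Walk.getVert_zero] at this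
    · exact (fun he => h.f11.2 (he ▸ hW'v 1))
  have hQ_arc : ∀ k, k ≤ n - 2 → u (i + 3 + k) = W'.getVert k := fun k hk =>
    hu.follows_path hJ W' hW' hW'J (i := i + 3) hL2 (fun _ => by rw [show i + 3 + 1 = i + 4 by omega]; exact hQ1) k (by omega)
  have huR0 : u (i + n + 1) = t + ![3, 0] := by
    have := hQ_arc (n - 2) le_rfl
    rw [show i + 3 + (n - 2) = i + n + 1 by omega, ← hW'len, Walk.getVert_length] at this; exact this
  have huR01 : u (i + n) = W'.getVert (n - 3) := by
    have := hQ_arc (n - 3) (by omega); rwa [show i + 3 + (n - 3) = i + n by omega] at this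
  have hW'last : s(t + ![3, 0], W'.getVert (n - 3)) ∈ J := by
    have := hW'edge (n - 3) (by omega)
    rw [show n - 3 + 1 = n - 2 by omega, ← hW'len, Walk.getVert_length, Sym2.eq_swap] at this
    exact this
  -- STEP 3: the lower connector backwards
  have hR1 : u (i + n + 2) = t + ![2, 0] := by
    have := next_eq₅ (i := i + n) hu hJ (x := W'.getVert (n - 3)) (y := t + ![2, 0]) (by rw [huR0]; exact hW'last)
      (by rw [huR0, Sym2.eq_swap]; exact cJ3) (fun he => h.f20.2 (he ▸ hW'v (n - 3))) huR01
    exact this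
  have hR2 : u (i + n + 3) = t + ![1, 0] := by
    have := next_eq₅ (i := i + n + 1) hu hJ (x := t + ![3, 0]) (y := t + ![1, 0]) (by rw [show i + n + 1 + 1 = i + n + 2 by omega, hR1]; exact cJ3)
      (by rw [show i + n + 1 + 1 = i + n + 2 by omega, hR1, Sym2.eq_swap]; exact cJ2) (off_ne₅ (by decide)) huR0
    rwa [show i + n + 1 + 2 = i + n + 3 by omega] at this
  have hR3 : u (i + n + 4) = t + ![0, 0] := by
    have := next_eq₅ (i := i + n + 2) hu hJ (x := t + ![2, 0]) (y := t + ![0, 0]) (by rw [show i + n + 2 + 1 = i + n + 3 by omega, hR2]; exact cJ2)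
      (by rw [show i + n + 2 + 1 = i + n + 3 by omega, hR2, Sym2.eq_swap]; exact cJ1) (off_ne₅ (by decide)) hR1
    rwa [show i + n + 2 + 2 = i + n + 4 by omega] at this
  -- STEP 4: the `P`-arc backwards
  have hP1 : u (i + n + 4 + 1) = W.getVert 1 := by
    have := next_eq₅ (i := i + n + 3) hu hJ (x := t + ![1, 0]) (y := W.getVert 1) (by rw [show i + n + 3 + 1 = i + n + 4 by omega, hR3]; exact cJ1) ?_ ?_ hR2
    · rwa [show i + n + 3 + 2 = i + n + 4 + 1 by omega] at this
    · rw [show i + n + 3 + 1 = i + n + 4 by omega, hR3]; have := hWedge 0 (by omega); rwa [Walk.getVert_zero] at this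
    · exact (fun he => h.f10.1 (he ▸ hWv 1))
  have hP_arc : ∀ k, k ≤ n - 2 → u (i + n + 4 + k) = W.getVert k := fun k hk =>
    hu.follows_path hJ W hW hWJ (i := i + n + 4) hR3 (fun _ => hP1) k (by omega)
  have huend : u (i + (2 * n + 2)) = t + ![-1, -1] := by
    have := hP_arc (n - 2) le_rfl
    rw [show i + n + 4 + (n - 2) = i + (2 * n + 2) by omega, ← hWlen, Walk.getVert_length] at this; exact this
  -- the backward cut
  refine isHdCutTT'_of_eqs_mirror t h1
    (by rw [show i + 1 + 1 = i + 2 by omega, hL1])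
    (by rw [show i + 1 + 2 = i + 3 by omega, hL2])
    (by rw [show i + 1 + (n + 1) - 1 = i + n + 1 by omega, huR0])
    (by rw [show i + 1 + (n + 1) = i + n + 2 by omega, hR1])
    (by rw [show i + 1 + (n + 1) + 1 = i + n + 3 by omega, hR2])
    (by rw [show i + 1 + (n + 1) + 2 = i + n + 4 by omega, hR3])
    (by rw [show i + 1 + 2 * (n + 1) - 1 = i + (2 * n + 2) by omega, huend])
    ?_
  -- row separation: the first block (upper connector, `Q`-arc) lies right of the second (lower connector, `P`-arc)
  intro a b ha1 ha2 hb1 hb2 hrow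
  have haR : u a ∈ vertsOf Q ∨ (u a = t + ![0, -1] ∨ u a = t + ![1, -1]) := by
    rcases Nat.lt_or_ge a (i + 3) with hlt | hge
    · right
      rcases Nat.lt_or_ge a (i + 2) with h1' | h1'
      · left; rw [show a = i + 1 by omega]; exact h1
      · right; rw [show a = i + 2 by omega]; exact hL1
    · left
      have := hQ_arc (a - (i + 3)) (by omega)
      rw [show i + 3 + (a - (i + 3)) = a by omega] at this
      rw [this]; exact hW'v _
  have hbL : u b ∈ vertsOf P ∨ (u b = t + ![2, 0] ∨ u b = t + ![1, 0]) := by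
    rcases Nat.lt_or_ge b (i + n + 4) with hlt | hge
    · right
      rcases Nat.lt_or_ge b (i + n + 3) with h1' | h1'
      · left; rw [show b = i + n + 2 by omega]; exact hR1
      · right; rw [show b = i + n + 3 by omega]; exact hR2
    · left
      have := hP_arc (b - (i + n + 4)) (by omega)
      rw [show i + n + 4 + (b - (i + n + 4)) = b by omega] at this
      rw [this]; exact hWv _
  rcases haR with haQ | hj <;> rcases hbL with hbP | hj'
  · exact lt_of_lt_of_le (by omega) (hK1 _ hbP _ haQ (Or.inl hrow.symm))
  · -- a `Q`-site against a lower-connector site (row `t₁`): corridor against `t ∈ P`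
    rcases hj' with hbE | hbE <;> rw [hbE] at hrow ⊢
    · have := hK1 _ tP _ haQ (by simp at hrow ⊢; omega)
      simp at this hrow ⊢
      rcases lt_or_eq_of_le (show t 0 + 2 ≤ u a 0 by omega) with hlt | heq
      · omega
      · exact absurd haQ (by rw [eq_off₅ (t := t) (x := u a) (a := 2) (b := 0) (by omega) (by omega)]; exact h.f20.2)
    · have := hK1 _ tP _ haQ (by simp at hrow ⊢; omega); simp at this ⊢; omega
  · -- an upper-connector site against a `P`-site (row `t₁ + 1`): corridor against `w′ ∈ Q`
    rcases hj with haE | haE <;> rw [haE] at hrow ⊢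
    · have := hK1 _ hbP _ wQ (by simp at hrow ⊢; omega)
      simp at this hrow ⊢
      rcases lt_or_eq_of_le (show u b 0 ≤ t 0 by omega) with hlt | heq
      · omega
      · exact absurd hbP (by rw [eq_off₅ (t := t) (x := u b) (a := 0) (b := -1) (by omega) (by omega)]; exact h.f01.1)
    · have := hK1 _ hbP _ wQ (by simp at hrow ⊢; omega); simp at this ⊢; omega
  · rcases hj with haE | haE <;> rcases hj' with hbE | hbE <;> rw [haE, hbE] at hrow ⊢ <;>
      (simp only [Pi.add_apply, uz0, uz1] at hrow ⊢; omega)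

end Bridge


/-! ### Same polygon, two T5 decompositions -/

/-- periodicity downwards (private plumbing). [cite: Hammond2015SAPJoining, Definition 4.3 p. 20 (arXiv v5)] -/
private theorem isHdCut_sub_period₅ {M j : ℕ} {v : ℕ → Site 2} (hM : 5 ≤ M) (hper : ∀ i, v (i + 2 * M) = v i)
    (h : IsHdCut M v (j + 2 * M)) : IsHdCut M v j := by
  have h' : IsHdCut M (fun i => v (i + 2 * M)) j := isHdCut_shift hM (by rw [Nat.add_comm]; exact h)
  simp only [hper] at h'
  exact h'

/-- periodicity downwards (private plumbing). [cite: Hammond2015SAPJoining, Definition 4.3 p. 20 (arXiv v5)] -/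
private theorem isHdCut'_sub_period₅ {M j : ℕ} {v : ℕ → Site 2} (hM : 5 ≤ M) (hper : ∀ i, v (i + 2 * M) = v i)
    (h : IsHdCut' M v (j + 2 * M)) : IsHdCut' M v j := by
  have h' : IsHdCut' M (fun i => v (i + 2 * M)) j := isHdCut'_shift hM (by rw [Nat.add_comm]; exact h)
  simp only [hper] at h'
  exact h'

/-- periodicity downwards (private plumbing). [cite: Hammond2015SAPJoining, Definition 4.3 p. 20 (arXiv v5)] -/
private theorem isHdCutTF_sub_period₅ {M j : ℕ} {v : ℕ → Site 2} (hM : 5 ≤ M) (hper : ∀ i, v (i + 2 * M) = v i)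
    (h : IsHdCutTF M v (j + 2 * M)) : IsHdCutTF M v j := by
  have h' : IsHdCutTF M (fun i => v (i + 2 * M)) j := isHdCutTF_shift hM (by rw [Nat.add_comm]; exact h)
  simp only [hper] at h'
  exact h'

/-- periodicity downwards (private plumbing). [cite: Hammond2015SAPJoining, Definition 4.3 p. 20 (arXiv v5)] -/
private theorem isHdCutTF'_sub_period₅ {M j : ℕ} {v : ℕ → Site 2} (hM : 5 ≤ M) (hper : ∀ i, v (i + 2 * M) = v i)
    (h : IsHdCutTF' M v (j + 2 * M)) : IsHdCutTF' M v j := by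
  have h' : IsHdCutTF' M (fun i => v (i + 2 * M)) j := isHdCutTF'_shift hM (by rw [Nat.add_comm]; exact h)
  simp only [hper] at h'
  exact h'

/-- periodicity downwards (private plumbing). [cite: Hammond2015SAPJoining, Definition 4.3 p. 20 (arXiv v5)] -/
private theorem isHdCutFT_sub_period₅ {M j : ℕ} {v : ℕ → Site 2} (hM : 5 ≤ M) (hper : ∀ i, v (i + 2 * M) = v i)
    (h : IsHdCutFT M v (j + 2 * M)) : IsHdCutFT M v j := by
  have h' : IsHdCutFT M (fun i => v (i + 2 * M)) j := isHdCutFT_shift hM (by rw [Nat.add_comm]; exact h)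
  simp only [hper] at h'
  exact h'

/-- periodicity downwards (private plumbing). [cite: Hammond2015SAPJoining, Definition 4.3 p. 20 (arXiv v5)] -/
private theorem isHdCutFT'_sub_period₅ {M j : ℕ} {v : ℕ → Site 2} (hM : 5 ≤ M) (hper : ∀ i, v (i + 2 * M) = v i)
    (h : IsHdCutFT' M v (j + 2 * M)) : IsHdCutFT' M v j := by
  have h' : IsHdCutFT' M (fun i => v (i + 2 * M)) j := isHdCutFT'_shift hM (by rw [Nat.add_comm]; exact h)
  simp only [hper] at h'
  exact h'

/-- periodicity downwards (private plumbing). [cite: Hammond2015SAPJoining, Definition 4.3 p. 20 (arXiv v5)] -/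
private theorem isHdCutTT_sub_period₅ {M j : ℕ} {v : ℕ → Site 2} (hM : 4 ≤ M) (hper : ∀ i, v (i + 2 * M) = v i)
    (h : IsHdCutTT M v (j + 2 * M)) : IsHdCutTT M v j := by
  have h' : IsHdCutTT M (fun i => v (i + 2 * M)) j := isHdCutTT_shift hM (by rw [Nat.add_comm]; exact h)
  simp only [hper] at h'
  exact h'

/-- periodicity downwards (private plumbing). [cite: Hammond2015SAPJoining, Definition 4.3 p. 20 (arXiv v5)] -/
private theorem isHdCutTT'_sub_period₅ {M j : ℕ} {v : ℕ → Site 2} (hM : 4 ≤ M) (hper : ∀ i, v (i + 2 * M) = v i)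
    (h : IsHdCutTT' M v (j + 2 * M)) : IsHdCutTT' M v j := by
  have h' : IsHdCutTT' M (fun i => v (i + 2 * M)) j := isHdCutTT'_shift hM (by rw [Nat.add_comm]; exact h)
  simp only [hper] at h'
  exact h'

/-- **Junction uniqueness for the reflected horizontal double brick, same polygon, shape FF** (`d = 0`): two T3 decompositions of the same joined
polygon of corridor-separated `n`-gon pairs, (mirrored traversal), both of shape FF, have the same contact site.
[cite: Hammond2015SAPJoining, §4.2 pp. 20–24 (arXiv v5: the junction plaquette is determined); Madras1995LatticeAnimalsExponent, §2] -/
theorem hdJoin'_site_unique_FF {P' Q' : Finset (Sym2 (Site 2))} {t' : Site 2}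
    (hP : IsPolygon brickWallGraph P) (hQ : IsPolygon brickWallGraph Q) (hP' : IsPolygon brickWallGraph P') (hQ' : IsPolygon brickWallGraph Q')
    (hPn : #P = n) (hQn : #Q = n) (hP'n : #P' = n) (hQ'n : #Q' = n) (hn : 3 ≤ n) (hK1 : Corridor P Q) (hK1' : Corridor P' Q')
    (h : IsT5 P Q t) (h' : IsT5 P' Q' t') (hjP : t + ![-1, -1] ∉ vertsOf P) (hjP' : t' + ![-1, -1] ∉ vertsOf P')
    (hjQ : t + ![3, 0] ∉ vertsOf Q) (hjQ' : t' + ![3, 0] ∉ vertsOf Q') (hJ : hdJoin' t' P' Q' = hdJoin' t P Q) : t' = t := by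
  classical
  have hdisj := disjoint_of_corridor (P := P) (Q := Q) hK1
  obtain ⟨hJpoly, hJc⟩ := h.isPolygon_join hP hQ hdisj
  have hcard : #(hdJoin' t P Q) = 2 * n + 6 := by rw [if_neg hjP, if_neg hjQ, hPn, hQn] at hJc; omega
  have cA : s(t + ![-1, -1], t + ![-1, 0]) ∈ hdJoin' t P Q := by rw [Sym2.eq_swap]; exact cJb₅ h hjP
  obtain ⟨u, hu, hu0, hu1⟩ := hJpoly.exists_isPolyTraversal cA
  rw [hcard] at hu
  -- the mirrored traversal
  set v : ℕ → Site 2 := fun k => ![u k 0, -(u k 1)] with hv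
  have hrowu : ∀ i, u (i + 1) 1 ≤ u i 1 + 1 ∧ u i 1 ≤ u (i + 1) 1 + 1 := row_step_le_of_adj hu.adj
  have hrow : ∀ i, v (i + 1) 1 ≤ v i 1 + 1 ∧ v i 1 ≤ v (i + 1) 1 + 1 := fun i => by
    have := hrowu i; simp only [hv, uz1]; omega
  have hper : ∀ i, v (i + 2 * (n + 3)) = v i := fun i => by
    simp only [hv, show 2 * (n + 3) = 2 * n + 6 by ring, hu.periodic]
  -- cut of decomposition 1 at index 1
  have cut1 := isHdCut_of_isT5 hP hQ hPn hQn hn hK1 h hjP hjQ hu (i := 0) hu0 (by simpa using hu1)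
  simp only [Nat.zero_add] at cut1
  -- locate decomposition 2's anchor bond on the traversal
  have cA' : s(t' + ![-1, -1], t' + ![-1, 0]) ∈ hdJoin' t P Q := by rw [← hJ, Sym2.eq_swap]; exact cJb₅ h' hjP'
  obtain ⟨i, hi, hie⟩ := hu.surj _ cA'
  have hu' : IsPolyTraversal brickWallGraph (hdJoin' t' P' Q') (2 * n + 6) u := by rw [hJ]; exact hu
  rcases Sym2.eq_iff.1 hie with ⟨ha, hb⟩ | ⟨ha, hb⟩
  · -- same orientation: forward cut at `i + 1`; uniqueness forces `i = 0`
    have cut2 := isHdCut_of_isT5 hP' hQ' hP'n hQ'n hn hK1' h' hjP' hjQ' hu' (i := i) ha hb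
    rcases Nat.lt_or_ge (i + 1) (2 * (n + 3)) with hlt | hge
    · have := isHdCut_unique (by omega) hper hrow (by omega) hlt cut1 cut2
      have e : u 1 = u (i + 1) := by rw [← this]
      rw [hu1, hb] at e
      exact (add_right_cancel e).symm
    · have hi' : i + 1 = 0 + 2 * (n + 3) := by omega
      rw [hi'] at cut2
      have := isHdCut_unique (by omega) hper hrow (by omega) (by omega) cut1 (isHdCut_sub_period₅ (by omega) hper cut2)
      omega
  · -- opposite orientation: a backward cut at `i + 1` next to the forward cut at `1` — impossible
    exfalso
    have cut2 := isHdCut'_of_isT5 hP' hQ' hP'n hQ'n hn hK1' h' hjP' hjQ' hu' (i := i) ha hb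
    rcases Nat.lt_or_ge (i + 1) (2 * (n + 3)) with hlt | hge
    · exact not_isHdCut'_of_isHdCut (by omega) hper hrow (by omega) hlt cut1 cut2
    · have hi' : i + 1 = 0 + 2 * (n + 3) := by omega
      rw [hi'] at cut2
      exact not_isHdCut'_of_isHdCut (by omega) hper hrow (by omega) (by omega) cut1 (isHdCut'_sub_period₅ (by omega) hper cut2)

/-- **Junction uniqueness for the reflected horizontal double brick, same polygon, shape TF** (`d = 0`): two T3 decompositions of the same joined
polygon of corridor-separated `n`-gon pairs, (mirrored traversal), both of shape TF, have the same contact site.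
[cite: Hammond2015SAPJoining, §4.2 pp. 20–24 (arXiv v5: the junction plaquette is determined); Madras1995LatticeAnimalsExponent, §2] -/
theorem hdJoin'_site_unique_TF {P' Q' : Finset (Sym2 (Site 2))} {t' : Site 2}
    (hP : IsPolygon brickWallGraph P) (hQ : IsPolygon brickWallGraph Q) (hP' : IsPolygon brickWallGraph P') (hQ' : IsPolygon brickWallGraph Q')
    (hPn : #P = n) (hQn : #Q = n) (hP'n : #P' = n) (hQ'n : #Q' = n) (hn : 3 ≤ n) (hK1 : Corridor P Q) (hK1' : Corridor P' Q')
    (h : IsT5 P Q t) (h' : IsT5 P' Q' t') (hjP : t + ![-1, -1] ∈ vertsOf P) (hjP' : t' + ![-1, -1] ∈ vertsOf P')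
    (hjQ : t + ![3, 0] ∉ vertsOf Q) (hjQ' : t' + ![3, 0] ∉ vertsOf Q') (hJ : hdJoin' t' P' Q' = hdJoin' t P Q) : t' = t := by
  classical
  have hdisj := disjoint_of_corridor (P := P) (Q := Q) hK1
  obtain ⟨hJpoly, hJc⟩ := h.isPolygon_join hP hQ hdisj
  have hcard : #(hdJoin' t P Q) = 2 * n + 4 := by rw [if_pos hjP, if_neg hjQ, hPn, hQn] at hJc; omega
  have cA : s(t + ![0, -1], t + ![-1, -1]) ∈ hdJoin' t P Q := by rw [Sym2.eq_swap]; exact cJ4₅ h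
  obtain ⟨u, hu, hu0, hu1⟩ := hJpoly.exists_isPolyTraversal cA
  rw [hcard] at hu
  -- the mirrored traversal
  set v : ℕ → Site 2 := fun k => ![u k 0, -(u k 1)] with hv
  have hrowu : ∀ i, u (i + 1) 1 ≤ u i 1 + 1 ∧ u i 1 ≤ u (i + 1) 1 + 1 := row_step_le_of_adj hu.adj
  have hrow : ∀ i, v (i + 1) 1 ≤ v i 1 + 1 ∧ v i 1 ≤ v (i + 1) 1 + 1 := fun i => by
    have := hrowu i; simp only [hv, uz1]; omega
  have hper : ∀ i, v (i + 2 * (n + 2)) = v i := fun i => by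
    simp only [hv, show 2 * (n + 2) = 2 * n + 4 by ring, hu.periodic]
  -- cut of decomposition 1 at index 1
  have cut1 := isHdCutTF_of_isT5 hP hQ hPn hQn hn hK1 h hjP hjQ hu (i := 0) hu0 (by simpa using hu1)
  simp only [Nat.zero_add] at cut1
  -- locate decomposition 2's anchor bond on the traversal
  have cA' : s(t' + ![0, -1], t' + ![-1, -1]) ∈ hdJoin' t P Q := by rw [← hJ, Sym2.eq_swap]; exact cJ4₅ h'
  obtain ⟨i, hi, hie⟩ := hu.surj _ cA'
  have hu' : IsPolyTraversal brickWallGraph (hdJoin' t' P' Q') (2 * n + 4) u := by rw [hJ]; exact hu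
  rcases Sym2.eq_iff.1 hie with ⟨ha, hb⟩ | ⟨ha, hb⟩
  · -- same orientation: forward cut at `i + 1`; uniqueness forces `i = 0`
    have cut2 := isHdCutTF_of_isT5 hP' hQ' hP'n hQ'n hn hK1' h' hjP' hjQ' hu' (i := i) ha hb
    rcases Nat.lt_or_ge (i + 1) (2 * (n + 2)) with hlt | hge
    · have := isHdCutTF_unique (by omega) hper hrow (by omega) hlt cut1 cut2
      have e : u 1 = u (i + 1) := by rw [← this]
      rw [hu1, hb] at e
      exact (add_right_cancel e).symm
    · have hi' : i + 1 = 0 + 2 * (n + 2) := by omega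
      rw [hi'] at cut2
      have := isHdCutTF_unique (by omega) hper hrow (by omega) (by omega) cut1 (isHdCutTF_sub_period₅ (by omega) hper cut2)
      omega
  · -- opposite orientation: a backward cut at `i + 1` next to the forward cut at `1` — impossible
    exfalso
    have cut2 := isHdCutTF'_of_isT5 hP' hQ' hP'n hQ'n hn hK1' h' hjP' hjQ' hu' (i := i) ha hb
    rcases Nat.lt_or_ge (i + 1) (2 * (n + 2)) with hlt | hge
    · exact not_isHdCutTF'_of_isHdCutTF (by omega) hper hrow (by omega) hlt cut1 cut2
    · have hi' : i + 1 = 0 + 2 * (n + 2) := by omega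
      rw [hi'] at cut2
      exact not_isHdCutTF'_of_isHdCutTF (by omega) hper hrow (by omega) (by omega) cut1 (isHdCutTF'_sub_period₅ (by omega) hper cut2)

/-- **Junction uniqueness for the reflected horizontal double brick, same polygon, shape FT** (`d = 0`): two T3 decompositions of the same joined
polygon of corridor-separated `n`-gon pairs, (mirrored traversal), both of shape FT, have the same contact site.
[cite: Hammond2015SAPJoining, §4.2 pp. 20–24 (arXiv v5: the junction plaquette is determined); Madras1995LatticeAnimalsExponent, §2] -/
theorem hdJoin'_site_unique_FT {P' Q' : Finset (Sym2 (Site 2))} {t' : Site 2}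
    (hP : IsPolygon brickWallGraph P) (hQ : IsPolygon brickWallGraph Q) (hP' : IsPolygon brickWallGraph P') (hQ' : IsPolygon brickWallGraph Q')
    (hPn : #P = n) (hQn : #Q = n) (hP'n : #P' = n) (hQ'n : #Q' = n) (hn : 3 ≤ n) (hK1 : Corridor P Q) (hK1' : Corridor P' Q')
    (h : IsT5 P Q t) (h' : IsT5 P' Q' t') (hjP : t + ![-1, -1] ∉ vertsOf P) (hjP' : t' + ![-1, -1] ∉ vertsOf P')
    (hjQ : t + ![3, 0] ∈ vertsOf Q) (hjQ' : t' + ![3, 0] ∈ vertsOf Q') (hJ : hdJoin' t' P' Q' = hdJoin' t P Q) : t' = t := by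
  classical
  have hdisj := disjoint_of_corridor (P := P) (Q := Q) hK1
  obtain ⟨hJpoly, hJc⟩ := h.isPolygon_join hP hQ hdisj
  have hcard : #(hdJoin' t P Q) = 2 * n + 4 := by rw [if_neg hjP, if_pos hjQ, hPn, hQn] at hJc; omega
  have cA : s(t + ![-1, -1], t + ![-1, 0]) ∈ hdJoin' t P Q := by rw [Sym2.eq_swap]; exact cJb₅ h hjP
  obtain ⟨u, hu, hu0, hu1⟩ := hJpoly.exists_isPolyTraversal cA
  rw [hcard] at hu
  -- the mirrored traversal
  set v : ℕ → Site 2 := fun k => ![u k 0, -(u k 1)] with hv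
  have hrowu : ∀ i, u (i + 1) 1 ≤ u i 1 + 1 ∧ u i 1 ≤ u (i + 1) 1 + 1 := row_step_le_of_adj hu.adj
  have hrow : ∀ i, v (i + 1) 1 ≤ v i 1 + 1 ∧ v i 1 ≤ v (i + 1) 1 + 1 := fun i => by
    have := hrowu i; simp only [hv, uz1]; omega
  have hper : ∀ i, v (i + 2 * (n + 2)) = v i := fun i => by
    simp only [hv, show 2 * (n + 2) = 2 * n + 4 by ring, hu.periodic]
  -- cut of decomposition 1 at index 1
  have cut1 := isHdCutFT_of_isT5 hP hQ hPn hQn hn hK1 h hjP hjQ hu (i := 0) hu0 (by simpa using hu1)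
  simp only [Nat.zero_add] at cut1
  -- locate decomposition 2's anchor bond on the traversal
  have cA' : s(t' + ![-1, -1], t' + ![-1, 0]) ∈ hdJoin' t P Q := by rw [← hJ, Sym2.eq_swap]; exact cJb₅ h' hjP'
  obtain ⟨i, hi, hie⟩ := hu.surj _ cA'
  have hu' : IsPolyTraversal brickWallGraph (hdJoin' t' P' Q') (2 * n + 4) u := by rw [hJ]; exact hu
  rcases Sym2.eq_iff.1 hie with ⟨ha, hb⟩ | ⟨ha, hb⟩
  · -- same orientation: forward cut at `i + 1`; uniqueness forces `i = 0`
    have cut2 := isHdCutFT_of_isT5 hP' hQ' hP'n hQ'n hn hK1' h' hjP' hjQ' hu' (i := i) ha hb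
    rcases Nat.lt_or_ge (i + 1) (2 * (n + 2)) with hlt | hge
    · have := isHdCutFT_unique (by omega) hper hrow (by omega) hlt cut1 cut2
      have e : u 1 = u (i + 1) := by rw [← this]
      rw [hu1, hb] at e
      exact (add_right_cancel e).symm
    · have hi' : i + 1 = 0 + 2 * (n + 2) := by omega
      rw [hi'] at cut2
      have := isHdCutFT_unique (by omega) hper hrow (by omega) (by omega) cut1 (isHdCutFT_sub_period₅ (by omega) hper cut2)
      omega
  · -- opposite orientation: a backward cut at `i + 1` next to the forward cut at `1` — impossible
    exfalso
    have cut2 := isHdCutFT'_of_isT5 hP' hQ' hP'n hQ'n hn hK1' h' hjP' hjQ' hu' (i := i) ha hb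
    rcases Nat.lt_or_ge (i + 1) (2 * (n + 2)) with hlt | hge
    · exact not_isHdCutFT'_of_isHdCutFT (by omega) hper hrow (by omega) hlt cut1 cut2
    · have hi' : i + 1 = 0 + 2 * (n + 2) := by omega
      rw [hi'] at cut2
      exact not_isHdCutFT'_of_isHdCutFT (by omega) hper hrow (by omega) (by omega) cut1 (isHdCutFT'_sub_period₅ (by omega) hper cut2)

/-- **Junction uniqueness for the reflected horizontal double brick, same polygon, shape TT** (`d = 0`): two T3 decompositions of the same joined
polygon of corridor-separated `n`-gon pairs, (mirrored traversal), both of shape TT, have the same contact site.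
[cite: Hammond2015SAPJoining, §4.2 pp. 20–24 (arXiv v5: the junction plaquette is determined); Madras1995LatticeAnimalsExponent, §2] -/
theorem hdJoin'_site_unique_TT {P' Q' : Finset (Sym2 (Site 2))} {t' : Site 2}
    (hP : IsPolygon brickWallGraph P) (hQ : IsPolygon brickWallGraph Q) (hP' : IsPolygon brickWallGraph P') (hQ' : IsPolygon brickWallGraph Q')
    (hPn : #P = n) (hQn : #Q = n) (hP'n : #P' = n) (hQ'n : #Q' = n) (hn : 3 ≤ n) (hK1 : Corridor P Q) (hK1' : Corridor P' Q')
    (h : IsT5 P Q t) (h' : IsT5 P' Q' t') (hjP : t + ![-1, -1] ∈ vertsOf P) (hjP' : t' + ![-1, -1] ∈ vertsOf P')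
    (hjQ : t + ![3, 0] ∈ vertsOf Q) (hjQ' : t' + ![3, 0] ∈ vertsOf Q') (hJ : hdJoin' t' P' Q' = hdJoin' t P Q) : t' = t := by
  classical
  have hdisj := disjoint_of_corridor (P := P) (Q := Q) hK1
  obtain ⟨hJpoly, hJc⟩ := h.isPolygon_join hP hQ hdisj
  have hcard : #(hdJoin' t P Q) = 2 * n + 2 := by rw [if_pos hjP, if_pos hjQ, hPn, hQn] at hJc; omega
  have cA : s(t + ![0, -1], t + ![-1, -1]) ∈ hdJoin' t P Q := by rw [Sym2.eq_swap]; exact cJ4₅ h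
  obtain ⟨u, hu, hu0, hu1⟩ := hJpoly.exists_isPolyTraversal cA
  rw [hcard] at hu
  -- the mirrored traversal
  set v : ℕ → Site 2 := fun k => ![u k 0, -(u k 1)] with hv
  have hrowu : ∀ i, u (i + 1) 1 ≤ u i 1 + 1 ∧ u i 1 ≤ u (i + 1) 1 + 1 := row_step_le_of_adj hu.adj
  have hrow : ∀ i, v (i + 1) 1 ≤ v i 1 + 1 ∧ v i 1 ≤ v (i + 1) 1 + 1 := fun i => by
    have := hrowu i; simp only [hv, uz1]; omega
  have hper : ∀ i, v (i + 2 * (n + 1)) = v i := fun i => by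
    simp only [hv, show 2 * (n + 1) = 2 * n + 2 by ring, hu.periodic]
  -- cut of decomposition 1 at index 1
  have cut1 := isHdCutTT_of_isT5 hP hQ hPn hQn hn hK1 h hjP hjQ hu (i := 0) hu0 (by simpa using hu1)
  simp only [Nat.zero_add] at cut1
  -- locate decomposition 2's anchor bond on the traversal
  have cA' : s(t' + ![0, -1], t' + ![-1, -1]) ∈ hdJoin' t P Q := by rw [← hJ, Sym2.eq_swap]; exact cJ4₅ h'
  obtain ⟨i, hi, hie⟩ := hu.surj _ cA'
  have hu' : IsPolyTraversal brickWallGraph (hdJoin' t' P' Q') (2 * n + 2) u := by rw [hJ]; exact hu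
  rcases Sym2.eq_iff.1 hie with ⟨ha, hb⟩ | ⟨ha, hb⟩
  · -- same orientation: forward cut at `i + 1`; uniqueness forces `i = 0`
    have cut2 := isHdCutTT_of_isT5 hP' hQ' hP'n hQ'n hn hK1' h' hjP' hjQ' hu' (i := i) ha hb
    rcases Nat.lt_or_ge (i + 1) (2 * (n + 1)) with hlt | hge
    · have := isHdCutTT_unique (by omega) hper hrow (by omega) hlt cut1 cut2
      have e : u 1 = u (i + 1) := by rw [← this]
      rw [hu1, hb] at e
      exact (add_right_cancel e).symm
    · have hi' : i + 1 = 0 + 2 * (n + 1) := by omega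
      rw [hi'] at cut2
      have := isHdCutTT_unique (by omega) hper hrow (by omega) (by omega) cut1 (isHdCutTT_sub_period₅ (by omega) hper cut2)
      omega
  · -- opposite orientation: a backward cut at `i + 1` next to the forward cut at `1` — impossible
    exfalso
    have cut2 := isHdCutTT'_of_isT5 hP' hQ' hP'n hQ'n hn hK1' h' hjP' hjQ' hu' (i := i) ha hb
    rcases Nat.lt_or_ge (i + 1) (2 * (n + 1)) with hlt | hge
    · exact not_isHdCutTT'_of_isHdCutTT (by omega) hper hrow (by omega) hlt cut1 cut2
    · have hi' : i + 1 = 0 + 2 * (n + 1) := by omega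
      rw [hi'] at cut2
      exact not_isHdCutTT'_of_isHdCutTT (by omega) hper hrow (by omega) (by omega) cut1 (isHdCutTT'_sub_period₅ (by omega) hper cut2)


/-- **Junction uniqueness for the reflected horizontal double brick, same polygon** (`d = 0`), the two decompositions having the same bits.
[cite: Hammond2015SAPJoining, §4.2 pp. 20–24 (arXiv v5: the junction plaquette is determined); Madras1995LatticeAnimalsExponent, §2] -/
theorem hdJoin'_site_unique {P' Q' : Finset (Sym2 (Site 2))} {t' : Site 2}
    (hP : IsPolygon brickWallGraph P) (hQ : IsPolygon brickWallGraph Q) (hP' : IsPolygon brickWallGraph P') (hQ' : IsPolygon brickWallGraph Q')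
    (hPn : #P = n) (hQn : #Q = n) (hP'n : #P' = n) (hQ'n : #Q' = n) (hn : 3 ≤ n) (hK1 : Corridor P Q) (hK1' : Corridor P' Q')
    (h : IsT5 P Q t) (h' : IsT5 P' Q' t') (hbP : t + ![-1, -1] ∈ vertsOf P ↔ t' + ![-1, -1] ∈ vertsOf P')
    (hbQ : t + ![3, 0] ∈ vertsOf Q ↔ t' + ![3, 0] ∈ vertsOf Q') (hJ : hdJoin' t' P' Q' = hdJoin' t P Q) : t' = t := by
  by_cases hjP : t + ![-1, -1] ∈ vertsOf P
  · by_cases hjQ : t + ![3, 0] ∈ vertsOf Q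
    · exact hdJoin'_site_unique_TT hP hQ hP' hQ' hPn hQn hP'n hQ'n hn hK1 hK1' h h' hjP (hbP.1 hjP) hjQ (hbQ.1 hjQ) hJ
    · exact hdJoin'_site_unique_TF hP hQ hP' hQ' hPn hQn hP'n hQ'n hn hK1 hK1' h h' hjP (hbP.1 hjP) hjQ (fun hh => hjQ (hbQ.2 hh)) hJ
  · by_cases hjQ : t + ![3, 0] ∈ vertsOf Q
    · exact hdJoin'_site_unique_FT hP hQ hP' hQ' hPn hQn hP'n hQ'n hn hK1 hK1' h h' hjP (fun hh => hjP (hbP.2 hh)) hjQ (hbQ.1 hjQ) hJ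
    · exact hdJoin'_site_unique_FF hP hQ hP' hQ' hPn hQn hP'n hQ'n hn hK1 hK1' h h' hjP (fun hh => hjP (hbP.2 hh)) hjQ
        (fun hh => hjQ (hbQ.2 hh)) hJ

/-! ### Translation and `JU5` -/

/-- a bond translated (private plumbing). [folklore] -/
private theorem mem_shift_of_mem₅ {E : Finset (Sym2 (Site 2))} {a b d : Site 2} (h : s(a, b) ∈ E) : s(a + d, b + d) ∈ shiftEdges d E :=
  mem_shiftEdges_iff.2 ⟨_, h, by rw [Sym2.map_mk]⟩

/-- offsets commute with the translation (private plumbing). [folklore] -/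
private theorem add_off₅ (t d v : Site 2) : t + d + v = t + v + d := add_right_comm t d v

/-- the corridor fact is translation-invariant (private copy of `Corridor.shift`). [cite: Hammond2015SAPJoining, §4.1 pp. 17–18 (arXiv v5)] -/
private theorem corridor_shift₅ (hK1 : Corridor P Q) (d : Site 2) : Corridor (shiftEdges d P) (shiftEdges d Q) := by
  intro p hp q hq hrow
  rw [mem_vertsOf_shiftEdges] at hp hq
  have := hK1 _ hp _ hq (by simp only [Pi.sub_apply]; omega)
  simp only [Pi.sub_apply] at this
  omega

/-- vertices of a translated edge set, offset form (private plumbing). [folklore] -/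
private theorem mem_vertsOf_shift_iff₅ {E : Finset (Sym2 (Site 2))} {v d : Site 2} :
    t + d + v ∈ vertsOf (shiftEdges d E) ↔ t + v ∈ vertsOf E := by
  rw [mem_vertsOf_shiftEdges, add_off₅, add_sub_cancel_right]

/-- The T3 bundle is covariant under EVEN translations. [cite: Hammond2015SAPJoining, Definition 4.3 p. 20 (arXiv v5)] -/
theorem isT5_shift (h : IsT5 P Q t) {d : Site 2} (hd : (d 0 + d 1) % 2 = 0) : IsT5 (shiftEdges d P) (shiftEdges d Q) (t + d) := by
  have nv : ∀ {E : Finset (Sym2 (Site 2))} {v : Site 2}, t + v ∉ vertsOf E → t + d + v ∉ vertsOf (shiftEdges d E) :=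
    fun {E} {v} hv hh => hv (mem_vertsOf_shift_iff₅.1 hh)
  refine ⟨?_, ?_, ?_, ⟨nv h.f10.1, nv h.f10.2⟩, ⟨nv h.f20.1, nv h.f20.2⟩, ⟨nv h.f01.1, nv h.f01.2⟩, ⟨nv h.f11.1, nv h.f11.2⟩, nv h.f30,
    nv h.fm1⟩
  · have := h.hpar; simp only [Pi.add_apply]; omega
  · rw [add_off₅, add_off₅ t d]; exact mem_shift_of_mem₅ h.hl
  · rw [add_off₅, add_off₅ t d]; exact mem_shift_of_mem₅ h.hr

/-- The reflected horizontal double-brick join is covariant under translations. [cite: Hammond2015SAPJoining, Definition 4.3 p. 20 (arXiv v5)] -/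
theorem hdJoin'_shift (P Q : Finset (Sym2 (Site 2))) (t d : Site 2) :
    hdJoin' (t + d) (shiftEdges d P) (shiftEdges d Q) = shiftEdges d (hdJoin' t P Q) := by
  classical
  rw [hdJoin', hdJoin', hdBoundary'_eq, hdBoundary'_eq, bdry_add]
  unfold shiftEdges
  rw [Finset.image_symmDiff _ _ (Sym2.map.injective (add_left_injective d)), Finset.image_union]

/-- **`JU5` holds**: junction uniqueness for the horizontal double-brick join (type T3, both sub-case bits shared). [cite: Hammond2015SAPJoining, §4.2 pp. 20–24 (arXiv v5: the junction plaquette is determined by the joined polygon); Madras1995LatticeAnimalsExponent, §2] -/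
theorem ju5 : JU5 := by
  intro P Q P' Q' t t' d n hP hQ hP' hQ' hPn hQn hP'n hQ'n hK1 hK1' h h' hbP hbQ hJ
  classical
  have hdisj := disjoint_of_corridor (P := P) (Q := Q) hK1
  have hn : 3 ≤ n := by
    obtain ⟨w, c, hc, hcE⟩ := hP
    rw [← hPn, ← hcE, List.toFinset_card_of_nodup hc.edges_nodup, Walk.length_edges]; exact hc.three_le_length
  by_cases hd : (d 0 + d 1) % 2 = 0
  · have hPd := PolygonConcat.isPolygon_shiftEdges_of_even hP hd
    have hQd := PolygonConcat.isPolygon_shiftEdges_of_even hQ hd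
    exact hdJoin'_site_unique (P := shiftEdges d P) (Q := shiftEdges d Q) (t := t + d) (n := n) hPd hQd hP' hQ'
      (by rw [card_shiftEdges, hPn]) (by rw [card_shiftEdges, hQn]) hP'n hQ'n hn (corridor_shift₅ hK1 d) hK1' (isT5_shift h hd) h'
      (mem_vertsOf_shift_iff₅.trans hbP) (mem_vertsOf_shift_iff₅.trans hbQ) (by rw [hJ, hdJoin'_shift])
  · -- `d` odd is impossible: the vertical bond `t – t−(0,-1)` of `P ⊆ J` would translate to a non-bond of the brick wall in `J'`
    exfalso
    have cv : s(t + ![0, 0], t + ![0, 1]) ∈ hdJoin' t P Q := tupJ₅ hP hK1 h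
    have hmemJ' : s(t + ![0, 0] + d, t + ![0, 1] + d) ∈ hdJoin' t' P' Q' := by rw [hJ]; exact mem_shift_of_mem₅ cv
    have hdisj' := disjoint_of_corridor (P := P') (Q := Q') hK1'
    have hJ'poly := (h'.isPolygon_join hP' hQ' hdisj').1
    have hadj : brickWallGraph.Adj (t + ![0, 0] + d) (t + ![0, 1] + d) := IsPolygon.mem_edgeSet hJ'poly hmemJ'
    rw [brickWallGraph_adj_coord] at hadj
    have ht := h.hpar
    simp only [Pi.add_apply] at hadj
    simp at hadj
    omega

end Assembly

end HexBW

end Literature.Probability.RandomPlanarGeometry.SAW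

end

/-! ## `_holds` aliases (appended 2026-08-28)

The named fact(s) below are already theorems of the tree under another name; the `_holds`
alias records the discharge under the tree's naming convention (D-0026 bookkeeping: proof term =
the existing theorem, no statement or definition edited). -/

/-- `JU5` is a theorem of the tree (`Literature.Probability.RandomPlanarGeometry.SAW.HexBW.Assembly.ju5`). [cite: Hammond2015SAPJoining, §4.2 pp. 20–24 (arXiv v5); Madras1995LatticeAnimalsExponent, §2] -/
theorem _root_.Literature.Probability.RandomPlanarGeometry.SAW.HexBW.Assembly.JU5_holds : _root_.Literature.Probability.RandomPlanarGeometry.SAW.HexBW.Assembly.JU5 :=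
  _root_.Literature.Probability.RandomPlanarGeometry.SAW.HexBW.Assembly.ju5
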